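import Mathlib.Analysis.SpecialFunctions.Trigonometric.Sinc
import Literature.NumberTheory.LFunctions.AlternativeHypothesisESHProofs
import Literature.NumberTheory.LFunctions.MontgomeryExplicitFormulaProofs
import Literature.NumberTheory.LFunctions.MontgomeryZeroSideProofs
import Literature.NumberTheory.LFunctions.MontgomeryDirichletSumMeanSquareProofs
import Literature.NumberTheory.LFunctions.RudnickSarnakPairRenormalise
import HarnessLib

/-!
# BGSTB 2025, Theorems 1 and 2 (and Corollaries 1–3) — proved

Topic `Literature/NumberTheory/LFunctions` (namespace `Literature.NumberTheory.LFunctions`; helpers in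
the sub-namespace `AH`). PROOF LAYER (no new definitions of record, no named facts), cell `rh-crit/ah`
(C5, seat t5). LABEL: **NOT RH-BEARING** — the theorem proved here is the CONDITIONAL
`RiemannHypothesis → AHPairs → …` exactly as typed in `AlternativeHypothesis.lean`
(`bgstb2025_theorem1`); RH and the Alternative Hypothesis (AH-Pairs) stay hypotheses and nothing here
bears on the truth of either.

S. A. C. Baluyot, D. A. Goldston, A. I. Suriajaya, C. L. Turnage-Butterbaugh, *The Alternative
Hypothesis for zeros of the Riemann zeta-function*, arXiv:2508.10857 (2025), **Theorem 1**: "Assume the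
Riemann Hypothesis and AH-Pairs. As `T → ∞`, `1 + o(1) ≤ P_0 ≤ 3/2 − 2/π² + o(1)`, and for
`k ∈ ℤ`, `k ≠ 0`, `P_{k/2} ∼ P_0 − ½` (`k` even), `P_{k/2} ∼ 3/2 − 2/(π²k²) − P_0` (`k` odd)."
We DISCHARGE the named claim `bgstb2025_theorem1` (`bgstb2025_theorem1_holds`) and, through the landed
glue, `bgstb2025_corollary1`, `bgstb2025_corollary1_of_one`, `bgstb2025_corollary2`,
`bgstb2025_corollary3` (`…_holds`); and (§H) **Theorem 2**: "Assume that the Riemann Hypothesis and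
the Strong AH-Pairs hold. Then `p_0 = lim_{T→∞} P_0 = 1`" — `bgstb2025_theorem2_holds :
bgstb2025_theorem2` (`RiemannHypothesis → StrongAHPairs → ∀ δ ∈ (0, 1/2], AH.HasLimitingDensity 0 δ 1`),
following the printed proof of §4 of the source.

## The printed proof (§3 of the source) and how it is followed

* **(MT-Pairs)**, second display, in `o(1)` form: for `g = g_n`,
  `∑_{0<γ,γ'≤T} ĝ(((γ−γ')/2π) log T) w(γ−γ') = ((T/2π) log T)(g(0) + 2∫₀¹ α g(α) dα + o(1))`
  (`AH.tendsto_sum_gHat_div`). The first display (the finite-sum/integral exchange) is the tree's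
  `AH.sum_fourier_pairSpacing_eq_integral`; Montgomery's theorem on `|α| ≤ 1 − δ` is the tree's PROVED
  `montgomery_pair_correlation_restricted_holds` (used through `RudnickSarnak.tendsto_integral_formFactor_mul`).
  The source invokes Goldston–Montgomery's uniform version on `[0, 1]`; we need only that `F(α, T)`
  is BOUNDED on `1/2 ≤ |α| ≤ 1` (`AH.exists_abs_formFactor_le_near_one`), which follows from
  Montgomery's own argument — the tree's PROVED explicit formula (P1), zero-side mean square (P2) and
  Montgomery–Vaughan mean value theorem (P3) via `Montgomery.core_estimate` — since every term of
  `(2π/(T log T)) F(T^{|α|}, T)` is `O(1)` for `√T ≤ T^{|α|} ≤ T` (Goldston 2005, §4, (4.5)–(4.9)).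
  Hence `∫ F(α,T) 1_{[-1,1]}(α) φ(α) dα → φ(0) + ∫_{-1}^{1} |α| φ(α) dα` for continuous `φ`
  (`AH.tendsto_integral_formFactor_indicator_mul`).
* **Lemma 2** (pairs outside `𝒫(T, M)`; `AH.eventually_abs_sum_sub_sum_pairs_le`): the low pairs
  (`γ ≤ T/log²T`) are `O(T)` (unit windows, `AH.card_pairs_offWindow_le`), the range
  `M < |y| ≲ log T` is `O(T log T/M)` by the pair count at scale `1/log T` (the tree's Fejér-kernel
  corollary of Montgomery's theorem, `RudnickSarnak.exists_pairCount_window_le`, `sum_filter_mid_le`),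
  and `|γ − γ'| ≳ 1` is `O(T)` by unit windows row by row and the decay `ĝ_n(t) ≪ |t|^{-3}`.
* **Lemma 3** (AH-Pairs; `AH.eventually_abs_sum_pairs_sub_bins_le`): for large `T` every pair of
  `𝒫(T, M)` is within `ρ → 0` of a unique half-integer `k/2`, `|k| ≤ 4M + 1`
  (`AH.eventually_localised`), so `𝒫(T, M)` is the disjoint union of the bins `B_{k/2}`
  (`AH.pairs_eq_biUnion_bin`; `δ ≤ 1/2` makes the half-open bins disjoint), `P_{−k/2} = P_{k/2}`
  (`AH.card_bin_neg`), and `∑_{𝒫(T,M)} r(y) w = ∑_k r(k/2)|B_{k/2}| + o(T log T)` by the Lipschitz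
  bound `|ĝ_n(x) − ĝ_n(y)| ≤ 4π|x − y|` and `1 − w ≤ (γ−γ')²/4`.
* **Lemma 4** (the pair `g_n`, `ĝ_n`): `ĝ_n(t) = sinc(2πt) + (σ_n/2)(sinc(π(n−2t)) + sinc(π(n+2t)))`
  `= (sin 2πt/2πt) · n²/(n² − 4t²)` (`AH.fourier_gFun`, `AH.gHat_mul_eq`), `ĝ_n(0) = 1`,
  `ĝ_n(±n/2) = (−1)^{n+1}/2`, `ĝ_n(k/2) = 0` otherwise, `|ĝ_n| ≤ 2`, `|ĝ_n(t)| ≤ n²/(6π|t|³)` for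
  `|t| ≥ n`, and `g_n(0) + 2∫₀¹ α g_n = ½` (`n` even), `3/2 − 2/(π²n²)` (`n` odd).
* **Assembly** (`AH.tendsto_binDensity_add`, `bgstb2025_theorem1_holds`): "take `T` and then `M`
  large" is a plain `T`-limit at each `M ≥ n` because the bins do not depend on `M ≥ (|k| + δ)/2`
  (`AH.bin_eq_bin_of_le`); `P_0 ≥ 1 + o(1)` from the diagonal pairs (`AH.eventually_le_binDensity_zero`,
  Riemann–von Mangoldt), `P_0 ≤ 3/2 − 2/π² + o(1)` from `n = 1` and `P_{1/2} ≥ 0`.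
* **Theorem 2** (§4 of the source; §H here): Montgomery's kernel `k = ½ 1_{[-1,1]}`,
  `k̂(t) = sin(2πt)/(2πt)` (`AH.fourier_half_indicator`), so (Msum1) in `o(1)` form reads
  `∑ k̂(y) w/((T/2π) log T) → k(0) + ∫_{-1}^{1}|α| k(α) dα = 1` (`AH.tendsto_sum_sinc_div`); the pairs
  with a member `≤ T/log²T` or with `|γ − γ'| > 𝓜` cost `O_𝓜(T) + O(T log T/𝓜²)`
  (`|k̂(y)| ≤ 1/(|γ−γ'| log T)`, `w ≤ 4/(γ−γ')²`, unit windows;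
  `AH.eventually_abs_sum_sub_sum_nearPairs_le`); on `𝒬(T, 𝓜)` Strong AH-Pairs gives, for the pairs
  near `k/2 ≠ 0`, `|k̂(y)| ≤ 8 C R(T)` (by `|sin(πk + x)| = |sin x| ≤ |x|`) against
  `|𝒬(T,𝓜)| ≪ 𝓜 T log²T` and `R(T) log T → 0`, while the pairs near `0` are exactly `B_0` (for
  `δ ≤ 1/2`) with `k̂(y) w = 1 + o(1)` (`AH.eventually_abs_sum_nearPairs_sub_card_bin_le`); finally
  `𝓜 → ∞` (`AH.tendsto_binDensity_zero_of_strong`).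

## References

* [BaluyotGoldstonSuriajayaTurnageButterbaugh2025] arXiv:2508.10857, §§2–4: (MT-Pairs), (Msum1),
  Lemmas 2–4, proof of Theorem 1, Corollaries 1–3, proof of Theorem 2 (held text
  `paper:arxiv-2508.10857`, p0006–p0011).
* [Montgomery1973] H. L. Montgomery, Proc. Sympos. Pure Math. 24 (1973), Theorem, §3.
* [Goldston2005] D. A. Goldston, *Notes on pair correlation of zeros and prime numbers*, §4 (4.5)–(4.9),
  §5 (5.3)–(5.5).
* [Titchmarsh1986] Thms. 9.2, 9.4 (zero counting, proved in the tree).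
-/

noncomputable section

open Filter Set MeasureTheory Finset
open scoped Real Topology FourierTransform

namespace Literature.NumberTheory.LFunctions

namespace AH

/-! ## A. The form factor is bounded on `1/2 ≤ |α| ≤ 1` -/

/-- `log T ^ 2 ≤ 4 T` for `T ≥ 1`. [folklore] -/
private theorem log_sq_le_four_mul {T : ℝ} (hT : 1 ≤ T) : Real.log T ^ 2 ≤ 4 * T := by
  have h0 : 0 ≤ Real.log T := Real.log_nonneg hT
  have h1 : Real.log T ≤ T ^ (1 / 2 : ℝ) / (1 / 2) :=
    Real.log_le_rpow_div (by linarith) (by norm_num)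
  have h2 : Real.log T ≤ 2 * Real.sqrt T := by
    rw [Real.sqrt_eq_rpow]; linarith
  have h3 : Real.sqrt T ^ 2 = T := Real.sq_sqrt (by linarith)
  nlinarith [Real.sqrt_nonneg T]

/-- **`F(α, T) = O(1)` on `1/2 ≤ |α| ≤ 1`** (assuming RH): Montgomery's argument (explicit formula,
mean square of the zero side, Montgomery–Vaughan mean value theorem — the tree's PROVED (P1)–(P3) and
`Montgomery.core_estimate`) with `x = T^{|α|} ∈ [√T, T]` bounds every term of
`(2π/(T log T)) F(T^{|α|}, T)` by an absolute constant; only the asymptotic evaluation needs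
`|α| ≤ 1 − δ`. (Goldston 2005, §4, (4.5)–(4.9); Goldston–Montgomery 1987 prove more.)
[cite: Goldston2005, §4 (4.5)–(4.9)] -/
theorem exists_abs_formFactor_le_near_one (hRH : RiemannHypothesis) :
    ∃ C : ℝ, 0 < C ∧ ∀ T : ℝ, 2 ≤ T → ∀ α : ℝ, 1 / 2 ≤ |α| → |α| ≤ 1 →
      |montgomeryFormFactor α T| ≤ C := by
  obtain ⟨K, hK, hcore⟩ := Montgomery.core_estimate hRH montgomery_explicit_formula_holds
    montgomery_pairSum_eq_meanSquare_holds montgomery_dirichletSum_meanSquare_holds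
  refine ⟨6 + 34 * K, by positivity, fun T hT α hα1 hα2 ↦ ?_⟩
  -- reduce to `β = |α| ≥ 0`
  set β : ℝ := |α| with hβ
  have hFβ : montgomeryFormFactor α T = montgomeryFormFactor β T := by
    rcases le_or_gt 0 α with h | h
    · rw [hβ, abs_of_nonneg h]
    · rw [hβ, abs_of_neg h, montgomeryFormFactor_neg]
  rw [hFβ]
  have hT0 : 0 < T := by linarith
  have hT1 : 1 ≤ T := by linarith
  have hL : 0 < Real.log T := Real.log_pos (by linarith)
  have hL2 : Real.log 2 ≤ Real.log T := Real.log_le_log (by norm_num) hT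
  have hLhalf : 1 / 2 ≤ Real.log T := by linarith [Real.log_two_gt_d9]
  have hLT : Real.log T ≤ T := by linarith [Real.log_le_sub_one_of_pos hT0]
  set x : ℝ := T ^ β with hx
  have hx1 : 1 ≤ x := Real.one_le_rpow hT1 (by linarith)
  have hx0 : 0 < x := by linarith
  have hxT : x ≤ T := by
    calc x = T ^ β := rfl
      _ ≤ T ^ (1 : ℝ) := Real.rpow_le_rpow_of_exponent_le hT1 hα2
      _ = T := Real.rpow_one T
  have hlogx : Real.log x = β * Real.log T := Real.log_rpow hT0 β
  have hlogx_le : Real.log x ≤ Real.log T := by rw [hlogx]; nlinarith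
  have hlogx0 : 0 ≤ Real.log x := Real.log_nonneg hx1
  have hx2 : T ≤ x ^ 2 := by
    have : x ^ 2 = T ^ (2 * β) := by
      rw [hx, ← Real.rpow_natCast, ← Real.rpow_mul hT0.le]; ring_nf
    rw [this]
    calc T = T ^ (1 : ℝ) := (Real.rpow_one T).symm
      _ ≤ T ^ (2 * β) := Real.rpow_le_rpow_of_exponent_le hT1 (by linarith)
  obtain ⟨Φ, a, g, r, hr0, hΦ, ha, hg, hr, hcross⟩ := hcore x hx1 T hT
  have hF : montgomeryFormFactor β T = 2 * π / (T * Real.log T) * montgomeryPairSum x T :=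
    montgomeryFormFactor_eq_montgomeryPairSum β hT0
  -- the bound for `a`
  have ha' : |a| ≤ 1 + 5 * K := by
    have h1 : 1 / Real.log T ≤ 2 := by
      rw [div_le_iff₀ hL]; linarith
    have h2 : x * (Real.log x + 1) / (T * Real.log T) ≤ 3 := by
      rw [div_le_iff₀ (by positivity)]
      have h21 : x * (Real.log x + 1) ≤ T * (Real.log T + 1) := by
        apply mul_le_mul hxT (by linarith) (by positivity) hT0.le
      have h22 : T * 1 ≤ T * (2 * Real.log T) := mul_le_mul_of_nonneg_left (by linarith) hT0.le
      linarith
    have h3 : Real.log x / Real.log T ≤ 1 := by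
      rw [div_le_one hL]; exact hlogx_le
    have h4 : 0 ≤ Real.log x / Real.log T := by positivity
    have h5 := abs_le.mp ha
    have hK5 : K * (1 / Real.log T + x * (Real.log x + 1) / (T * Real.log T)) ≤ K * 5 :=
      mul_le_mul_of_nonneg_left (by linarith) hK.le
    rw [abs_le]; constructor <;> linarith [h5.1, h5.2]
  -- the bound for `g`
  have hg' : |g| ≤ 1 + K := by
    have hx2pos : 0 < x ^ 2 := by positivity
    have h1 : Real.log T / x ^ 2 ≤ 1 := by
      rw [div_le_one hx2pos]; linarith
    have h2 : K / x ^ 2 ≤ K := div_le_self hK.le (by nlinarith)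
    have h3 : 0 ≤ Real.log T / x ^ 2 := by positivity
    have h5 := abs_le.mp hg
    rw [abs_le]; constructor <;> linarith [h5.1, h5.2]
  -- the bound for `r`
  have hr' : r ≤ 4 * K := by
    have h1 : x / (T * Real.log T) ≤ 2 := by
      rw [div_le_iff₀ (by positivity)]
      have : T * 1 ≤ T * Real.log T * 2 := by nlinarith
      linarith
    have h2 : 1 / Real.log T ≤ 2 := by
      rw [div_le_iff₀ hL]; linarith
    have : K * (x / (T * Real.log T) + 1 / Real.log T) ≤ K * 4 :=
      mul_le_mul_of_nonneg_left (by linarith) hK.le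
    linarith
  -- `|Φ| ≤ 3|a| + 3|g| + 3r`
  have hΦ' : |Φ| ≤ 3 * |a| + 3 * |g| + 3 * r := by
    have hc := hcross 1 1 1 one_pos one_pos one_pos
    simp only [one_mul, div_one] at hc
    have h1 := abs_le.mp hc
    have haa := le_abs_self a; have haa' := neg_abs_le a
    have hgg := le_abs_self g; have hgg' := neg_abs_le g
    rw [abs_le]; constructor <;> linarith [h1.1, h1.2]
  -- the transfer error `K log²T / T ≤ 4K`
  have hE : K * (Real.log T ^ 2 / T) ≤ K * 4 := by
    have : Real.log T ^ 2 / T ≤ 4 := by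
      rw [div_le_iff₀ hT0]; exact log_sq_le_four_mul hT1
    exact mul_le_mul_of_nonneg_left this hK.le
  have h1 := abs_le.mp hΦ
  have h2 := abs_le.mp hΦ'
  rw [hF, abs_le]
  constructor <;> linarith [h1.1, h1.2, h2.1, h2.2, abs_nonneg a, abs_nonneg g]

/-! ## B. Montgomery's theorem integrated against `1_{[-1,1]} φ`, `φ` continuous -/

/-- The continuous cut-off `χ_η`: `1` on `|a| ≤ 1 − 2η`, `0` on `|a| ≥ 1 − η`, linear in between. [folklore] -/
def cutoff (η a : ℝ) : ℝ :=
  min 1 (max 0 ((1 - η - |a|) / η))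

/-- `0 ≤ χ_η`. [folklore] -/
private theorem cutoff_nonneg (η a : ℝ) : 0 ≤ cutoff η a :=
  le_min zero_le_one (le_max_left _ _)

/-- `χ_η ≤ 1`. [folklore] -/
private theorem cutoff_le_one (η a : ℝ) : cutoff η a ≤ 1 := min_le_left _ _

/-- `χ_η = 1` on `|a| ≤ 1 − 2η`. [folklore] -/
private theorem cutoff_eq_one {η a : ℝ} (hη : 0 < η) (ha : |a| ≤ 1 - 2 * η) : cutoff η a = 1 := by
  unfold cutoff
  have : 1 ≤ (1 - η - |a|) / η := by rw [le_div_iff₀ hη]; linarith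
  rw [min_eq_left_iff]
  exact le_max_of_le_right this

/-- `χ_η = 0` on `|a| ≥ 1 − η`. [folklore] -/
private theorem cutoff_eq_zero {η a : ℝ} (hη : 0 < η) (ha : 1 - η ≤ |a|) : cutoff η a = 0 := by
  unfold cutoff
  have : (1 - η - |a|) / η ≤ 0 := div_nonpos_of_nonpos_of_nonneg (by linarith) hη.le
  rw [max_eq_left this, min_eq_right zero_le_one]

/-- `χ_η` is continuous. [folklore] -/
private theorem continuous_cutoff (η : ℝ) : Continuous (cutoff η) := by
  unfold cutoff
  fun_prop

/-- Integrability of a constant on `[a, b]` (as an indicator). [folklore] -/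
private theorem integrable_indicator_Icc_const (a b c : ℝ) :
    Integrable (fun x : ℝ ↦ (Icc a b).indicator (fun _ ↦ c) x) := by
  have : IntegrableOn (fun _ : ℝ ↦ c) (Icc a b) :=
    integrableOn_const (hs := by rw [Real.volume_Icc]; exact ENNReal.ofReal_ne_top)
  exact this.integrable_indicator measurableSet_Icc

/-- `∫ 1_{[a,b]} c = (b − a) c`. [folklore] -/
private theorem integral_indicator_Icc_const {a b : ℝ} (h : a ≤ b) (c : ℝ) :
    ∫ x : ℝ, (Icc a b).indicator (fun _ ↦ c) x = (b - a) * c := by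
  rw [integral_indicator_const _ measurableSet_Icc, Real.volume_real_Icc_of_le h, smul_eq_mul]

/-- Pointwise: `|1_{[-1,1]} φ − χ_η φ| ≤ B (1_{[-1,-(1-2η)]} + 1_{[1-2η,1]})` when `|φ| ≤ B` on `[-1, 1]`. [folklore] -/
private theorem abs_indicator_mul_sub_cutoff_mul_le {φ : ℝ → ℝ} {B : ℝ} (hB : ∀ a, |a| ≤ 1 → |φ a| ≤ B)
    {η : ℝ} (hη : 0 < η) (a : ℝ) :
    |(Icc (-1 : ℝ) 1).indicator φ a - cutoff η a * φ a| ≤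
      (Icc (-1 : ℝ) (-(1 - 2 * η))).indicator (fun _ ↦ B) a +
        (Icc (1 - 2 * η) (1 : ℝ)).indicator (fun _ ↦ B) a := by
  have hB0 : 0 ≤ B := (abs_nonneg _).trans (hB 0 (by norm_num))
  by_cases h1 : |a| ≤ 1
  · have hmem : a ∈ Icc (-1 : ℝ) 1 := ⟨by linarith [(abs_le.mp h1).1], (abs_le.mp h1).2⟩
    rw [indicator_of_mem hmem]
    by_cases h2 : |a| ≤ 1 - 2 * η
    · rw [cutoff_eq_one hη h2, one_mul, sub_self, abs_zero]
      exact add_nonneg (indicator_nonneg (fun _ _ ↦ hB0) _) (indicator_nonneg (fun _ _ ↦ hB0) _)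
    · push Not at h2
      have hval : |φ a - cutoff η a * φ a| ≤ B := by
        rw [show φ a - cutoff η a * φ a = (1 - cutoff η a) * φ a by ring, abs_mul]
        have hc1 : |1 - cutoff η a| ≤ 1 := by
          rw [abs_le]; constructor <;> linarith [cutoff_nonneg η a, cutoff_le_one η a]
        calc |1 - cutoff η a| * |φ a| ≤ 1 * B :=
              mul_le_mul hc1 (hB a h1) (abs_nonneg _) zero_le_one
          _ = B := one_mul B
      rcases le_or_gt 0 a with ha0 | ha0
      · have hmem2 : a ∈ Icc (1 - 2 * η) (1 : ℝ) := by
          rw [abs_of_nonneg ha0] at h1 h2; exact ⟨h2.le, h1⟩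
        rw [indicator_of_mem hmem2]
        linarith [indicator_nonneg (s := Icc (-1 : ℝ) (-(1 - 2 * η))) (f := fun _ ↦ B)
          (fun _ _ ↦ hB0) a]
      · have hmem2 : a ∈ Icc (-1 : ℝ) (-(1 - 2 * η)) := by
          rw [abs_of_neg ha0] at h1 h2; exact ⟨by linarith, by linarith⟩
        rw [indicator_of_mem hmem2]
        linarith [indicator_nonneg (s := Icc (1 - 2 * η) (1 : ℝ)) (f := fun _ ↦ B)
          (fun _ _ ↦ hB0) a]
  · push Not at h1
    have hnmem : a ∉ Icc (-1 : ℝ) 1 := by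
      intro h; exact absurd (abs_le.mpr ⟨by linarith [h.1], h.2⟩) (not_le.mpr h1)
    rw [indicator_of_notMem hnmem, cutoff_eq_zero hη (by linarith), zero_mul, sub_self,
      abs_zero]
    exact add_nonneg (indicator_nonneg (fun _ _ ↦ hB0) _) (indicator_nonneg (fun _ _ ↦ hB0) _)

/-- **Montgomery's theorem integrated up to `|α| = 1`**: assuming RH, for every continuous `φ`,
`∫ F(α, T) 1_{[-1,1]}(α) φ(α) dα → φ(0) + ∫_{-1}^{1} |α| φ(α) dα` as `T → ∞`. The range
`|α| ≤ 1 − η` is the tree's `RudnickSarnak.tendsto_integral_formFactor_mul` (Montgomery's uniform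
clause); the strip `1 − 2η ≤ |α| ≤ 1` contributes `O(η)` by `exists_abs_formFactor_le_near_one`.
This is the second display of BGSTB's (MT-Pairs) in `o(1)` form (Goldston–Montgomery's
`O(1/√log T)` is not needed for Theorem 1). [cite: BaluyotGoldstonSuriajayaTurnageButterbaugh2025, §2 (MT-Pairs)] -/
theorem tendsto_integral_formFactor_indicator_mul (hRH : RiemannHypothesis) {φ : ℝ → ℝ}
    (hφ : Continuous φ) :
    Tendsto (fun T : ℝ ↦ ∫ a, montgomeryFormFactor a T * (Icc (-1 : ℝ) 1).indicator φ a) atTop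
      (𝓝 (φ 0 + ∫ a in (-1 : ℝ)..1, |a| * φ a)) := by
  obtain ⟨C, hC, hFC⟩ := exists_abs_formFactor_le_near_one hRH
  -- a bound for `φ` on `[-1, 1]`
  obtain ⟨B, hB⟩ : ∃ B : ℝ, ∀ a, |a| ≤ 1 → |φ a| ≤ B := by
    have hK : IsCompact (Icc (-1 : ℝ) 1) := isCompact_Icc
    obtain ⟨B, hB⟩ := hK.exists_bound_of_continuousOn hφ.continuousOn
    exact ⟨B, fun a ha ↦ by
      have := hB a ⟨by linarith [(abs_le.mp ha).1], (abs_le.mp ha).2⟩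
      simpa [Real.norm_eq_abs] using this⟩
  have hB0 : 0 ≤ B := (abs_nonneg _).trans (hB 0 (by norm_num))
  rw [Metric.tendsto_atTop]
  intro ε hε
  -- choose `η`
  set η : ℝ := min (1 / 4) (ε / (16 * (B + 1) * (C + 1))) with hη
  have hη0 : 0 < η := by positivity
  have hη4 : η ≤ 1 / 4 := min_le_left _ _
  have hηε : η * (16 * (B + 1) * (C + 1)) ≤ ε := by
    have : η ≤ ε / (16 * (B + 1) * (C + 1)) := min_le_right _ _
    rwa [le_div_iff₀ (by positivity)] at this
  -- the truncated test function
  set ψ : ℝ → ℂ := fun a ↦ ((cutoff η a * φ a : ℝ) : ℂ) with hψ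
  have hψc : Continuous ψ := by
    simp only [hψ]; exact Complex.continuous_ofReal.comp ((continuous_cutoff η).mul hφ)
  have hψ0 : ∀ α, 1 - η < |α| → ψ α = 0 := by
    intro α hα; simp only [hψ, cutoff_eq_zero hη0 hα.le, zero_mul, Complex.ofReal_zero]
  have hlim := RudnickSarnak.tendsto_integral_formFactor_mul hRH hψc hη0 hψ0
  -- real form of the truncated limit
  have hreal : ∀ T : ℝ, (∫ α, (montgomeryFormFactor α T : ℂ) * ψ α) =
      ((∫ α, montgomeryFormFactor α T * (cutoff η α * φ α) : ℝ) : ℂ) := by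
    intro T
    rw [← integral_complex_ofReal]
    refine integral_congr_ae (Eventually.of_forall fun α ↦ ?_)
    simp only [hψ]; push_cast; ring
  have hreal0 : ψ 0 + ∫ α, ((|α| : ℝ) : ℂ) * ψ α =
      ((φ 0 + ∫ α, |α| * (cutoff η α * φ α) : ℝ) : ℂ) := by
    have h0 : cutoff η 0 = 1 := cutoff_eq_one hη0 (by rw [abs_zero]; linarith)
    rw [Complex.ofReal_add, ← integral_complex_ofReal]
    simp only [hψ, h0, one_mul]
    congr 1
    refine integral_congr_ae (Eventually.of_forall fun α ↦ ?_)
    push_cast; ring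
  rw [hreal0] at hlim
  simp_rw [hreal] at hlim
  have hlimR : Tendsto (fun T : ℝ ↦ ∫ α, montgomeryFormFactor α T * (cutoff η α * φ α)) atTop
      (𝓝 (φ 0 + ∫ α, |α| * (cutoff η α * φ α))) := by
    have h := (Complex.continuous_re.tendsto _).comp hlim
    simp only [Function.comp_def, Complex.ofReal_re] at h
    exact h
  rw [Metric.tendsto_atTop] at hlimR
  obtain ⟨T₁, hT₁⟩ := hlimR (ε / 2) (by positivity)
  refine ⟨max T₁ 2, fun T hT ↦ ?_⟩
  have hT2 : 2 ≤ T := (le_max_right _ _).trans hT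
  have hT₁' : T₁ ≤ T := (le_max_left _ _).trans hT
  have h1 := hT₁ T hT₁'
  rw [Real.dist_eq] at h1 ⊢
  -- integrability facts
  have hgi : Integrable fun a : ℝ ↦ montgomeryFormFactor a T * (Icc (-1 : ℝ) 1).indicator φ a := by
    have hK : IsCompact (Icc (-1 : ℝ) 1) := isCompact_Icc
    have hcont : ContinuousOn (fun a : ℝ ↦ montgomeryFormFactor a T * φ a) (Icc (-1 : ℝ) 1) :=
      ((RudnickSarnak.continuous_montgomeryFormFactor T).mul hφ).continuousOn
    have := hcont.integrableOn_compact (μ := volume) hK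
    rw [← integrable_indicator_iff measurableSet_Icc] at this
    refine this.congr (Eventually.of_forall fun a ↦ ?_)
    by_cases ha : a ∈ Icc (-1 : ℝ) 1
    · simp [indicator_of_mem ha]
    · simp [indicator_of_notMem ha]
  have hψi : Integrable fun a : ℝ ↦ montgomeryFormFactor a T * (cutoff η a * φ a) := by
    have hcs0 : HasCompactSupport (fun a : ℝ ↦ cutoff η a * φ a) := by
      refine HasCompactSupport.of_support_subset_isCompact (K := Icc (-1 : ℝ) 1) isCompact_Icc ?_
      intro a ha
      rw [Function.mem_support] at ha
      by_contra hna
      apply ha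
      have : 1 - η ≤ |a| := by
        rw [Set.mem_Icc, not_and_or, not_le, not_le] at hna
        rcases hna with h | h
        · rw [abs_of_neg (by linarith)]; linarith
        · rw [abs_of_pos (by linarith)]; linarith
      rw [cutoff_eq_zero hη0 this, zero_mul]
    have hcs : HasCompactSupport (fun a : ℝ ↦ montgomeryFormFactor a T * (cutoff η a * φ a)) :=
      hcs0.mul_left
    exact ((RudnickSarnak.continuous_montgomeryFormFactor T).mul
      ((continuous_cutoff η).mul hφ)).integrable_of_hasCompactSupport hcs
  -- the strip estimate for the `F`-integrals
  have hstrip : |(∫ a, montgomeryFormFactor a T * (Icc (-1 : ℝ) 1).indicator φ a) -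
      ∫ a, montgomeryFormFactor a T * (cutoff η a * φ a)| ≤ 4 * η * (C * B) := by
    rw [← integral_sub hgi hψi]
    have hbd : ∀ a : ℝ, |montgomeryFormFactor a T * (Icc (-1 : ℝ) 1).indicator φ a -
        montgomeryFormFactor a T * (cutoff η a * φ a)| ≤
        (Icc (-1 : ℝ) (-(1 - 2 * η))).indicator (fun _ ↦ C * B) a +
          (Icc (1 - 2 * η) (1 : ℝ)).indicator (fun _ ↦ C * B) a := by
      intro a
      rw [← mul_sub, abs_mul]
      have hd := abs_indicator_mul_sub_cutoff_mul_le hB hη0 a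
      by_cases hs : 1 - 2 * η ≤ |a| ∧ |a| ≤ 1
      · have hFa : |montgomeryFormFactor a T| ≤ C := hFC T hT2 a (by linarith) hs.2
        calc |montgomeryFormFactor a T| * |(Icc (-1 : ℝ) 1).indicator φ a - cutoff η a * φ a|
            ≤ C * ((Icc (-1 : ℝ) (-(1 - 2 * η))).indicator (fun _ ↦ B) a +
                (Icc (1 - 2 * η) (1 : ℝ)).indicator (fun _ ↦ B) a) :=
              mul_le_mul hFa hd (abs_nonneg _) hC.le
          _ = (Icc (-1 : ℝ) (-(1 - 2 * η))).indicator (fun _ ↦ C * B) a +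
                (Icc (1 - 2 * η) (1 : ℝ)).indicator (fun _ ↦ C * B) a := by
              rw [mul_add]
              congr 1
              · by_cases hm : a ∈ Icc (-1 : ℝ) (-(1 - 2 * η))
                · rw [indicator_of_mem hm, indicator_of_mem hm]
                · rw [indicator_of_notMem hm, indicator_of_notMem hm, mul_zero]
              · by_cases hm : a ∈ Icc (1 - 2 * η) (1 : ℝ)
                · rw [indicator_of_mem hm, indicator_of_mem hm]
                · rw [indicator_of_notMem hm, indicator_of_notMem hm, mul_zero]
      · -- outside the strip the difference vanishes
        have hzero : (Icc (-1 : ℝ) 1).indicator φ a - cutoff η a * φ a = 0 := by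
          rw [not_and_or, not_le, not_le] at hs
          rcases hs with h | h
          · have hmem : a ∈ Icc (-1 : ℝ) 1 :=
              ⟨by linarith [(abs_le.mp (show |a| ≤ 1 by linarith)).1],
                (abs_le.mp (show |a| ≤ 1 by linarith)).2⟩
            rw [indicator_of_mem hmem, cutoff_eq_one hη0 h.le, one_mul, sub_self]
          · have hnmem : a ∉ Icc (-1 : ℝ) 1 := by
              intro hm; exact absurd (abs_le.mpr ⟨by linarith [hm.1], hm.2⟩) (not_le.mpr h)
            rw [indicator_of_notMem hnmem, cutoff_eq_zero hη0 (by linarith), zero_mul, sub_self]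
        rw [hzero, abs_zero, mul_zero]
        exact add_nonneg (indicator_nonneg (fun _ _ ↦ by positivity) _)
          (indicator_nonneg (fun _ _ ↦ by positivity) _)
    have hint1 : Integrable fun a : ℝ ↦ (Icc (-1 : ℝ) (-(1 - 2 * η))).indicator (fun _ ↦ C * B) a +
        (Icc (1 - 2 * η) (1 : ℝ)).indicator (fun _ ↦ C * B) a :=
      (integrable_indicator_Icc_const _ _ _).add (integrable_indicator_Icc_const _ _ _)
    calc |∫ a, montgomeryFormFactor a T * (Icc (-1 : ℝ) 1).indicator φ a -
          montgomeryFormFactor a T * (cutoff η a * φ a)|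
        ≤ ∫ a, (Icc (-1 : ℝ) (-(1 - 2 * η))).indicator (fun _ ↦ C * B) a +
            (Icc (1 - 2 * η) (1 : ℝ)).indicator (fun _ ↦ C * B) a := by
          rw [← Real.norm_eq_abs]
          exact norm_integral_le_of_norm_le hint1 (Eventually.of_forall fun a ↦ by
            rw [Real.norm_eq_abs]; exact hbd a)
      _ = 4 * η * (C * B) := by
          rw [integral_add (integrable_indicator_Icc_const _ _ _) (integrable_indicator_Icc_const _ _ _),
            integral_indicator_Icc_const (by linarith), integral_indicator_Icc_const (by linarith)]
          ring
  -- the strip estimate for the limits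
  have hstrip0 : |(∫ a in (-1 : ℝ)..1, |a| * φ a) - ∫ α, |α| * (cutoff η α * φ α)| ≤ 4 * η * B := by
    rw [intervalIntegral.integral_of_le (by norm_num), ← integral_Icc_eq_integral_Ioc,
      ← integral_indicator measurableSet_Icc]
    have hi1 : Integrable fun a : ℝ ↦ (Icc (-1 : ℝ) 1).indicator (fun a ↦ |a| * φ a) a := by
      rw [integrable_indicator_iff measurableSet_Icc]
      exact ((continuous_abs.mul hφ).continuousOn).integrableOn_compact isCompact_Icc
    have hi2 : Integrable fun a : ℝ ↦ |a| * (cutoff η a * φ a) := by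
      have e : (fun a : ℝ ↦ |a| * (cutoff η a * φ a)) =
          fun a ↦ (Icc (-1 : ℝ) 1).indicator (fun a ↦ |a| * (cutoff η a * φ a)) a := by
        funext a
        by_cases ha : a ∈ Icc (-1 : ℝ) 1
        · rw [indicator_of_mem ha]
        · rw [indicator_of_notMem ha]
          have : 1 - η ≤ |a| := by
            rw [Set.mem_Icc, not_and_or, not_le, not_le] at ha
            rcases ha with h | h
            · rw [abs_of_neg (by linarith)]; linarith
            · rw [abs_of_pos (by linarith)]; linarith
          rw [cutoff_eq_zero hη0 this]; ring
      rw [e, integrable_indicator_iff measurableSet_Icc]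
      exact ((continuous_abs.mul ((continuous_cutoff η).mul hφ)).continuousOn).integrableOn_compact
        isCompact_Icc
    rw [← integral_sub hi1 hi2]
    have hbd : ∀ a : ℝ, |(Icc (-1 : ℝ) 1).indicator (fun a ↦ |a| * φ a) a - |a| * (cutoff η a * φ a)|
        ≤ (Icc (-1 : ℝ) (-(1 - 2 * η))).indicator (fun _ ↦ B) a +
          (Icc (1 - 2 * η) (1 : ℝ)).indicator (fun _ ↦ B) a := by
      intro a
      have hd := abs_indicator_mul_sub_cutoff_mul_le hB hη0 a
      have e : (Icc (-1 : ℝ) 1).indicator (fun a ↦ |a| * φ a) a - |a| * (cutoff η a * φ a) =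
          |a| * ((Icc (-1 : ℝ) 1).indicator φ a - cutoff η a * φ a) := by
        by_cases ha : a ∈ Icc (-1 : ℝ) 1
        · rw [indicator_of_mem ha, indicator_of_mem ha]; ring
        · rw [indicator_of_notMem ha, indicator_of_notMem ha]; ring
      rw [e, abs_mul, abs_abs]
      by_cases ha1 : |a| ≤ 1
      · calc |a| * |(Icc (-1 : ℝ) 1).indicator φ a - cutoff η a * φ a|
            ≤ 1 * ((Icc (-1 : ℝ) (-(1 - 2 * η))).indicator (fun _ ↦ B) a +
                (Icc (1 - 2 * η) (1 : ℝ)).indicator (fun _ ↦ B) a) :=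
              mul_le_mul ha1 hd (abs_nonneg _) zero_le_one
          _ = _ := one_mul _
      · push Not at ha1
        have hnmem : a ∉ Icc (-1 : ℝ) 1 := by
          intro hm; exact absurd (abs_le.mpr ⟨by linarith [hm.1], hm.2⟩) (not_le.mpr ha1)
        rw [indicator_of_notMem hnmem, cutoff_eq_zero hη0 (by linarith), zero_mul, sub_self,
          abs_zero, mul_zero]
        exact add_nonneg (indicator_nonneg (fun _ _ ↦ hB0) _) (indicator_nonneg (fun _ _ ↦ hB0) _)
    have hint1 : Integrable fun a : ℝ ↦ (Icc (-1 : ℝ) (-(1 - 2 * η))).indicator (fun _ ↦ B) a +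
        (Icc (1 - 2 * η) (1 : ℝ)).indicator (fun _ ↦ B) a :=
      (integrable_indicator_Icc_const _ _ _).add (integrable_indicator_Icc_const _ _ _)
    calc |∫ a, (Icc (-1 : ℝ) 1).indicator (fun a ↦ |a| * φ a) a - |a| * (cutoff η a * φ a)|
        ≤ ∫ a, (Icc (-1 : ℝ) (-(1 - 2 * η))).indicator (fun _ ↦ B) a +
            (Icc (1 - 2 * η) (1 : ℝ)).indicator (fun _ ↦ B) a := by
          rw [← Real.norm_eq_abs]
          exact norm_integral_le_of_norm_le hint1 (Eventually.of_forall fun a ↦ by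
            rw [Real.norm_eq_abs]; exact hbd a)
      _ = 4 * η * B := by
          rw [integral_add (integrable_indicator_Icc_const _ _ _) (integrable_indicator_Icc_const _ _ _),
            integral_indicator_Icc_const (by linarith), integral_indicator_Icc_const (by linarith)]
          ring
  -- assemble
  have hη1 : 4 * η * (C * B) ≤ ε / 4 := by nlinarith
  have hη2 : 4 * η * B ≤ ε / 4 := by nlinarith
  have := abs_sub_lt_iff.mp h1
  have h3 := abs_le.mp hstrip
  have h4 := abs_le.mp hstrip0
  rw [abs_sub_lt_iff]
  constructor <;> linarith [h3.1, h3.2, h4.1, h4.2, this.1, this.2]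

/-! ## C. BGSTB 2025, Lemma 4: the test functions `g_n` and their Fourier transforms -/

/-- `σ_n = (−1)^{n+1}`: `+1` for `n` odd, `−1` for `n` even (BGSTB 2025, §3, display (g_n)). [cite: BaluyotGoldstonSuriajayaTurnageButterbaugh2025, Lemma 4] -/
def sgn (n : ℕ) : ℝ := (-1) ^ (n + 1)

/-- `σ_n² = 1`. [cite: BaluyotGoldstonSuriajayaTurnageButterbaugh2025, Lemma 4] -/
theorem sgn_sq (n : ℕ) : sgn n * sgn n = 1 := by
  rw [sgn, ← pow_add, ← two_mul, pow_mul]; norm_num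

/-- `|σ_n| = 1`. [cite: BaluyotGoldstonSuriajayaTurnageButterbaugh2025, Lemma 4] -/
theorem abs_sgn (n : ℕ) : |sgn n| = 1 := by
  rw [sgn, abs_pow, abs_neg, abs_one, one_pow]

/-- `σ_n (−1)^n = −1`. [cite: BaluyotGoldstonSuriajayaTurnageButterbaugh2025, Lemma 4] -/
theorem sgn_mul_neg_one_pow (n : ℕ) : sgn n * (-1) ^ n = -1 := by
  rw [sgn, ← pow_add, show n + 1 + n = 2 * n + 1 by ring, pow_succ, pow_mul]; norm_num

/-- `σ_n = −1` for `n` even (`g_n = sin²(nπα/2)`). [cite: BaluyotGoldstonSuriajayaTurnageButterbaugh2025, Lemma 4] -/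
theorem sgn_of_even {n : ℕ} (h : Even n) : sgn n = -1 := by
  rw [sgn, pow_succ, h.neg_one_pow]; norm_num

/-- `σ_n = 1` for `n` odd (`g_n = cos²(nπα/2)`). [cite: BaluyotGoldstonSuriajayaTurnageButterbaugh2025, Lemma 4] -/
theorem sgn_of_odd {n : ℕ} (h : Odd n) : sgn n = 1 := by
  rw [sgn, pow_succ, h.neg_one_pow]; norm_num

/-- The continuous profile `φ_n(a) = (1 + (−1)^{n+1} cos(nπa))/2` — `sin²(nπa/2)` for `n` even,
`cos²(nπa/2)` for `n` odd (BGSTB 2025, §3, (g_n)). [cite: BaluyotGoldstonSuriajayaTurnageButterbaugh2025, Lemma 4] -/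
def gProfile (n : ℕ) (a : ℝ) : ℝ :=
  (1 + sgn n * Real.cos (n * π * a)) / 2

/-- **BGSTB's `g_n`** (Lemma 4): `g_n(α) = (1 + (−1)^{n+1} cos(nπα))/2` for `|α| ≤ 1`, `0` for
`|α| > 1`. [cite: BaluyotGoldstonSuriajayaTurnageButterbaugh2025, Lemma 4] -/
def gFun (n : ℕ) (a : ℝ) : ℝ :=
  (Icc (-1 : ℝ) 1).indicator (gProfile n) a

/-- **`ĝ_n`** in closed form (BGSTB 2025, Lemma 4, `ĝ_n(t) = sin(2πt)/(2πt) · n²/(n² − 4t²)`), written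
as the three-`sinc` combination `sinc(2πt) + (σ_n/2)(sinc(π(n − 2t)) + sinc(π(n + 2t)))` which has
no removable singularities (`Real.sinc 0 = 1`). [cite: BaluyotGoldstonSuriajayaTurnageButterbaugh2025, Lemma 4] -/
def gHat (n : ℕ) (t : ℝ) : ℝ :=
  Real.sinc (2 * π * t) + sgn n / 2 * (Real.sinc (π * (n - 2 * t)) + Real.sinc (π * (n + 2 * t)))

/-- `φ_n` is continuous. [cite: BaluyotGoldstonSuriajayaTurnageButterbaugh2025, Lemma 4] -/
theorem continuous_gProfile (n : ℕ) : Continuous (gProfile n) := by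
  unfold gProfile; fun_prop

/-- `φ_n ≥ 0`. [cite: BaluyotGoldstonSuriajayaTurnageButterbaugh2025, Lemma 4] -/
theorem gProfile_nonneg (n : ℕ) (a : ℝ) : 0 ≤ gProfile n a := by
  unfold gProfile
  have h1 : -1 ≤ sgn n * Real.cos (n * π * a) := by
    have := abs_le.mp (show |sgn n * Real.cos (n * π * a)| ≤ 1 by
      rw [abs_mul, abs_sgn, one_mul]; exact Real.abs_cos_le_one _)
    exact this.1
  linarith

/-- `φ_n ≤ 1`. [cite: BaluyotGoldstonSuriajayaTurnageButterbaugh2025, Lemma 4] -/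
theorem gProfile_le_one (n : ℕ) (a : ℝ) : gProfile n a ≤ 1 := by
  unfold gProfile
  have h1 : sgn n * Real.cos (n * π * a) ≤ 1 := by
    have := abs_le.mp (show |sgn n * Real.cos (n * π * a)| ≤ 1 by
      rw [abs_mul, abs_sgn, one_mul]; exact Real.abs_cos_le_one _)
    exact this.2
  linarith

/-- `φ_n(±1) = 0` (so `g_n` is continuous). [cite: BaluyotGoldstonSuriajayaTurnageButterbaugh2025, Lemma 4] -/
theorem gProfile_eq_zero_of_abs_eq_one (n : ℕ) {a : ℝ} (ha : |a| = 1) : gProfile n a = 0 := by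
  unfold gProfile
  have hcos : Real.cos (n * π * a) = (-1) ^ n := by
    rcases (abs_eq zero_le_one).mp ha with h | h
    · rw [h, mul_one, Real.cos_nat_mul_pi]
    · rw [h, mul_neg_one, Real.cos_neg, Real.cos_nat_mul_pi]
  rw [hcos, sgn_mul_neg_one_pow]; norm_num

/-- `φ_n(0) = (1 + σ_n)/2` (`= g_n(0)`: `0` for `n` even, `1` for `n` odd). [cite: BaluyotGoldstonSuriajayaTurnageButterbaugh2025, Lemma 4] -/
theorem gProfile_zero (n : ℕ) : gProfile n 0 = (1 + sgn n) / 2 := by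
  simp [gProfile]

/-- `g_n ≥ 0`. [cite: BaluyotGoldstonSuriajayaTurnageButterbaugh2025, Lemma 4] -/
theorem gFun_nonneg (n : ℕ) (a : ℝ) : 0 ≤ gFun n a := by
  unfold gFun
  exact indicator_nonneg (fun a _ ↦ gProfile_nonneg n a) a

/-- `g_n ≤ 1`. [cite: BaluyotGoldstonSuriajayaTurnageButterbaugh2025, Lemma 4] -/
theorem gFun_le_one (n : ℕ) (a : ℝ) : gFun n a ≤ 1 := by
  unfold gFun
  by_cases h : a ∈ Icc (-1 : ℝ) 1
  · rw [indicator_of_mem h]; exact gProfile_le_one n a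
  · rw [indicator_of_notMem h]; exact zero_le_one

/-- `|g_n| ≤ 1`. [cite: BaluyotGoldstonSuriajayaTurnageButterbaugh2025, Lemma 4] -/
theorem abs_gFun_le_one (n : ℕ) (a : ℝ) : |gFun n a| ≤ 1 := by
  rw [abs_of_nonneg (gFun_nonneg n a)]; exact gFun_le_one n a

/-- `g_n(α) = 0` for `|α| > 1`. [cite: BaluyotGoldstonSuriajayaTurnageButterbaugh2025, Lemma 4] -/
theorem gFun_eq_zero_of_one_lt {n : ℕ} {a : ℝ} (ha : 1 < |a|) : gFun n a = 0 := by
  unfold gFun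
  rw [indicator_of_notMem]
  intro h
  exact absurd (abs_le.mpr ⟨by linarith [h.1], h.2⟩) (not_le.mpr ha)

/-- `g_n` is continuous (`φ_n(±1) = 0`): `g_n = φ_n ∘ clamp_{[-1,1]}`. [cite: BaluyotGoldstonSuriajayaTurnageButterbaugh2025, Lemma 4] -/
theorem continuous_gFun (n : ℕ) : Continuous (gFun n) := by
  have e : gFun n = fun a ↦ gProfile n (max (-1) (min 1 a)) := by
    funext a
    unfold gFun
    by_cases ha : a ∈ Icc (-1 : ℝ) 1
    · rw [indicator_of_mem ha, min_eq_right ha.2, max_eq_right ha.1]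
    · rw [indicator_of_notMem ha]
      rw [Set.mem_Icc, not_and_or, not_le, not_le] at ha
      rcases ha with h | h
      · rw [min_eq_right (by linarith : a ≤ 1), max_eq_left (by linarith : a ≤ -1)]
        exact (gProfile_eq_zero_of_abs_eq_one n (by norm_num)).symm
      · rw [min_eq_left (by linarith : (1 : ℝ) ≤ a), max_eq_right (by norm_num : (-1 : ℝ) ≤ 1)]
        exact (gProfile_eq_zero_of_abs_eq_one n (by norm_num)).symm
  rw [e]
  exact (continuous_gProfile n).comp (continuous_const.max (continuous_const.min continuous_id))

/-- `g_n` has compact support (`⊆ [-1, 1]`). [cite: BaluyotGoldstonSuriajayaTurnageButterbaugh2025, Lemma 4] -/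
theorem hasCompactSupport_gFun (n : ℕ) : HasCompactSupport (gFun n) :=
  HasCompactSupport.of_support_subset_isCompact (K := Icc (-1 : ℝ) 1) isCompact_Icc
    (fun _ ha ↦ Set.support_indicator_subset ha)

/-- `g_n ∈ L¹(ℝ)` ("Clearly `g_n(α)` is even and in `L¹(ℝ)`"). [cite: BaluyotGoldstonSuriajayaTurnageButterbaugh2025, Lemma 4] -/
theorem integrable_gFun (n : ℕ) : Integrable (gFun n) :=
  (continuous_gFun n).integrable_of_hasCompactSupport (hasCompactSupport_gFun n)

/-- `∫_{-1}^{1} e^{icv} dv = 2 sinc(c)`. [folklore] -/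
private theorem integral_cexp_mul_I (c : ℝ) :
    ∫ v in (-1 : ℝ)..1, Complex.exp (↑(c * v) * Complex.I) = ((2 * Real.sinc c : ℝ) : ℂ) := by
  rcases eq_or_ne c 0 with rfl | hc
  · simp [Real.sinc_zero]
    norm_num
  · have hc' : (c : ℂ) * Complex.I ≠ 0 :=
      mul_ne_zero (Complex.ofReal_ne_zero.mpr hc) Complex.I_ne_zero
    have e : (fun v : ℝ ↦ Complex.exp (↑(c * v) * Complex.I)) =
        fun v : ℝ ↦ Complex.exp ((c : ℂ) * Complex.I * (v : ℂ)) := by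
      funext v; congr 1; push_cast; ring
    rw [e, integral_exp_mul_complex hc', Real.sinc_of_ne_zero hc]
    have h1 : (c : ℂ) * Complex.I * ((1 : ℝ) : ℂ) = c * Complex.I := by push_cast; ring
    have h2 : (c : ℂ) * Complex.I * ((-1 : ℝ) : ℂ) = -c * Complex.I := by push_cast; ring
    rw [h1, h2, Complex.exp_mul_I, Complex.exp_mul_I]
    simp only [Complex.cos_neg, Complex.sin_neg, neg_mul]
    push_cast
    have e3 : Complex.cos (c : ℂ) + Complex.sin c * Complex.I -
        (Complex.cos c + -(Complex.sin c * Complex.I)) = 2 * Complex.sin c * Complex.I := by ring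
    rw [e3]
    have hcC : (c : ℂ) ≠ 0 := Complex.ofReal_ne_zero.mpr hc
    field_simp

/-- The Fourier integrand of `g_n`, expanded into exponentials: for `|v| ≤ 1`,
`e(−tv) g_n(v) = ½ E_{−2πt}(v) + (σ_n/4)(E_{nπ−2πt}(v) + E_{−nπ−2πt}(v))`, `E_c(v) = e^{icv}`. [cite: BaluyotGoldstonSuriajayaTurnageButterbaugh2025, Lemma 4] -/
theorem cexp_mul_gProfile (n : ℕ) (t v : ℝ) :
    Complex.exp (↑(-2 * π * v * t) * Complex.I) * (gProfile n v : ℂ) =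
      (1 / 2 : ℂ) * Complex.exp (↑((-2 * π * t) * v) * Complex.I) +
        (sgn n / 4 : ℂ) * (Complex.exp (↑((n * π - 2 * π * t) * v) * Complex.I) +
          Complex.exp (↑((-(n * π) - 2 * π * t) * v) * Complex.I)) := by
  unfold gProfile
  push_cast
  have hcos : Complex.cos ((n : ℂ) * (π : ℂ) * (v : ℂ)) =
      (Complex.exp ((n : ℂ) * π * v * Complex.I) + Complex.exp (-((n : ℂ) * π * v) * Complex.I)) / 2 := by
    rw [← Complex.two_cos]; ring
  rw [hcos]
  have e1 : Complex.exp ((-2 * (π : ℂ) * v * t) * Complex.I) * Complex.exp ((n : ℂ) * π * v * Complex.I) =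
      Complex.exp (((n : ℂ) * π - 2 * π * t) * v * Complex.I) := by
    rw [← Complex.exp_add]; congr 1; ring
  have e2 : Complex.exp ((-2 * (π : ℂ) * v * t) * Complex.I) * Complex.exp (-((n : ℂ) * π * v) * Complex.I) =
      Complex.exp ((-((n : ℂ) * π) - 2 * π * t) * v * Complex.I) := by
    rw [← Complex.exp_add]; congr 1; ring
  have e3 : Complex.exp ((-2 * (π : ℂ) * v * t) * Complex.I) =
      Complex.exp ((-2 * (π : ℂ) * t) * v * Complex.I) := by
    congr 1; ring
  calc Complex.exp ((-2 * (π : ℂ) * v * t) * Complex.I) *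
        ((1 + (sgn n : ℂ) * ((Complex.exp ((n : ℂ) * π * v * Complex.I) +
          Complex.exp (-((n : ℂ) * π * v) * Complex.I)) / 2)) / 2)
      = (1 / 2 : ℂ) * Complex.exp ((-2 * (π : ℂ) * v * t) * Complex.I) +
          (sgn n / 4 : ℂ) * (Complex.exp ((-2 * (π : ℂ) * v * t) * Complex.I) *
              Complex.exp ((n : ℂ) * π * v * Complex.I) +
            Complex.exp ((-2 * (π : ℂ) * v * t) * Complex.I) *
              Complex.exp (-((n : ℂ) * π * v) * Complex.I)) := by ring
    _ = _ := by rw [e1, e2, e3]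

/-- **`𝓕 g_n = ĝ_n`** (BGSTB 2025, Lemma 4, the computation of `ĝ_n`). [cite: BaluyotGoldstonSuriajayaTurnageButterbaugh2025, Lemma 4] -/
theorem fourier_gFun (n : ℕ) (t : ℝ) : 𝓕 (fun a : ℝ ↦ (gFun n a : ℂ)) t = (gHat n t : ℂ) := by
  rw [Real.fourier_real_eq_integral_exp_smul]
  simp only [smul_eq_mul]
  -- restrict to `[-1, 1]`
  have e1 : (fun v : ℝ ↦ Complex.exp (↑(-2 * π * v * t) * Complex.I) * (gFun n v : ℂ)) =
      fun v ↦ (Icc (-1 : ℝ) 1).indicator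
        (fun v ↦ Complex.exp (↑(-2 * π * v * t) * Complex.I) * (gProfile n v : ℂ)) v := by
    funext v
    unfold gFun
    by_cases hv : v ∈ Icc (-1 : ℝ) 1
    · rw [indicator_of_mem hv, indicator_of_mem hv]
    · rw [indicator_of_notMem hv, indicator_of_notMem hv, Complex.ofReal_zero, mul_zero]
  rw [e1, integral_indicator measurableSet_Icc, integral_Icc_eq_integral_Ioc,
    ← intervalIntegral.integral_of_le (by norm_num : (-1 : ℝ) ≤ 1)]
  simp_rw [cexp_mul_gProfile]
  have hi : ∀ c : ℝ, IntervalIntegrable (fun v : ℝ ↦ Complex.exp (↑(c * v) * Complex.I)) volume (-1) 1 :=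
    fun c ↦ (by fun_prop : Continuous fun v : ℝ ↦ Complex.exp (↑(c * v) * Complex.I)).intervalIntegrable _ _
  rw [intervalIntegral.integral_add ((hi _).const_mul _) (((hi _).add (hi _)).const_mul _),
    intervalIntegral.integral_const_mul, intervalIntegral.integral_const_mul,
    intervalIntegral.integral_add (hi _) (hi _), integral_cexp_mul_I, integral_cexp_mul_I,
    integral_cexp_mul_I]
  unfold gHat
  have h1 : Real.sinc (-2 * π * t) = Real.sinc (2 * π * t) := by
    rw [show -2 * π * t = -(2 * π * t) by ring, Real.sinc_neg]
  have h2 : Real.sinc (n * π - 2 * π * t) = Real.sinc (π * (n - 2 * t)) := by ring_nf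
  have h3 : Real.sinc (-(n * π) - 2 * π * t) = Real.sinc (π * (n + 2 * t)) := by
    rw [show -(n * π) - 2 * π * t = -(π * (n + 2 * t)) by ring, Real.sinc_neg]
  rw [h1, h2, h3]
  push_cast
  ring

/-- `sinc(πm) = [m = 0]` for integers `m`. [folklore] -/
private theorem sinc_pi_mul_int (m : ℤ) : Real.sinc (π * m) = if m = 0 then 1 else 0 := by
  split_ifs with h
  · rw [h, Int.cast_zero, mul_zero, Real.sinc_zero]
  · rw [Real.sinc_of_ne_zero (mul_ne_zero Real.pi_ne_zero (Int.cast_ne_zero.mpr h)), mul_comm,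
      Real.sin_int_mul_pi, zero_div]

/-- **`ĝ_n(0) = 1`** (`n ≥ 1`). [cite: BaluyotGoldstonSuriajayaTurnageButterbaugh2025, Lemma 4 (hatg_nzero)] -/
theorem gHat_zero {n : ℕ} (hn : 1 ≤ n) : gHat n 0 = 1 := by
  unfold gHat
  have h := sinc_pi_mul_int (n : ℤ)
  rw [Int.cast_natCast, if_neg (by exact_mod_cast (show n ≠ 0 by omega))] at h
  rw [mul_zero, Real.sinc_zero, mul_zero, sub_zero, add_zero, h]
  ring

/-- **`ĝ_n(k/2) = 0`** for `k ∉ {0, ±n}`. [cite: BaluyotGoldstonSuriajayaTurnageButterbaugh2025, Lemma 4 (hatg_nzero)] -/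
theorem gHat_half_int_eq_zero {n : ℕ} {k : ℤ} (hk0 : k ≠ 0) (hkn : k ≠ n) (hkn' : k ≠ -n) :
    gHat n (k / 2) = 0 := by
  unfold gHat
  have h1 : Real.sinc (2 * π * (k / 2 : ℝ)) = 0 := by
    rw [show 2 * π * (k / 2 : ℝ) = π * k by ring]
    have := sinc_pi_mul_int k; rwa [if_neg hk0] at this
  have h2 : Real.sinc (π * (n - 2 * (k / 2 : ℝ))) = 0 := by
    rw [show π * (n - 2 * (k / 2 : ℝ)) = π * ((n - k : ℤ) : ℝ) by push_cast; ring]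
    have := sinc_pi_mul_int (n - k); rwa [if_neg (by omega)] at this
  have h3 : Real.sinc (π * (n + 2 * (k / 2 : ℝ))) = 0 := by
    rw [show π * (n + 2 * (k / 2 : ℝ)) = π * ((n + k : ℤ) : ℝ) by push_cast; ring]
    have := sinc_pi_mul_int (n + k); rwa [if_neg (by omega)] at this
  rw [h1, h2, h3]; ring

/-- **`ĝ_n(±n/2) = (−1)^{n+1}/2`** (`n ≥ 1`). [cite: BaluyotGoldstonSuriajayaTurnageButterbaugh2025, Lemma 4 (hatg_nzero)] -/
theorem gHat_half_self {n : ℕ} (hn : 1 ≤ n) : gHat n (n / 2) = sgn n / 2 := by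
  unfold gHat
  have h1 : Real.sinc (2 * π * (n / 2 : ℝ)) = 0 := by
    rw [show 2 * π * (n / 2 : ℝ) = π * ((n : ℤ) : ℝ) by push_cast; ring]
    have := sinc_pi_mul_int n; rwa [if_neg (by exact_mod_cast (show n ≠ 0 by omega))] at this
  have h2 : Real.sinc (π * (n - 2 * (n / 2 : ℝ))) = 1 := by
    rw [show π * (n - 2 * (n / 2 : ℝ)) = 0 by ring, Real.sinc_zero]
  have h3 : Real.sinc (π * (n + 2 * (n / 2 : ℝ))) = 0 := by
    rw [show π * (n + 2 * (n / 2 : ℝ)) = π * ((2 * n : ℤ) : ℝ) by push_cast; ring]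
    have := sinc_pi_mul_int (2 * n); rwa [if_neg (by omega)] at this
  rw [h1, h2, h3]; ring

/-- `ĝ_n` is even. [cite: BaluyotGoldstonSuriajayaTurnageButterbaugh2025, Lemma 4] -/
theorem gHat_neg (n : ℕ) (t : ℝ) : gHat n (-t) = gHat n t := by
  unfold gHat
  rw [show 2 * π * -t = -(2 * π * t) by ring, Real.sinc_neg,
    show π * (n - 2 * -t) = π * (n + 2 * t) by ring, show π * (n + 2 * -t) = π * (n - 2 * t) by ring]
  ring

/-- `ĝ_n(−n/2) = (−1)^{n+1}/2`. [cite: BaluyotGoldstonSuriajayaTurnageButterbaugh2025, Lemma 4 (hatg_nzero)] -/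
theorem gHat_neg_half_self {n : ℕ} (hn : 1 ≤ n) : gHat n (-(n / 2 : ℝ)) = sgn n / 2 := by
  rw [gHat_neg, gHat_half_self hn]

/-- `|ĝ_n(t)| ≤ 2` ("`|r(t)| ≪ 1`"). [cite: BaluyotGoldstonSuriajayaTurnageButterbaugh2025, Lemma 4 (g_nbound)] -/
theorem abs_gHat_le_two (n : ℕ) (t : ℝ) : |gHat n t| ≤ 2 := by
  unfold gHat
  have h1 := Real.abs_sinc_le_one (2 * π * t)
  have h2 := Real.abs_sinc_le_one (π * (n - 2 * t))
  have h3 := Real.abs_sinc_le_one (π * (n + 2 * t))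
  have hs : |sgn n / 2| = 1 / 2 := by rw [abs_div, abs_sgn, abs_two]
  calc |Real.sinc (2 * π * t) + sgn n / 2 * (Real.sinc (π * (n - 2 * t)) + Real.sinc (π * (n + 2 * t)))|
      ≤ |Real.sinc (2 * π * t)| + |sgn n / 2 * (Real.sinc (π * (n - 2 * t)) + Real.sinc (π * (n + 2 * t)))| :=
        abs_add_le _ _
    _ ≤ 1 + 1 / 2 * (1 + 1) := by
        rw [abs_mul, hs]
        gcongr
        exact (abs_add_le _ _).trans (add_le_add h2 h3)
    _ = 2 := by norm_num

/-- The closed form away from the removable singularities: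
`ĝ_n(t) · 2πt(n² − 4t²) = n² sin(2πt)`. [cite: BaluyotGoldstonSuriajayaTurnageButterbaugh2025, Lemma 4] -/
theorem gHat_mul_eq {n : ℕ} {t : ℝ} (ht : t ≠ 0) (h1 : (n : ℝ) - 2 * t ≠ 0) (h2 : (n : ℝ) + 2 * t ≠ 0) :
    gHat n t * (2 * π * t * ((n : ℝ) ^ 2 - 4 * t ^ 2)) = (n : ℝ) ^ 2 * Real.sin (2 * π * t) := by
  unfold gHat
  rw [Real.sinc_of_ne_zero (by positivity), Real.sinc_of_ne_zero (mul_ne_zero Real.pi_ne_zero h1),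
    Real.sinc_of_ne_zero (mul_ne_zero Real.pi_ne_zero h2)]
  have hs1 : Real.sin (π * (n - 2 * t)) = -((-1) ^ n * Real.sin (2 * π * t)) := by
    rw [show π * (n - 2 * t) = n * π - 2 * π * t by ring, Real.sin_nat_mul_pi_sub]
  have hs2 : Real.sin (π * (n + 2 * t)) = (-1) ^ n * Real.sin (2 * π * t) := by
    rw [show π * (n + 2 * t) = 2 * π * t + n * π by ring, Real.sin_add_nat_mul_pi]
  rw [hs1, hs2]
  have hπt : 2 * π * t ≠ 0 := by positivity
  have hA : π * ((n : ℝ) - 2 * t) ≠ 0 := mul_ne_zero Real.pi_ne_zero h1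
  have hB : π * ((n : ℝ) + 2 * t) ≠ 0 := mul_ne_zero Real.pi_ne_zero h2
  rcases Nat.even_or_odd n with he | ho
  · rw [sgn_of_even he, he.neg_one_pow]
    field_simp
    ring
  · rw [sgn_of_odd ho, ho.neg_one_pow]
    field_simp
    ring

/-- **Decay: `|ĝ_n(t)| ≤ n²/(6π|t|³)` for `|t| ≥ n ≥ 1`.** [cite: BaluyotGoldstonSuriajayaTurnageButterbaugh2025, Lemma 4 (g_nbound)] -/
theorem abs_gHat_le_of_le_abs {n : ℕ} (hn : 1 ≤ n) {t : ℝ} (ht : (n : ℝ) ≤ |t|) :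
    |gHat n t| ≤ (n : ℝ) ^ 2 / (6 * π * |t| ^ 3) := by
  have hn1 : (1 : ℝ) ≤ n := by exact_mod_cast hn
  have ht1 : 1 ≤ |t| := hn1.trans ht
  have ht0 : t ≠ 0 := by intro h; rw [h, abs_zero] at ht1; linarith
  have htabs : 0 < |t| := by linarith
  have h4 : 3 * t ^ 2 ≤ 4 * t ^ 2 - (n : ℝ) ^ 2 := by
    have : (n : ℝ) ^ 2 ≤ |t| ^ 2 := pow_le_pow_left₀ (by positivity) ht 2
    rw [sq_abs] at this; linarith
  have hpos : 0 < 4 * t ^ 2 - (n : ℝ) ^ 2 := by nlinarith [sq_abs t]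
  have h1 : (n : ℝ) - 2 * t ≠ 0 := by
    intro h
    have : |t| = n / 2 := by rw [show t = n / 2 by linarith, abs_of_nonneg (by positivity)]
    rw [this] at ht; linarith
  have h2 : (n : ℝ) + 2 * t ≠ 0 := by
    intro h
    have : |t| = n / 2 := by rw [show t = -(n / 2) by linarith, abs_neg, abs_of_nonneg (by positivity)]
    rw [this] at ht; linarith
  have key := gHat_mul_eq ht0 h1 h2
  have hD : 2 * π * t * ((n : ℝ) ^ 2 - 4 * t ^ 2) ≠ 0 := by
    apply mul_ne_zero (by positivity); linarith
  have e : gHat n t = (n : ℝ) ^ 2 * Real.sin (2 * π * t) / (2 * π * t * ((n : ℝ) ^ 2 - 4 * t ^ 2)) := by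
    rw [eq_div_iff hD, key]
  rw [e, abs_div, abs_mul, abs_mul, abs_mul, abs_pow, Nat.abs_cast, abs_mul, abs_two,
    abs_of_pos Real.pi_pos, show |(n : ℝ) ^ 2 - 4 * t ^ 2| = 4 * t ^ 2 - (n : ℝ) ^ 2 by
      rw [abs_sub_comm, abs_of_pos hpos]]
  rw [div_le_div_iff₀ (by positivity) (by positivity)]
  have hsin := Real.abs_sin_le_one (2 * π * t)
  have : |t| ^ 3 = |t| * t ^ 2 := by rw [pow_succ, sq_abs]; ring
  rw [this]
  have hn2 : 0 ≤ (n : ℝ) ^ 2 := by positivity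
  calc (n : ℝ) ^ 2 * |Real.sin (2 * π * t)| * (6 * π * (|t| * t ^ 2))
      ≤ (n : ℝ) ^ 2 * 1 * (6 * π * (|t| * t ^ 2)) := by gcongr
    _ = (n : ℝ) ^ 2 * (2 * π * |t| * (3 * t ^ 2)) := by ring
    _ ≤ (n : ℝ) ^ 2 * (2 * π * |t| * (4 * t ^ 2 - (n : ℝ) ^ 2)) := by gcongr

/-- **Uniform decay `|ĝ_n(t)| ≤ 16(n+1)³ (1 + |t|)^{-3}`** (combining `|ĝ_n| ≤ 2` on `|t| ≤ n` with
the cubic decay beyond). [cite: BaluyotGoldstonSuriajayaTurnageButterbaugh2025, Lemma 4 (g_nbound)] -/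
theorem abs_gHat_le_decay {n : ℕ} (hn : 1 ≤ n) (t : ℝ) :
    |gHat n t| ≤ 16 * ((n : ℝ) + 1) ^ 3 * ((1 + |t|) ^ 3)⁻¹ := by
  have hn1 : (1 : ℝ) ≤ n := by exact_mod_cast hn
  have ht0 : 0 ≤ |t| := abs_nonneg t
  rw [← div_eq_mul_inv, le_div_iff₀ (by positivity)]
  rcases le_or_gt (n : ℝ) |t| with h | h
  · have hd := abs_gHat_le_of_le_abs hn h
    have ht1 : 1 ≤ |t| := hn1.trans h
    have h8 : (1 + |t|) ^ 3 ≤ 8 * |t| ^ 3 := by nlinarith [pow_le_pow_left₀ zero_le_one ht1 2]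
    calc |gHat n t| * (1 + |t|) ^ 3 ≤ (n : ℝ) ^ 2 / (6 * π * |t| ^ 3) * (8 * |t| ^ 3) := by
          gcongr
      _ = (n : ℝ) ^ 2 * 8 / (6 * π) := by field_simp
      _ ≤ (n : ℝ) ^ 2 * 8 / 6 :=
          div_le_div_of_nonneg_left (by positivity) (by norm_num) (by nlinarith [Real.pi_gt_three])
      _ ≤ 16 * ((n : ℝ) + 1) ^ 3 := by nlinarith
  · have h2 := abs_gHat_le_two n t
    calc |gHat n t| * (1 + |t|) ^ 3 ≤ 2 * (1 + (n : ℝ)) ^ 3 := by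
          gcongr
      _ ≤ 16 * ((n : ℝ) + 1) ^ 3 := by nlinarith [pow_nonneg (show (0:ℝ) ≤ 1 + n by positivity) 3]

/-- **Lipschitz bound for `ĝ`**: if `‖g‖ ≤ B` and `g = 0` off `[-1, 1]`, then
`‖ĝ(x) − ĝ(y)‖ ≤ 4πB |x − y|` (`|e(−vx) − e(−vy)| ≤ 2π|v||x − y|`; BGSTB 2025, §3, proof of Lemma 3:
"`|r(t+h) − r(t)| ≪ min{1, |h|}`"). [cite: BaluyotGoldstonSuriajayaTurnageButterbaugh2025, §3 (proof of Lemma 3)] -/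
theorem norm_fourier_sub_fourier_le_of_support {g : ℝ → ℂ} (hg : Integrable g) {B : ℝ}
    (hB : ∀ v, ‖g v‖ ≤ B) (hsupp : ∀ v, 1 < |v| → g v = 0) (x y : ℝ) :
    ‖𝓕 g x - 𝓕 g y‖ ≤ 4 * π * B * |x - y| := by
  have hB0 : 0 ≤ B := (norm_nonneg _).trans (hB 0)
  have hint : ∀ z : ℝ, Integrable fun v : ℝ ↦ Complex.exp (↑(-2 * π * v * z) * Complex.I) * g v := by
    intro z
    refine hg.bdd_mul (c := 1) ?_ (Eventually.of_forall fun v ↦ ?_)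
    · exact (by fun_prop : Continuous fun v : ℝ ↦
        Complex.exp (↑(-2 * π * v * z) * Complex.I)).aestronglyMeasurable
    · rw [Complex.norm_exp_ofReal_mul_I]
  have e0 : 𝓕 g x - 𝓕 g y =
      ∫ v, (Complex.exp (↑(-2 * π * v * x) * Complex.I) * g v -
        Complex.exp (↑(-2 * π * v * y) * Complex.I) * g v) := by
    rw [Real.fourier_real_eq_integral_exp_smul, Real.fourier_real_eq_integral_exp_smul]
    simp_rw [smul_eq_mul]
    rw [integral_sub (hint x) (hint y)]
  have hbound : ∀ v : ℝ, ‖Complex.exp (↑(-2 * π * v * x) * Complex.I) * g v -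
      Complex.exp (↑(-2 * π * v * y) * Complex.I) * g v‖ ≤
      (Icc (-1 : ℝ) 1).indicator (fun _ ↦ 2 * π * |x - y| * B) v := by
    intro v
    by_cases hv : v ∈ Icc (-1 : ℝ) 1
    · rw [indicator_of_mem hv, ← sub_mul, norm_mul]
      have hv1 : |v| ≤ 1 := abs_le.mpr ⟨by linarith [hv.1], hv.2⟩
      have hphase : ‖Complex.exp (↑(-2 * π * v * x) * Complex.I) -
          Complex.exp (↑(-2 * π * v * y) * Complex.I)‖ ≤ 2 * π * |x - y| * |v| := by
        have e : Complex.exp (↑(-2 * π * v * x) * Complex.I) -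
            Complex.exp (↑(-2 * π * v * y) * Complex.I) =
            Complex.exp (↑(-2 * π * v * y) * Complex.I) *
              (Complex.exp (Complex.I * ↑(-2 * π * v * (x - y))) - 1) := by
          rw [mul_sub, mul_one, ← Complex.exp_add]
          congr 2
          push_cast
          ring
        rw [e, norm_mul, Complex.norm_exp_ofReal_mul_I, one_mul]
        refine (Real.norm_exp_I_mul_ofReal_sub_one_le).trans (le_of_eq ?_)
        rw [Real.norm_eq_abs, abs_mul, abs_mul, abs_mul, abs_neg, abs_two, abs_of_pos Real.pi_pos]
        ring
      calc ‖Complex.exp (↑(-2 * π * v * x) * Complex.I) -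
            Complex.exp (↑(-2 * π * v * y) * Complex.I)‖ * ‖g v‖
          ≤ 2 * π * |x - y| * |v| * B := mul_le_mul hphase (hB v) (norm_nonneg _) (by positivity)
        _ ≤ 2 * π * |x - y| * 1 * B := by gcongr
        _ = 2 * π * |x - y| * B := by ring
    · rw [indicator_of_notMem hv]
      have : 1 < |v| := by
        rw [Set.mem_Icc, not_and_or, not_le, not_le] at hv
        rcases hv with h | h
        · rw [abs_of_neg (by linarith)]; linarith
        · rw [abs_of_pos (by linarith)]; linarith
      rw [hsupp v this, mul_zero, mul_zero, sub_self, norm_zero]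
  rw [e0]
  calc ‖∫ v, (Complex.exp (↑(-2 * π * v * x) * Complex.I) * g v -
        Complex.exp (↑(-2 * π * v * y) * Complex.I) * g v)‖
      ≤ ∫ v, (Icc (-1 : ℝ) 1).indicator (fun _ ↦ 2 * π * |x - y| * B) v :=
        norm_integral_le_of_norm_le (integrable_indicator_Icc_const _ _ _) (Eventually.of_forall hbound)
    _ = 4 * π * B * |x - y| := by rw [integral_indicator_Icc_const (by norm_num)]; ring

/-- **Lipschitz bound `|ĝ_n(x) − ĝ_n(y)| ≤ 4π |x − y|`.** [cite: BaluyotGoldstonSuriajayaTurnageButterbaugh2025, §3 (proof of Lemma 3)] -/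
theorem abs_gHat_sub_le (n : ℕ) (x y : ℝ) : |gHat n x - gHat n y| ≤ 4 * π * |x - y| := by
  have hg : Integrable fun a : ℝ ↦ (gFun n a : ℂ) := (integrable_gFun n).ofReal
  have hB : ∀ v, ‖(gFun n v : ℂ)‖ ≤ 1 := fun v ↦ by
    rw [Complex.norm_real, Real.norm_eq_abs]; exact abs_gFun_le_one n v
  have h := norm_fourier_sub_fourier_le_of_support hg hB
    (fun v hv ↦ by rw [gFun_eq_zero_of_one_lt hv, Complex.ofReal_zero]) x y
  rw [fourier_gFun, fourier_gFun, ← Complex.ofReal_sub, Complex.norm_real, Real.norm_eq_abs] at h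
  linarith

/-- The antiderivative `a sin(ca)/c + cos(ca)/c²` of `a cos(ca)`. [folklore] -/
private theorem hasDerivAt_mul_cos_primitive {c : ℝ} (hc : c ≠ 0) (a : ℝ) :
    HasDerivAt (fun a : ℝ ↦ a * Real.sin (c * a) / c + Real.cos (c * a) / c ^ 2)
      (a * Real.cos (c * a)) a := by
  have h0 : HasDerivAt (fun a : ℝ ↦ c * a) c a := by
    simpa using (hasDerivAt_id' a).const_mul c
  have h1 : HasDerivAt (fun a : ℝ ↦ Real.sin (c * a)) (Real.cos (c * a) * c) a := h0.sin
  have h2 : HasDerivAt (fun a : ℝ ↦ Real.cos (c * a)) (-Real.sin (c * a) * c) a := h0.cos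
  have h3 := ((hasDerivAt_id' a).mul h1).div_const c
  have h4 := h2.div_const (c ^ 2)
  have h5 : HasDerivAt (fun a : ℝ ↦ a * Real.sin (c * a) / c + Real.cos (c * a) / c ^ 2)
      ((1 * Real.sin (c * a) + a * (Real.cos (c * a) * c)) / c + -Real.sin (c * a) * c / c ^ 2) a :=
    h3.add h4
  refine h5.congr_deriv ?_
  field_simp
  ring

/-- `∫_0^1 a cos(nπa) da = ((−1)^n − 1)/(n²π²)` for `n ≥ 1`. [folklore] -/
private theorem integral_mul_cos_nat_pi {n : ℕ} (hn : 1 ≤ n) :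
    ∫ a in (0 : ℝ)..1, a * Real.cos (n * π * a) = ((-1) ^ n - 1) / ((n : ℝ) ^ 2 * π ^ 2) := by
  have hc : (n : ℝ) * π ≠ 0 := mul_ne_zero (by exact_mod_cast (show n ≠ 0 by omega)) Real.pi_ne_zero
  rw [intervalIntegral.integral_eq_sub_of_hasDerivAt (fun a _ ↦ hasDerivAt_mul_cos_primitive hc a)
    ((by fun_prop : Continuous fun a : ℝ ↦ a * Real.cos (n * π * a)).intervalIntegrable _ _)]
  simp only [mul_one, mul_zero, Real.sin_zero, Real.cos_zero, zero_div, zero_add]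
  rw [Real.sin_nat_mul_pi, Real.cos_nat_mul_pi]
  field_simp
  ring

/-- **The right-hand side of (MT-Pairs) for `g_n`:**
`g_n(0) + ∫_{-1}^{1} |α| g_n(α) dα = ½` for `n` even, `3/2 − 2/(π²n²)` for `n` odd
(BGSTB 2025, §3, proof of Theorem 1: "by an elementary calculation using (g_n)").
[cite: BaluyotGoldstonSuriajayaTurnageButterbaugh2025, §3 (proof of Theorem 1)] -/
theorem gProfile_zero_add_integral {n : ℕ} (hn : 1 ≤ n) :
    gProfile n 0 + ∫ a in (-1 : ℝ)..1, |a| * gProfile n a =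
      (1 + sgn n) / 2 + 1 / 2 + sgn n * (((-1) ^ n - 1) / ((n : ℝ) ^ 2 * π ^ 2)) := by
  rw [gProfile_zero]
  have hcont : Continuous fun a : ℝ ↦ |a| * gProfile n a := continuous_abs.mul (continuous_gProfile n)
  have heven : ∀ a : ℝ, |-a| * gProfile n (-a) = |a| * gProfile n a := by
    intro a; rw [abs_neg]; unfold gProfile; rw [mul_neg, Real.cos_neg]
  -- split at `0` and fold the negative half
  rw [← intervalIntegral.integral_add_adjacent_intervals (b := 0) (hcont.intervalIntegrable _ _)
    (hcont.intervalIntegrable _ _)]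
  have hneg : ∫ a in (-1 : ℝ)..0, |a| * gProfile n a = ∫ a in (0 : ℝ)..1, |a| * gProfile n a := by
    have := intervalIntegral.integral_comp_neg (a := (0 : ℝ)) (b := 1) (fun a ↦ |a| * gProfile n a)
    simp only [neg_zero] at this
    rw [← this]
    exact intervalIntegral.integral_congr fun a _ ↦ heven a
  rw [hneg, ← two_mul]
  have hpos : ∫ a in (0 : ℝ)..1, |a| * gProfile n a = ∫ a in (0 : ℝ)..1, a * gProfile n a := by
    refine intervalIntegral.integral_congr fun a ha ↦ ?_
    rw [Set.uIcc_of_le zero_le_one] at ha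
    rw [abs_of_nonneg ha.1]
  rw [hpos]
  have e : (fun a : ℝ ↦ a * gProfile n a) = fun a ↦ (1 / 2 : ℝ) * a + sgn n / 2 * (a * Real.cos (n * π * a)) := by
    funext a; unfold gProfile; ring
  rw [e, intervalIntegral.integral_add
    ((by fun_prop : Continuous fun a : ℝ ↦ (1 / 2 : ℝ) * a).intervalIntegrable _ _)
    ((by fun_prop : Continuous fun a : ℝ ↦ sgn n / 2 * (a * Real.cos (n * π * a))).intervalIntegrable _ _),
    intervalIntegral.integral_const_mul, intervalIntegral.integral_const_mul, integral_id,
    integral_mul_cos_nat_pi hn]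
  ring

/-- `g_n(0) + 2∫₀¹ α g_n(α) dα = ½` for `n` even. [cite: BaluyotGoldstonSuriajayaTurnageButterbaugh2025, §3 (proof of Theorem 1)] -/
theorem gProfile_zero_add_integral_of_even {n : ℕ} (hn : 1 ≤ n) (he : Even n) :
    gProfile n 0 + ∫ a in (-1 : ℝ)..1, |a| * gProfile n a = 1 / 2 := by
  rw [gProfile_zero_add_integral hn, sgn_of_even he, he.neg_one_pow]; ring

/-- `g_n(0) + 2∫₀¹ α g_n(α) dα = 3/2 − 2/(π²n²)` for `n` odd. [cite: BaluyotGoldstonSuriajayaTurnageButterbaugh2025, §3 (proof of Theorem 1)] -/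
theorem gProfile_zero_add_integral_of_odd {n : ℕ} (ho : Odd n) :
    gProfile n 0 + ∫ a in (-1 : ℝ)..1, |a| * gProfile n a = 3 / 2 - 2 / (π ^ 2 * (n : ℝ) ^ 2) := by
  have hn : 1 ≤ n := by obtain ⟨k, rfl⟩ := ho; omega
  have hn0 : (n : ℝ) ≠ 0 := by exact_mod_cast (show n ≠ 0 by omega)
  rw [gProfile_zero_add_integral hn, sgn_of_odd ho, ho.neg_one_pow]
  field_simp
  ring

/-! ## D. Pair sums: (MT-Pairs) in `o(1)` form for `g_n`; the diagonal -/

/-- The normaliser `(T/2π) log T` is eventually positive. [folklore] -/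
private theorem eventually_normaliser_pos : ∀ᶠ T : ℝ in atTop, 0 < T / (2 * π) * Real.log T := by
  filter_upwards [eventually_gt_atTop (1 : ℝ)] with T hT
  exact mul_pos (by positivity) (Real.log_pos hT)

/-- **(MT-Pairs) for `g_n`, in `o(1)` form — PROVED under RH:**
`(1/((T/2π) log T)) ∑_{0<γ,γ'≤T} ĝ_n(((γ−γ')/2π) log T) w(γ−γ') → g_n(0) + 2∫₀¹ α g_n(α) dα`
(BGSTB 2025, (MT-Pairs) second display with `o(1)` in place of `O(1/√log T)`, applied to `g = g_n`;
first display = the tree's `AH.sum_fourier_pairSpacing_eq_integral`).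
[cite: BaluyotGoldstonSuriajayaTurnageButterbaugh2025, §2 (MT-Pairs)] -/
theorem tendsto_sum_gHat_div (hRH : RiemannHypothesis) (n : ℕ) :
    Tendsto (fun T : ℝ ↦ (∑ p ∈ zeroIndexSet T ×ˢ zeroIndexSet T,
        gHat n (pairSpacing T p) * montgomeryWeight (zetaOrdinate p.1 - zetaOrdinate p.2)) /
          (T / (2 * π) * Real.log T)) atTop
      (𝓝 (gProfile n 0 + ∫ a in (-1 : ℝ)..1, |a| * gProfile n a)) := by
  have hB := tendsto_integral_formFactor_indicator_mul hRH (continuous_gProfile n)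
  refine hB.congr' ?_
  filter_upwards [eventually_gt_atTop (1 : ℝ)] with T hT
  have hN : 0 < T / (2 * π) * Real.log T := mul_pos (by positivity) (Real.log_pos hT)
  have h := sum_fourier_pairSpacing_eq_integral (gFun n) (integrable_gFun n) hT
  simp_rw [fourier_gFun] at h
  have h' : ((∑ p ∈ zeroIndexSet T ×ˢ zeroIndexSet T,
      gHat n (pairSpacing T p) * montgomeryWeight (zetaOrdinate p.1 - zetaOrdinate p.2) : ℝ) : ℂ) =
      ((T / (2 * π) * Real.log T * ∫ a : ℝ, montgomeryFormFactor a T * gFun n a : ℝ) : ℂ) := by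
    rw [← h]; push_cast; rfl
  have h'' := Complex.ofReal_injective h'
  rw [eq_div_iff hN.ne', h'', mul_comm]
  rfl

/-- **The diagonal: `P_0(T) ≥ 1 + o(1)`** ("`P_0 ≥ ((T/2π) log T)⁻¹ N(T) ≥ 1 + o(1)`", BGSTB 2025,
§3, end of the proof of Theorem 1; here with the cut `γ > T/log²T` of `𝒫(T, M)`: the diagonal pairs
`(γ, γ)` with `T/log²T < γ ≤ T` lie in `B_0`, and `N(T) − N(T/log²T) = (1 + o(1)) (T/2π) log T`).
[cite: BaluyotGoldstonSuriajayaTurnageButterbaugh2025, §3 (proof of Theorem 1, (thm1a))] -/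
theorem eventually_le_binDensity_zero {M δ : ℝ} (hM : 0 ≤ M) (hδ : 0 < δ) {ε : ℝ} (hε : 0 < ε) :
    ∀ᶠ T : ℝ in atTop, 1 - ε ≤ binDensity 0 T M δ := by
  obtain ⟨CN, hCN, hN⟩ := exists_zetaZeroCount_le_mul_log
  obtain ⟨C₂, T₂, hC₂, hlow⟩ := exists_zetaZeroCount_ge_sub
  -- `T / log² T → ∞` and `log T → ∞`
  have h1 : ∀ᶠ T : ℝ in atTop, 2 ≤ T / Real.log T ^ 2 :=
    RudnickSarnak.tendsto_div_log_sq_atTop.eventually_ge_atTop 2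
  have h2 : ∀ᶠ T : ℝ in atTop, (2 * π) * (C₂ + CN) / ε ≤ Real.log T :=
    Real.tendsto_log_atTop.eventually_ge_atTop _
  filter_upwards [h1, h2, eventually_ge_atTop T₂, eventually_gt_atTop (1 : ℝ),
    eventually_ge_atTop (Real.exp 1)] with T hT1 hT2 hT₂ hT hTe
  have hT0 : 0 < T := by linarith
  have hL : 0 < Real.log T := Real.log_pos hT
  have hL1 : 1 ≤ Real.log T := by
    rw [← Real.log_exp 1]; exact Real.log_le_log (Real.exp_pos 1) hTe
  have hN0 : 0 < T / (2 * π) * Real.log T := by positivity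
  set u : ℝ := T / Real.log T ^ 2 with hu
  -- the diagonal pairs above the cut lie in `B_0`
  set D : Finset (ℕ × ℕ) := ((zeroIndexSet T).filter fun i ↦ u < zetaOrdinate i).image
    fun i ↦ (i, i) with hD
  have hDsub : D ⊆ bin 0 T M δ := by
    intro p hp
    rw [hD, Finset.mem_image] at hp
    obtain ⟨i, hi, rfl⟩ := hp
    rw [Finset.mem_filter] at hi
    rw [mem_bin, mem_pairs]
    have hps : pairSpacing T (i, i) = 0 := by simp [pairSpacing]
    refine ⟨⟨Finset.mem_product.mpr ⟨hi.1, hi.1⟩, hi.2, hi.2, ?_⟩, ?_, ?_⟩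
    · rw [hps, abs_zero]; exact hM
    · rw [hps]; push_cast; linarith
    · rw [hps]; push_cast; linarith
  have hDcard : D.card = ((zeroIndexSet T).filter fun i ↦ u < zetaOrdinate i).card :=
    Finset.card_image_of_injective _ fun i j h ↦ (Prod.mk.inj h).1
  -- counting: `#D = N(T) − #{γ_i ≤ u} ≥ N(T) − N(u)`
  have hsplit : ((zeroIndexSet T).filter fun i ↦ u < zetaOrdinate i).card +
      ((zeroIndexSet T).filter fun i ↦ zetaOrdinate i ≤ u).card = zetaZeroCount T := by
    have e : ((zeroIndexSet T).filter fun i ↦ ¬ u < zetaOrdinate i) =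
        (zeroIndexSet T).filter fun i ↦ zetaOrdinate i ≤ u :=
      Finset.filter_congr fun i _ ↦ by rw [not_lt]
    rw [← card_zeroIndexSet T, ← e]
    exact Finset.card_filter_add_card_filter_not _
  have hlowc := card_filter_zetaOrdinate_le_le T u
  have hNu : (zetaZeroCount u : ℝ) ≤ CN * (u * Real.log u) := hN u hT1
  have hulog : u * Real.log u ≤ T / Real.log T := by
    have hlu : Real.log u ≤ Real.log T := by
      apply Real.log_le_log (by linarith)
      rw [hu, div_le_iff₀ (by positivity)]
      have h1' : (1 : ℝ) ≤ Real.log T ^ 2 := one_le_pow₀ hL1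
      calc T = T * 1 := (mul_one T).symm
        _ ≤ T * Real.log T ^ 2 := mul_le_mul_of_nonneg_left h1' hT0.le
    have hu0 : 0 ≤ u := by linarith
    calc u * Real.log u ≤ u * Real.log T := mul_le_mul_of_nonneg_left hlu hu0
      _ = T / Real.log T := by rw [hu]; field_simp
  have hNT := hlow T hT₂
  -- assemble
  have hcardR : T / (2 * π) * Real.log T - C₂ * T - CN * (T / Real.log T) ≤ (D.card : ℝ) := by
    have e : (D.card : ℝ) = (zetaZeroCount T : ℝ) -
        ((zeroIndexSet T).filter fun i ↦ zetaOrdinate i ≤ u).card := by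
      rw [hDcard]
      have := congrArg (fun m : ℕ ↦ (m : ℝ)) hsplit
      push_cast at this
      linarith
    rw [e]
    have : (((zeroIndexSet T).filter fun i ↦ zetaOrdinate i ≤ u).card : ℝ) ≤ CN * (T / Real.log T) :=
      calc (((zeroIndexSet T).filter fun i ↦ zetaOrdinate i ≤ u).card : ℝ) ≤ zetaZeroCount u := by
            exact_mod_cast hlowc
        _ ≤ CN * (u * Real.log u) := hNu
        _ ≤ CN * (T / Real.log T) := mul_le_mul_of_nonneg_left hulog hCN.le
    linarith
  have hmono : (D.card : ℝ) ≤ (bin 0 T M δ).card := by exact_mod_cast Finset.card_le_card hDsub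
  rw [binDensity, le_div_iff₀ hN0]
  -- `(C₂ + CN/L) T ≤ ε (T/2π) L`
  have hkey : C₂ * T + CN * (T / Real.log T) ≤ ε * (T / (2 * π) * Real.log T) := by
    have h3 : CN * (T / Real.log T) ≤ CN * T := by
      apply mul_le_mul_of_nonneg_left _ hCN.le
      rw [div_le_iff₀ hL]; nlinarith
    have h4 : (2 * π) * (C₂ + CN) ≤ ε * Real.log T := by
      rw [div_le_iff₀ hε] at hT2; linarith
    have h5 : (C₂ + CN) * T ≤ ε * (T / (2 * π) * Real.log T) := by
      rw [show ε * (T / (2 * π) * Real.log T) = (ε * Real.log T) * T / (2 * π) by ring]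
      rw [le_div_iff₀ (by positivity)]
      nlinarith
    nlinarith
  nlinarith

/-! ## E. BGSTB 2025, Lemma 2: the pairs outside `𝒫(T, M)` contribute `o(T log T) + O(T log T/M)` -/

/-- The normalised difference in Montgomery's variable: `((γ−γ')/2π) log T = (log T/2π)(γ − γ')`
(the form used by the tree's `RudnickSarnak` pair counts). [cite: BaluyotGoldstonSuriajayaTurnageButterbaugh2025, §1 (P(T,M))] -/
theorem pairSpacing_eq (T : ℝ) (p : ℕ × ℕ) :
    pairSpacing T p = Real.log T / (2 * π) * (zetaOrdinate p.1 - zetaOrdinate p.2) := by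
  unfold pairSpacing; ring

/-- Zeros indexed by `zeroIndexSet T` have ordinates in `(0, T]`, so `|γ − γ'| ≤ T`. [cite: Titchmarsh1986, §9.1] -/
theorem abs_sub_zetaOrdinate_le {T : ℝ} {p : ℕ × ℕ} (hp : p ∈ zeroIndexSet T ×ˢ zeroIndexSet T) :
    |zetaOrdinate p.1 - zetaOrdinate p.2| ≤ T := by
  rw [Finset.mem_product] at hp
  have h1 := zetaOrdinate_le_of_mem_zeroIndexSet hp.1
  have h2 := zetaOrdinate_le_of_mem_zeroIndexSet hp.2
  have h3 := zetaOrdinate_pos_holds p.1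
  have h4 := zetaOrdinate_pos_holds p.2
  rw [abs_le]; constructor <;> linarith

/-- Two adjacent unit windows in Montgomery's variable `L γ/2π`: a window of half-width `1`
contains `≤ 2 C₁ log T` indices. [cite: Titchmarsh1986, Thm. 9.2] -/
theorem card_filter_abs_scaled_sub_le {T C₁ : ℝ} (hL : 2 * π ≤ Real.log T)
    (hwin : ∀ a : ℝ, (((Finset.range (zetaZeroCount T)).filter fun c ↦
      a ≤ zetaOrdinate c ∧ zetaOrdinate c ≤ a + 1).card : ℝ) ≤ C₁ * Real.log T) (x s : ℝ) :
    (((zeroIndexSet T).filter fun j ↦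
        |Real.log T / (2 * π) * (x - zetaOrdinate j) - s| ≤ 1).card : ℝ) ≤ 2 * (C₁ * Real.log T) := by
  set c : ℝ := Real.log T / (2 * π) with hc
  set v : ℝ := c * x - s - 1 with hv
  have hsub : ((zeroIndexSet T).filter fun j ↦ |c * (x - zetaOrdinate j) - s| ≤ 1) ⊆
      ((Finset.range (zetaZeroCount T)).filter fun j ↦ v ≤ c * zetaOrdinate j ∧ c * zetaOrdinate j ≤ v + 1) ∪
      ((Finset.range (zetaZeroCount T)).filter fun j ↦
        v + 1 ≤ c * zetaOrdinate j ∧ c * zetaOrdinate j ≤ v + 1 + 1) := by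
    intro j hj
    rw [Finset.mem_filter] at hj
    have hjr : j ∈ Finset.range (zetaZeroCount T) := hj.1
    obtain ⟨h1, h2⟩ := abs_le.mp hj.2
    rw [Finset.mem_union, Finset.mem_filter, Finset.mem_filter]
    by_cases h : c * zetaOrdinate j ≤ v + 1
    · exact Or.inl ⟨hjr, by rw [hv]; linarith [mul_sub c x (zetaOrdinate j)], h⟩
    · push Not at h
      exact Or.inr ⟨hjr, h.le, by rw [hv]; linarith [mul_sub c x (zetaOrdinate j)]⟩
  calc (((zeroIndexSet T).filter fun j ↦ |c * (x - zetaOrdinate j) - s| ≤ 1).card : ℝ)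
      ≤ ((((Finset.range (zetaZeroCount T)).filter fun j ↦
            v ≤ c * zetaOrdinate j ∧ c * zetaOrdinate j ≤ v + 1) ∪
          ((Finset.range (zetaZeroCount T)).filter fun j ↦
            v + 1 ≤ c * zetaOrdinate j ∧ c * zetaOrdinate j ≤ v + 1 + 1)).card : ℝ) := by
        exact_mod_cast Finset.card_le_card hsub
    _ ≤ (((Finset.range (zetaZeroCount T)).filter fun j ↦
            v ≤ c * zetaOrdinate j ∧ c * zetaOrdinate j ≤ v + 1).card : ℝ) +
        (((Finset.range (zetaZeroCount T)).filter fun j ↦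
            v + 1 ≤ c * zetaOrdinate j ∧ c * zetaOrdinate j ≤ v + 1 + 1).card : ℝ) := by
        exact_mod_cast Finset.card_union_le _ _
    _ ≤ C₁ * Real.log T + C₁ * Real.log T :=
        add_le_add (RudnickSarnak.card_filter_scaled_window_le hL hwin v)
          (RudnickSarnak.card_filter_scaled_window_le hL hwin (v + 1))
    _ = 2 * (C₁ * Real.log T) := by ring

set_option maxHeartbeats 1600000 in
/-- **BGSTB 2025, Lemma 2 for `r = ĝ_n`** (removing the pairs outside `𝒫(T, M)`): assuming RH,
for every `ε > 0` there is `M₀` such that for all `M ≥ M₀` and all large `T`,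
`|∑_{0<γ,γ'≤T} ĝ_n(y) w − ∑_{(γ,γ')∈𝒫(T,M)} ĝ_n(y) w| ≤ ε (T/2π) log T` (`y = ((γ−γ')/2π) log T`).
Printed: "`= ∑_{𝒫(T,M)} + O(C(r) T log T/M^{b−1}) + O(T)`" with `b = 3`; here with the decay
`(1+|t|)^{-3}` of `ĝ_n`, the pair count at scale `1/log T` (tree: Fejér-kernel corollary of
Montgomery's theorem, `RudnickSarnak.exists_pairCount_window_le`) for `M < |y| ≲ log T`, unit
windows for `|γ − γ'| ≳ 1`, and the low pairs `γ ≤ T/log²T` being `O(T)`.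
[cite: BaluyotGoldstonSuriajayaTurnageButterbaugh2025, Lemma 2] -/
theorem eventually_abs_sum_sub_sum_pairs_le (hRH : RiemannHypothesis) {n : ℕ} (hn : 1 ≤ n)
    {ε : ℝ} (hε : 0 < ε) :
    ∃ M₀ : ℝ, 0 < M₀ ∧ ∀ M : ℝ, M₀ ≤ M → ∀ᶠ T : ℝ in atTop,
      |∑ p ∈ zeroIndexSet T ×ˢ zeroIndexSet T,
          gHat n (pairSpacing T p) * montgomeryWeight (zetaOrdinate p.1 - zetaOrdinate p.2) -
        ∑ p ∈ pairs T M,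
          gHat n (pairSpacing T p) * montgomeryWeight (zetaOrdinate p.1 - zetaOrdinate p.2)| ≤
        ε * (T / (2 * π) * Real.log T) := by
  obtain ⟨y₀, hy₀, C_w, hwinE⟩ := RudnickSarnak.exists_pairCount_window_le hRH
  obtain ⟨C₁, hC₁, hunitE⟩ := RudnickSarnak.eventually_card_filter_zetaOrdinate_window_le
  obtain ⟨C₀, hC₀, hW⟩ := Montgomery.exists_zetaZeroCount_window_le
  obtain ⟨CN, hCN, hN⟩ := exists_zetaZeroCount_le_mul_log
  set D : ℝ := 16 * ((n : ℝ) + 1) ^ 3 with hD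
  have hD0 : 0 < D := by positivity
  set Cw : ℝ := max C_w 1 with hCw
  have hCw1 : 1 ≤ Cw := le_max_right _ _
  have hCw0 : 0 < Cw := by linarith
  -- the constant of the `O(T)` terms and the threshold `M₀`
  set K : ℝ := 24 * CN * C₀ + 16 * π ^ 2 * D * CN * C₁ with hK
  have hK0 : 0 ≤ K := by positivity
  refine ⟨3 * y₀ + 12 * π * D * Cw / (y₀ * ε) + 1, by positivity, fun M hM ↦ ?_⟩
  have hM3 : 3 * y₀ ≤ M := by
    have : 0 ≤ 12 * π * D * Cw / (y₀ * ε) := by positivity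
    linarith
  have hM0 : 0 < M := by linarith
  have hMy : 12 * π * D * Cw / (y₀ * ε) < M - 2 * y₀ := by linarith
  filter_upwards [hwinE, hunitE, eventually_ge_atTop (4 : ℝ),
    Real.tendsto_log_atTop.eventually_ge_atTop (2 * π * M),
    Real.tendsto_log_atTop.eventually_ge_atTop (2 * π * (3 * y₀ + 2)),
    Real.tendsto_log_atTop.eventually_ge_atTop (6 * π * K / ε + 2),
    (RudnickSarnak.tendsto_div_log_sq_atTop).eventually_ge_atTop (1 : ℝ)]
    with T hwin hunit hT4 hLM hLy hLK hu1
  have hT0 : 0 < T := by linarith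
  have hT1 : 1 < T := by linarith
  have hL : 0 < Real.log T := Real.log_pos hT1
  set L : ℝ := Real.log T with hLdef
  have hL2π : 2 * π ≤ L := by nlinarith [Real.pi_pos]
  have hL2 : 2 ≤ L := by linarith [Real.pi_gt_three]
  set c : ℝ := L / (2 * π) with hc
  have hc0 : 0 < c := by positivity
  have hc1 : 1 ≤ c := by rw [hc, le_div_iff₀ (by positivity)]; linarith
  set Z := zeroIndexSet T with hZ
  set Ω := zeroIndexSet T ×ˢ zeroIndexSet T with hΩ
  set yM : ℕ × ℕ → ℝ := fun p ↦ c * (zetaOrdinate p.1 - zetaOrdinate p.2) with hyM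
  set w : ℕ × ℕ → ℝ := fun p ↦ montgomeryWeight (zetaOrdinate p.1 - zetaOrdinate p.2) with hw
  have hyeq : ∀ p, pairSpacing T p = yM p := fun p ↦ pairSpacing_eq T p
  set f : ℕ × ℕ → ℝ := fun p ↦ gHat n (yM p) * w p with hf
  have hfe : ∀ p, gHat n (pairSpacing T p) * montgomeryWeight (zetaOrdinate p.1 - zetaOrdinate p.2) = f p :=
    fun p ↦ by rw [hyeq]
  simp_rw [hfe]
  -- window bound with the positive constant `Cw`
  have hwin' : ∀ s : ℝ, |s| + y₀ ≤ L / π →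
      ((Ω.filter fun p ↦ |yM p - s| ≤ y₀).card : ℝ) ≤ Cw * (T * L) := by
    intro s hs
    refine (hwin s hs).trans ?_
    exact mul_le_mul_of_nonneg_right (le_max_left _ _) (by positivity)
  -- the cut and the ranges
  set u : ℝ := T / L ^ 2 with hu
  set BT : ℝ := L / π - 3 * y₀ with hBT
  have hBT1 : c + 2 ≤ BT := by
    rw [hBT, hc]
    have : L / π = 2 * (L / (2 * π)) := by field_simp
    rw [this]
    have : 3 * y₀ + 2 ≤ L / (2 * π) := by rw [le_div_iff₀ (by positivity)]; linarith
    linarith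
  have hBT3 : 3 ≤ BT := by linarith
  have hBT2 : c ≤ BT - 2 := by linarith
  have hBT0 : 0 < BT := by linarith
  set B' : ℝ := c * T with hB'
  -- `|f| ≤ |ĝ_n(y)|`, decay, and `|y| ≤ B'`
  have hfabs : ∀ p, |f p| ≤ |gHat n (yM p)| := by
    intro p
    rw [hf]; dsimp only
    rw [abs_mul, abs_of_pos (montgomeryWeight_pos _)]
    exact mul_le_of_le_one_right (abs_nonneg _) (montgomeryWeight_le_one _)
  have hdec : ∀ p, |gHat n (yM p)| ≤ D * ((1 + |yM p|) ^ 3)⁻¹ := fun p ↦ abs_gHat_le_decay hn _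
  have hyB' : ∀ p ∈ Ω, |yM p| ≤ B' := by
    intro p hp
    rw [hyM]; dsimp only
    rw [abs_mul, abs_of_pos hc0, hB']
    exact mul_le_mul_of_nonneg_left (abs_sub_zetaOrdinate_le hp) hc0.le
  -- the decomposition of `Ω \ 𝒫(T, M)`
  have hPΩ : pairs T M ⊆ Ω := fun p hp ↦ (mem_pairs.mp hp).1
  set A := Ω.filter fun p ↦ |yM p| ≤ M ∧ (zetaOrdinate p.1 ≤ u ∨ zetaOrdinate p.2 ≤ u) with hA
  set Bmid := Ω.filter fun p ↦ M < |yM p| ∧ |yM p| ≤ BT with hBmid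
  set Cfar := Ω.filter fun p ↦ BT < |yM p| ∧ |yM p| ≤ B' with hCfar
  have hcover : Ω \ pairs T M ⊆ A ∪ (Bmid ∪ Cfar) := by
    intro p hp
    rw [Finset.mem_sdiff] at hp
    obtain ⟨hpΩ, hpP⟩ := hp
    rw [mem_pairs, hyeq, not_and] at hpP
    have hnot := hpP hpΩ
    rw [Finset.mem_union, Finset.mem_union, hA, hBmid, hCfar, Finset.mem_filter, Finset.mem_filter,
      Finset.mem_filter]
    by_cases hyMle : |yM p| ≤ M
    · left
      refine ⟨hpΩ, hyMle, ?_⟩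
      by_contra hcon
      push Not at hcon
      exact hnot ⟨by rw [← hu]; exact hcon.1, by rw [← hu]; exact hcon.2, hyMle⟩
    · right
      push Not at hyMle
      by_cases hyB : |yM p| ≤ BT
      · exact Or.inl ⟨hpΩ, hyMle, hyB⟩
      · push Not at hyB
        exact Or.inr ⟨hpΩ, hyB, hyB' p hpΩ⟩
  -- |Σ_Ω f − Σ_P f| ≤ Σ_A |r| + Σ_Bmid |r| + Σ_Cfar |r|
  have hnn : ∀ p, 0 ≤ |gHat n (yM p)| := fun p ↦ abs_nonneg _
  have hmain : |∑ p ∈ Ω, f p - ∑ p ∈ pairs T M, f p| ≤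
      ∑ p ∈ A, |gHat n (yM p)| + (∑ p ∈ Bmid, |gHat n (yM p)| + ∑ p ∈ Cfar, |gHat n (yM p)|) := by
    rw [← Finset.sum_sdiff_eq_sub hPΩ]
    calc |∑ p ∈ Ω \ pairs T M, f p| ≤ ∑ p ∈ Ω \ pairs T M, |f p| := Finset.abs_sum_le_sum_abs _ _
      _ ≤ ∑ p ∈ Ω \ pairs T M, |gHat n (yM p)| := Finset.sum_le_sum fun p _ ↦ hfabs p
      _ ≤ ∑ p ∈ A ∪ (Bmid ∪ Cfar), |gHat n (yM p)| :=
          Finset.sum_le_sum_of_subset_of_nonneg hcover fun p _ _ ↦ hnn p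
      _ ≤ ∑ p ∈ A, |gHat n (yM p)| + ∑ p ∈ Bmid ∪ Cfar, |gHat n (yM p)| :=
          RudnickSarnak.sum_union_le_add _ _ hnn
      _ ≤ _ := by
          gcongr
          exact RudnickSarnak.sum_union_le_add _ _ hnn
  -- (a) the low pairs
  have hAcard : (A.card : ℝ) ≤ 12 * CN * C₀ * T := by
    have hclose : ∀ p ∈ A, |zetaOrdinate p.1 - zetaOrdinate p.2| ≤ 1 := by
      intro p hp
      rw [hA, Finset.mem_filter] at hp
      have h1 : |yM p| ≤ M := hp.2.1
      rw [hyM] at h1; dsimp only at h1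
      rw [abs_mul, abs_of_pos hc0] at h1
      have h2 : c * |zetaOrdinate p.1 - zetaOrdinate p.2| ≤ c * 1 := by
        rw [mul_one]
        refine h1.trans ?_
        rw [hc, le_div_iff₀ (by positivity)]; linarith
      exact le_of_mul_le_mul_left h2 hc0
    have hoff : ∀ p ∈ A, zetaOrdinate p.1 ≤ u ∨ zetaOrdinate p.2 ≤ u := fun p hp ↦ by
      rw [hA, Finset.mem_filter] at hp; exact hp.2.2
    have h1 := card_pairs_offWindow_le hC₀.le hW hT0.le (Finset.filter_subset _ _) hclose hoff
    -- `N(u + 1) ≤ 2 CN T / L`, `log(T + 4) ≤ 2 L`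
    have hu2 : 2 ≤ u + 1 := by linarith
    have huT : u + 1 ≤ T := by
      rw [hu]
      have : T / L ^ 2 ≤ T / 4 := by
        apply div_le_div_of_nonneg_left hT0.le (by norm_num)
        nlinarith
      linarith
    have hNu : (zetaZeroCount (u + 1) : ℝ) ≤ 2 * CN * T / L := by
      refine (hN (u + 1) hu2).trans ?_
      have hlog : Real.log (u + 1) ≤ L := Real.log_le_log (by linarith) huT
      have hlog0 : 0 ≤ Real.log (u + 1) := Real.log_nonneg (by linarith)
      calc CN * ((u + 1) * Real.log (u + 1)) ≤ CN * ((2 * u) * L) := by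
            apply mul_le_mul_of_nonneg_left _ hCN.le
            exact mul_le_mul (by linarith) hlog hlog0 (by linarith)
        _ = 2 * CN * T / L := by rw [hu]; field_simp
    have hlog4 : Real.log (T + 4) ≤ 2 * L := by
      have h2 : T + 4 ≤ T ^ 2 := by nlinarith
      calc Real.log (T + 4) ≤ Real.log (T ^ 2) := Real.log_le_log (by linarith) h2
        _ = 2 * L := by rw [Real.log_pow]; push_cast; rw [hLdef]
    calc (A.card : ℝ) ≤ zetaZeroCount (u + 1) * (3 * C₀ * Real.log (T + 4)) := h1
      _ ≤ (2 * CN * T / L) * (3 * C₀ * (2 * L)) := by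
          have hl0 : 0 ≤ Real.log (T + 4) := Real.log_nonneg (by linarith)
          apply mul_le_mul hNu (by nlinarith) (by positivity) (by positivity)
      _ = 12 * CN * C₀ * T := by field_simp; norm_num
  have hAsum : ∑ p ∈ A, |gHat n (yM p)| ≤ 24 * CN * C₀ * T :=
    calc ∑ p ∈ A, |gHat n (yM p)| ≤ ∑ p ∈ A, (2 : ℝ) := Finset.sum_le_sum fun p _ ↦ abs_gHat_le_two n _
      _ = A.card * 2 := by rw [Finset.sum_const, nsmul_eq_mul]
      _ ≤ 24 * CN * C₀ * T := by nlinarith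
  -- (b) the middle range, by the window bound at scale `1/log T`
  have hBsum : ∑ p ∈ Bmid, |gHat n (yM p)| ≤ D * (2 * (Cw * (T * L)) / (y₀ * (M - 2 * y₀))) := by
    have hR : (BT / y₀ + 5 / 2) * y₀ ≤ L / π := by
      have : (BT / y₀ + 5 / 2) * y₀ = BT + 5 / 2 * y₀ := by field_simp
      rw [this, hBT]; linarith
    have hmid := RudnickSarnak.sum_filter_mid_le Ω yM hy₀ hM3 (by positivity : (0 : ℝ) ≤ Cw * (T * L))
      hwin' hR
    calc ∑ p ∈ Bmid, |gHat n (yM p)| ≤ ∑ p ∈ Bmid, D * ((1 + |yM p|) ^ 2)⁻¹ := by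
          refine Finset.sum_le_sum fun p _ ↦ (hdec p).trans ?_
          apply mul_le_mul_of_nonneg_left _ hD0.le
          apply inv_anti₀ (by positivity)
          have : 1 ≤ 1 + |yM p| := by linarith [abs_nonneg (yM p)]
          calc (1 + |yM p|) ^ 2 = (1 + |yM p|) ^ 2 * 1 := (mul_one _).symm
            _ ≤ (1 + |yM p|) ^ 2 * (1 + |yM p|) := by gcongr
            _ = (1 + |yM p|) ^ 3 := by ring
      _ = D * ∑ p ∈ Bmid, ((1 + |yM p|) ^ 2)⁻¹ := by rw [Finset.mul_sum]
      _ ≤ D * (2 * (Cw * (T * L)) / (y₀ * (M - 2 * y₀))) := by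
          apply mul_le_mul_of_nonneg_left _ hD0.le
          rw [hBmid]
          exact hmid
  -- (c) the far range, by unit windows row by row
  have hCsum : ∑ p ∈ Cfar, |gHat n (yM p)| ≤ 16 * π ^ 2 * D * CN * C₁ * T := by
    -- row sums
    have hrow : ∀ i ∈ Z, ∑ j ∈ Z with BT < |yM (i, j)| ∧ |yM (i, j)| ≤ B',
        ((1 + |yM (i, j)|) ^ 2)⁻¹ ≤ 2 * (2 * (C₁ * L)) / (1 * (BT - 2 * 1)) := by
      intro i _
      have hwin_i : ∀ s : ℝ, |s| + 1 ≤ B' + 5 / 2 →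
          ((Z.filter fun j ↦ |yM (i, j) - s| ≤ 1).card : ℝ) ≤ 2 * (C₁ * L) := by
        intro s _
        exact card_filter_abs_scaled_sub_le hL2π hunit (zetaOrdinate i) s
      have h := RudnickSarnak.sum_filter_mid_le Z (fun j ↦ yM (i, j)) one_pos (by linarith : 3 * (1 : ℝ) ≤ BT)
        (by positivity : (0 : ℝ) ≤ 2 * (C₁ * L)) hwin_i (by linarith : (B' / 1 + 5 / 2) * 1 ≤ B' + 5 / 2)
      exact h
    have hCfar_sum : ∑ p ∈ Cfar, ((1 + |yM p|) ^ 2)⁻¹ ≤ zetaZeroCount T * (4 * (C₁ * L) / (BT - 2)) := by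
      have e : ∑ p ∈ Cfar, ((1 + |yM p|) ^ 2)⁻¹ =
          ∑ i ∈ Z, ∑ j ∈ Z with BT < |yM (i, j)| ∧ |yM (i, j)| ≤ B', ((1 + |yM (i, j)|) ^ 2)⁻¹ := by
        rw [hCfar, Finset.sum_filter, hΩ, Finset.sum_product]
        refine Finset.sum_congr rfl fun i _ ↦ ?_
        rw [Finset.sum_filter]
      rw [e]
      calc ∑ i ∈ Z, ∑ j ∈ Z with BT < |yM (i, j)| ∧ |yM (i, j)| ≤ B', ((1 + |yM (i, j)|) ^ 2)⁻¹
          ≤ ∑ i ∈ Z, 2 * (2 * (C₁ * L)) / (1 * (BT - 2 * 1)) := Finset.sum_le_sum hrow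
        _ = zetaZeroCount T * (4 * (C₁ * L) / (BT - 2)) := by
            rw [Finset.sum_const, nsmul_eq_mul, hZ, card_zeroIndexSet]; ring
    have hNT : (zetaZeroCount T : ℝ) ≤ CN * (T * L) := hN T (by linarith)
    have hBTinv : (1 + BT)⁻¹ ≤ c⁻¹ := inv_anti₀ hc0 (by linarith)
    have hBT2inv : 4 * (C₁ * L) / (BT - 2) ≤ 4 * (C₁ * L) / c :=
      div_le_div_of_nonneg_left (by positivity) hc0 hBT2
    calc ∑ p ∈ Cfar, |gHat n (yM p)| ≤ ∑ p ∈ Cfar, D * (1 + BT)⁻¹ * ((1 + |yM p|) ^ 2)⁻¹ := by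
          refine Finset.sum_le_sum fun p hp ↦ (hdec p).trans ?_
          rw [hCfar, Finset.mem_filter] at hp
          have hy : BT < |yM p| := hp.2.1
          have h1 : 0 < 1 + |yM p| := by positivity
          have key : ((1 + |yM p|) ^ 3)⁻¹ ≤ (1 + BT)⁻¹ * ((1 + |yM p|) ^ 2)⁻¹ := by
            rw [← mul_inv]
            apply inv_anti₀ (by positivity)
            calc (1 + BT) * (1 + |yM p|) ^ 2 ≤ (1 + |yM p|) * (1 + |yM p|) ^ 2 := by
                  apply mul_le_mul_of_nonneg_right (by linarith) (by positivity)
              _ = (1 + |yM p|) ^ 3 := by ring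
          calc D * ((1 + |yM p|) ^ 3)⁻¹ ≤ D * ((1 + BT)⁻¹ * ((1 + |yM p|) ^ 2)⁻¹) :=
                mul_le_mul_of_nonneg_left key hD0.le
            _ = D * (1 + BT)⁻¹ * ((1 + |yM p|) ^ 2)⁻¹ := by ring
      _ = D * (1 + BT)⁻¹ * ∑ p ∈ Cfar, ((1 + |yM p|) ^ 2)⁻¹ := by rw [Finset.mul_sum]
      _ ≤ D * c⁻¹ * (CN * (T * L) * (4 * (C₁ * L) / c)) := by
          have hq0 : 0 ≤ 4 * (C₁ * L) / (BT - 2) := div_nonneg (by positivity) (by linarith)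
          have hS : ∑ p ∈ Cfar, ((1 + |yM p|) ^ 2)⁻¹ ≤ CN * (T * L) * (4 * (C₁ * L) / c) :=
            hCfar_sum.trans (mul_le_mul hNT hBT2inv hq0 (by positivity))
          have hS0 : 0 ≤ ∑ p ∈ Cfar, ((1 + |yM p|) ^ 2)⁻¹ := Finset.sum_nonneg fun p _ ↦ by positivity
          have hD1 : D * (1 + BT)⁻¹ ≤ D * c⁻¹ := mul_le_mul_of_nonneg_left hBTinv hD0.le
          exact mul_le_mul hD1 hS hS0 (by positivity)
      _ = 16 * π ^ 2 * D * CN * C₁ * T := by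
          rw [hc]; field_simp; ring
  -- assemble: `K T ≤ (ε/3) (T/2π) L` and the middle range `≤ (ε/3) (T/2π) L`
  have hN0 : 0 < T / (2 * π) * L := by positivity
  have hac : 24 * CN * C₀ * T + 16 * π ^ 2 * D * CN * C₁ * T ≤ ε / 3 * (T / (2 * π) * L) := by
    have : K * T ≤ ε / 3 * (T / (2 * π) * L) := by
      rw [show ε / 3 * (T / (2 * π) * L) = (ε * L / (6 * π)) * T by ring]
      apply mul_le_mul_of_nonneg_right _ hT0.le
      rw [le_div_iff₀ (by positivity)]
      have : 6 * π * K / ε ≤ L := by linarith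
      rw [div_le_iff₀ hε] at this
      linarith
    rw [hK] at this; linarith
  have hb : D * (2 * (Cw * (T * L)) / (y₀ * (M - 2 * y₀))) ≤ ε / 3 * (T / (2 * π) * L) := by
    have hMy0 : 0 < M - 2 * y₀ := by linarith
    have hMy' : 12 * π * D * Cw < (M - 2 * y₀) * (y₀ * ε) := (div_lt_iff₀ (by positivity)).mp hMy
    rw [show D * (2 * (Cw * (T * L)) / (y₀ * (M - 2 * y₀))) =
      (2 * D * Cw / (y₀ * (M - 2 * y₀))) * (T * L) by field_simp]
    rw [show ε / 3 * (T / (2 * π) * L) = (ε / (6 * π)) * (T * L) by ring]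
    apply mul_le_mul_of_nonneg_right _ (by positivity)
    rw [div_le_iff₀ (by positivity)]
    have h6 : ε / (6 * π) * (y₀ * (M - 2 * y₀)) = ((M - 2 * y₀) * (y₀ * ε)) / (6 * π) := by ring
    rw [h6, le_div_iff₀ (by positivity)]
    nlinarith [Real.pi_pos]
  calc |∑ p ∈ Ω, f p - ∑ p ∈ pairs T M, f p|
      ≤ ∑ p ∈ A, |gHat n (yM p)| + (∑ p ∈ Bmid, |gHat n (yM p)| + ∑ p ∈ Cfar, |gHat n (yM p)|) := hmain
    _ ≤ 24 * CN * C₀ * T + (D * (2 * (Cw * (T * L)) / (y₀ * (M - 2 * y₀))) + 16 * π ^ 2 * D * CN * C₁ * T) := by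
        gcongr
    _ ≤ ε / 3 * (T / (2 * π) * L) + ε / 3 * (T / (2 * π) * L) := by linarith
    _ ≤ ε * (T / (2 * π) * L) := by nlinarith

/-! ## F. BGSTB 2025, Lemma 3: evaluating the sum over `𝒫(T, M)` with AH-Pairs -/

/-- Half-integers `k/2`, `k'/2` within `< 1/2` of each other are equal. [folklore] -/
private theorem int_eq_of_abs_sub_half_lt {k k' : ℤ} (h : |(k : ℝ) / 2 - (k' : ℝ) / 2| < 1 / 4 + 1 / 4) : k = k' := by
  have h1 : |((k - k' : ℤ) : ℝ)| < 1 := by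
    push_cast
    rw [show (k : ℝ) - k' = 2 * ((k : ℝ) / 2 - (k' : ℝ) / 2) by ring, abs_mul, abs_two]
    linarith
  have h2 : |k - k'| < 1 := by exact_mod_cast h1
  exact sub_eq_zero.mp (Int.abs_lt_one_iff.mp h2)

/-- The bins `B_{k/2}(T, M, δ)`, `k ∈ ℤ`, are pairwise disjoint when `δ ≤ 1/2` (half-open intervals
of length `δ` centred `1/2` apart). [cite: BaluyotGoldstonSuriajayaTurnageButterbaugh2025, §1 (B_{k/2})] -/
theorem disjoint_bin {T M δ : ℝ} (hδ2 : δ ≤ 1 / 2) {k k' : ℤ} (hkk' : k ≠ k') :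
    Disjoint (bin k T M δ) (bin k' T M δ) := by
  rw [Finset.disjoint_left]
  intro p hp hp'
  rw [mem_bin] at hp hp'
  obtain ⟨-, h1, h2⟩ := hp
  obtain ⟨-, h1', h2'⟩ := hp'
  apply hkk'
  apply int_eq_of_abs_sub_half_lt
  rw [abs_lt]; constructor <;> linarith

/-- **Localisation.** If every pair in `𝒫(T, M)` is within `ρ < δ/2` of some half-integer (this is
what AH-Pairs gives for large `T`), then `(γ, γ') ∈ B_{k/2}` iff `|y − k/2| ≤ ρ`.
[cite: BaluyotGoldstonSuriajayaTurnageButterbaugh2025, §3 (proof of Lemma 3)] -/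
theorem mem_bin_iff_of_localised {T M δ ρ : ℝ} (hδ2 : δ ≤ 1 / 2) (hρ : ρ < δ / 2)
    (hloc : ∀ p ∈ pairs T M, ∃ k : ℤ, |pairSpacing T p - (k : ℝ) / 2| ≤ ρ)
    {p : ℕ × ℕ} (hp : p ∈ pairs T M) (k : ℤ) :
    p ∈ bin k T M δ ↔ |pairSpacing T p - (k : ℝ) / 2| ≤ ρ := by
  constructor
  · intro h
    rw [mem_bin] at h
    obtain ⟨-, h1, h2⟩ := h
    obtain ⟨k', hk'⟩ := hloc p hp
    have hkk' : k = k' := by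
      apply int_eq_of_abs_sub_half_lt
      have := abs_le.mp hk'
      rw [abs_lt]; constructor <;> linarith
    rw [hkk']; exact hk'
  · intro h
    rw [mem_bin]
    have := abs_le.mp h
    exact ⟨hp, by linarith, by linarith⟩

/-- Under the localisation, `𝒫(T, M)` is the (disjoint) union of the bins `B_{k/2}`, `|k| ≤ N`,
for any `N ≥ 2M + 1`. [cite: BaluyotGoldstonSuriajayaTurnageButterbaugh2025, §3 (proof of Lemma 3)] -/
theorem pairs_eq_biUnion_bin {T M δ ρ : ℝ} (hδ2 : δ ≤ 1 / 2) (hρ : ρ < δ / 2)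
    (hloc : ∀ p ∈ pairs T M, ∃ k : ℤ, |pairSpacing T p - (k : ℝ) / 2| ≤ ρ) {N : ℕ}
    (hN : 2 * M + 1 ≤ N) :
    pairs T M = (Finset.Icc (-(N : ℤ)) N).biUnion fun k ↦ bin k T M δ := by
  ext p
  rw [Finset.mem_biUnion]
  constructor
  · intro hp
    obtain ⟨k, hk⟩ := hloc p hp
    refine ⟨k, ?_, (mem_bin_iff_of_localised hδ2 hρ hloc hp k).mpr hk⟩
    have hy : |pairSpacing T p| ≤ M := (mem_pairs.mp hp).2.2.2
    have hk2 : |(k : ℝ)| ≤ 2 * M + 1 := by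
      have h1 : |(k : ℝ) / 2| ≤ |pairSpacing T p| + ρ := by
        have := abs_sub_abs_le_abs_sub ((k : ℝ) / 2) (pairSpacing T p)
        rw [abs_sub_comm] at this
        linarith
      rw [abs_div, abs_two] at h1
      linarith
    have hk3 : |(k : ℝ)| ≤ N := hk2.trans hN
    rw [Finset.mem_Icc]
    have := abs_le.mp hk3
    constructor
    · exact_mod_cast this.1
    · exact_mod_cast this.2
  · rintro ⟨k, -, hk⟩
    exact bin_subset_pairs k T M δ hk

/-- Sum over `𝒫(T, M)` = sum over the bins `B_{k/2}`, `|k| ≤ N` (under the localisation). [cite: BaluyotGoldstonSuriajayaTurnageButterbaugh2025, §3 (proof of Lemma 3)] -/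
theorem sum_pairs_eq_sum_bin {T M δ ρ : ℝ} (hδ2 : δ ≤ 1 / 2) (hρ : ρ < δ / 2)
    (hloc : ∀ p ∈ pairs T M, ∃ k : ℤ, |pairSpacing T p - (k : ℝ) / 2| ≤ ρ) {N : ℕ}
    (hN : 2 * M + 1 ≤ N) (F : ℕ × ℕ → ℝ) :
    ∑ p ∈ pairs T M, F p = ∑ k ∈ Finset.Icc (-(N : ℤ)) N, ∑ p ∈ bin k T M δ, F p := by
  rw [pairs_eq_biUnion_bin hδ2 hρ hloc hN]
  apply Finset.sum_biUnion
  intro k _ k' _ hkk'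
  exact disjoint_bin hδ2 hkk'

/-- **Swap symmetry `|B_{−k/2}| = |B_{k/2}|`** under the localisation ("`P_{k/2} = P_{−k/2}`",
BGSTB 2025, §1; exact here because no normalised difference lies on a bin edge).
[cite: BaluyotGoldstonSuriajayaTurnageButterbaugh2025, §1 (P_{k/2} = P_{-k/2})] -/
theorem card_bin_neg {T M δ ρ : ℝ} (hδ2 : δ ≤ 1 / 2) (hρ : ρ < δ / 2)
    (hloc : ∀ p ∈ pairs T M, ∃ k : ℤ, |pairSpacing T p - (k : ℝ) / 2| ≤ ρ) (k : ℤ) :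
    (bin (-k) T M δ).card = (bin k T M δ).card := by
  have hswap : ∀ q : ℕ × ℕ, q ∈ pairs T M → q.swap ∈ pairs T M := by
    intro q hq
    rw [mem_pairs] at hq ⊢
    obtain ⟨h1, h2, h3, h4⟩ := hq
    rw [Finset.mem_product] at h1 ⊢
    refine ⟨⟨h1.2, h1.1⟩, h3, h2, ?_⟩
    rwa [pairSpacing_swap, abs_neg]
  have key : ∀ (j : ℤ) (q : ℕ × ℕ), q ∈ bin j T M δ → q.swap ∈ bin (-j) T M δ := by
    intro j q hq
    have hqP : q ∈ pairs T M := bin_subset_pairs j T M δ hq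
    have h1 := (mem_bin_iff_of_localised hδ2 hρ hloc hqP j).mp hq
    apply (mem_bin_iff_of_localised hδ2 hρ hloc (hswap q hqP) (-j)).mpr
    rw [pairSpacing_swap]
    push_cast
    rw [show -pairSpacing T q - -(j : ℝ) / 2 = -(pairSpacing T q - (j : ℝ) / 2) by ring, abs_neg]
    exact h1
  refine Finset.card_nbij' Prod.swap Prod.swap (fun q hq ↦ ?_) (fun q hq ↦ ?_) (fun q _ ↦ by simp)
    (fun q _ ↦ by simp)
  · have := key (-k) q hq
    rwa [neg_neg] at this
  · exact key k q hq

/-- `0 ≤ 1 − w(γ − γ') ≤ π² y²/log²T` for `y = ((γ − γ')/2π) log T`. [cite: Montgomery1973, §1 (1)] -/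
theorem one_sub_weight_le {T : ℝ} (hL : 0 < Real.log T) (p : ℕ × ℕ) :
    0 ≤ 1 - montgomeryWeight (zetaOrdinate p.1 - zetaOrdinate p.2) ∧
      1 - montgomeryWeight (zetaOrdinate p.1 - zetaOrdinate p.2) ≤
        π ^ 2 * pairSpacing T p ^ 2 / Real.log T ^ 2 := by
  have h := RudnickSarnak.one_sub_montgomeryWeight_mem (zetaOrdinate p.1 - zetaOrdinate p.2)
  refine ⟨h.1, h.2.trans (le_of_eq ?_)⟩
  have e : zetaOrdinate p.1 - zetaOrdinate p.2 = 2 * π * pairSpacing T p / Real.log T := by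
    unfold pairSpacing; field_simp
  rw [e]; field_simp; ring

/-- **AH-Pairs localises every pair of `𝒫(T, M)` near a half-integer**: for any `ρ₀ > 0` and all
large `T`, every `(γ, γ') ∈ 𝒫(T, M)` has `|y − k/2| ≤ ρ₀` for some `k ∈ ℤ` (`|k| ≤ 4M + 1`, so the
printed `O((|k| + 1) R(T))` is `≤ C (4M + 2) R(T) → 0`). [cite: BaluyotGoldstonSuriajayaTurnageButterbaugh2025, §3 (proof of Lemma 3)] -/
theorem eventually_localised {M : ℝ} (hAHM : AHPairsAt M) {ρ₀ : ℝ} (hρ₀ : 0 < ρ₀) :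
    ∀ᶠ T : ℝ in atTop, ∀ p ∈ pairs T M, ∃ k : ℤ, |pairSpacing T p - (k : ℝ) / 2| ≤ ρ₀ := by
  obtain ⟨R, hR0, -, hRlim, C, hC⟩ := hAHM
  set C' : ℝ := max C 1 with hC'
  have hC'0 : 0 < C' := lt_of_lt_of_le one_pos (le_max_right _ _)
  have hρlim : Tendsto (fun T ↦ C' * (4 * M + 2) * R T) atTop (𝓝 0) := by
    have := hRlim.const_mul (C' * (4 * M + 2))
    rw [mul_zero] at this
    exact this
  filter_upwards [hC, hρlim.eventually (gt_mem_nhds hρ₀),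
    (hRlim.const_mul C').eventually (gt_mem_nhds (show C' * 0 < 1 / 4 by norm_num))]
    with T hCT hρT hCR
  have hCR' : C' * R T < 1 / 4 := hCR
  intro p hp
  obtain ⟨k, hk⟩ := hCT p hp
  have hy : |pairSpacing T p| ≤ M := (mem_pairs.mp hp).2.2.2
  have hk1 : |pairSpacing T p - (k : ℝ) / 2| ≤ C' * (|(k : ℝ)| + 1) * R T := by
    refine hk.trans ?_
    gcongr
    · exact (hR0 T).le
    · exact le_max_left _ _
  have hkabs : |(k : ℝ)| ≤ 4 * M + 1 := by
    have h1 : |(k : ℝ) / 2| ≤ |pairSpacing T p| + C' * (|(k : ℝ)| + 1) * R T := by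
      have := abs_sub_abs_le_abs_sub ((k : ℝ) / 2) (pairSpacing T p)
      rw [abs_sub_comm] at this
      linarith
    rw [abs_div, abs_two] at h1
    have h2 : C' * (|(k : ℝ)| + 1) * R T ≤ (|(k : ℝ)| + 1) * (1 / 4) := by
      rw [show C' * (|(k : ℝ)| + 1) * R T = (|(k : ℝ)| + 1) * (C' * R T) by ring]
      exact mul_le_mul_of_nonneg_left hCR'.le (by positivity)
    linarith
  refine ⟨k, hk1.trans (le_trans ?_ hρT.le)⟩
  rw [show C' * (4 * M + 2) * R T = C' * (4 * M + 1 + 1) * R T by ring]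
  gcongr
  · exact (hR0 T).le

/-- **`|B_{−k/2}| = |B_{k/2}|` for all large `T`** under AH-Pairs at level `M`.
[cite: BaluyotGoldstonSuriajayaTurnageButterbaugh2025, §1 (P_{k/2} = P_{-k/2})] -/
theorem eventually_card_bin_neg {M : ℝ} (hAHM : AHPairsAt M) {δ : ℝ} (hδ : 0 < δ)
    (hδ2 : δ ≤ 1 / 2) (k : ℤ) :
    ∀ᶠ T : ℝ in atTop, (bin (-k) T M δ).card = (bin k T M δ).card := by
  filter_upwards [eventually_localised hAHM (by positivity : (0 : ℝ) < δ / 4)] with T hloc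
  exact card_bin_neg hδ2 (by linarith) hloc k

set_option maxHeartbeats 1600000 in
/-- **BGSTB 2025, Lemma 3 for `r = ĝ_n`** (evaluating the sum over `𝒫(T, M)` by AH-Pairs):
assuming RH (for the pair count `|𝒫(T, M)| ≪ M T log T`) and AH-Pairs at level `M ≥ n`, for every
`ε > 0` and all large `T`,
`|∑_{(γ,γ')∈𝒫(T,M)} ĝ_n(y) w(γ−γ') − (|B_0| + (−1)^{n+1} |B_{n/2}|)| ≤ ε (T/2π) log T`.
Printed: "`∑_{𝒫(T,M)} r(y) = ((T/2π) log T) ∑_{k≪M} r(k/2) P_{k/2} + O(M² R(T) T log T)`" together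
with `ĝ_n(k/2) = 0` for `k ∉ {0, ±n}`, `ĝ_n(0) = 1`, `ĝ_n(±n/2) = (−1)^{n+1}/2`, `P_{n/2} = P_{−n/2}`,
and the removal of `w` ("`≪ (M/log T)² M T log T`").
[cite: BaluyotGoldstonSuriajayaTurnageButterbaugh2025, Lemma 3] -/
theorem eventually_abs_sum_pairs_sub_bins_le (hRH : RiemannHypothesis) {M : ℝ} (hM0 : 0 < M)
    (hAHM : AHPairsAt M) {δ : ℝ} (hδ : 0 < δ) (hδ2 : δ ≤ 1 / 2) {n : ℕ} (hn : 1 ≤ n)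
    (hnM : (n : ℝ) ≤ M) {ε : ℝ} (hε : 0 < ε) :
    ∀ᶠ T : ℝ in atTop,
      |∑ p ∈ pairs T M, gHat n (pairSpacing T p) * montgomeryWeight (zetaOrdinate p.1 - zetaOrdinate p.2) -
        (((bin 0 T M δ).card : ℝ) + sgn n * (bin n T M δ).card)| ≤ ε * (T / (2 * π) * Real.log T) := by
  obtain ⟨y₀, hy₀, C_w, hwinE⟩ := RudnickSarnak.exists_pairCount_window_le hRH
  set Cw : ℝ := max C_w 1 with hCw
  have hCw0 : 0 < Cw := lt_of_lt_of_le one_pos (le_max_right _ _)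
  -- the count of `𝒫(T, M)` and the error coefficient
  set Q : ℝ := 4 * π * Cw * (M / y₀ + 1) with hQ
  have hQ0 : 0 < Q := by positivity
  set N : ℕ := ⌈2 * M + 1⌉₊ with hN
  have hNM : 2 * M + 1 ≤ N := Nat.le_ceil _
  -- the localisation radius
  set ρ : ℝ := min (δ / 4) (ε / (16 * π * Q)) with hρ
  have hρ0 : 0 < ρ := by positivity
  have hρδ : ρ < δ / 2 := lt_of_le_of_lt (min_le_left _ _) (by linarith)
  have hρε : ρ ≤ ε / (16 * π * Q) := min_le_right _ _
  filter_upwards [eventually_localised hAHM hρ0, hwinE, eventually_gt_atTop (1 : ℝ),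
    Real.tendsto_log_atTop.eventually_ge_atTop (π * (M + 5 / 2 * y₀)),
    Real.tendsto_log_atTop.eventually_ge_atTop (2 * (2 * π ^ 2 * M ^ 2 * Q) / ε + 1)]
    with T hloc hwin hT hLM hLQ
  have hT0 : 0 < T := by linarith
  set L : ℝ := Real.log T with hLdef
  have hL : 0 < L := Real.log_pos hT
  have hL1 : 1 ≤ L := by
    have : 0 ≤ 2 * (2 * π ^ 2 * M ^ 2 * Q) / ε := by positivity
    linarith
  have hN0 : 0 < T / (2 * π) * L := by positivity
  -- the sum over `𝒫(T, M)` as a sum over bins, and the values `ĝ_n(k/2)`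
  set F : ℕ × ℕ → ℝ := fun p ↦
    gHat n (pairSpacing T p) * montgomeryWeight (zetaOrdinate p.1 - zetaOrdinate p.2) with hF
  set K := Finset.Icc (-(N : ℤ)) N with hK
  have hsumK : ∑ p ∈ pairs T M, F p = ∑ k ∈ K, ∑ p ∈ bin k T M δ, F p :=
    sum_pairs_eq_sum_bin hδ2 hρδ hloc hNM F
  have hcardK : ((pairs T M).card : ℝ) = ∑ k ∈ K, ((bin k T M δ).card : ℝ) := by
    have := sum_pairs_eq_sum_bin hδ2 hρδ hloc hNM (fun _ ↦ (1 : ℝ))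
    simpa using this
  -- main values: `∑_k ĝ_n(k/2) |B_k| = |B_0| + σ_n |B_n|`
  have hnK : (n : ℤ) ∈ K := by
    rw [hK, Finset.mem_Icc]
    have : (n : ℝ) ≤ N := by linarith
    constructor
    · linarith [show (0 : ℤ) ≤ n from Int.natCast_nonneg n]
    · exact_mod_cast this
  have hnK' : -(n : ℤ) ∈ K := by
    rw [hK, Finset.mem_Icc] at hnK ⊢
    constructor <;> linarith [hnK.1, hnK.2]
  have h0K : (0 : ℤ) ∈ K := by
    rw [hK, Finset.mem_Icc]; constructor <;> linarith [show (0 : ℤ) ≤ (N : ℤ) from Int.natCast_nonneg N]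
  have hn0 : (n : ℤ) ≠ 0 := by exact_mod_cast (show n ≠ 0 by omega)
  have hvals : ∑ k ∈ K, gHat n ((k : ℝ) / 2) * ((bin k T M δ).card : ℝ) =
      ((bin 0 T M δ).card : ℝ) + sgn n * (bin n T M δ).card := by
    have hsub : ({0, (n : ℤ), -(n : ℤ)} : Finset ℤ) ⊆ K := by
      intro k hk
      simp only [Finset.mem_insert, Finset.mem_singleton] at hk
      rcases hk with rfl | rfl | rfl
      · exact h0K
      · exact hnK
      · exact hnK'
    rw [← Finset.sum_subset hsub]
    · have h1 : (0 : ℤ) ∉ ({(n : ℤ), -(n : ℤ)} : Finset ℤ) := by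
        simp only [Finset.mem_insert, Finset.mem_singleton, not_or]
        exact ⟨hn0.symm, by omega⟩
      have h2 : (n : ℤ) ∉ ({-(n : ℤ)} : Finset ℤ) := by
        simp only [Finset.mem_singleton]; omega
      rw [Finset.sum_insert h1, Finset.sum_insert h2, Finset.sum_singleton]
      have e0 : gHat n ((0 : ℤ) / 2 : ℝ) = 1 := by
        rw [show ((0 : ℤ) : ℝ) / 2 = 0 by simp]; exact gHat_zero hn
      have en : gHat n (((n : ℤ) : ℝ) / 2) = sgn n / 2 := by
        rw [show (((n : ℤ) : ℝ)) = (n : ℝ) by simp]; exact gHat_half_self hn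
      have en' : gHat n (((-(n : ℤ) : ℤ) : ℝ) / 2) = sgn n / 2 := by
        rw [show (((-(n : ℤ) : ℤ) : ℝ)) / 2 = -((n : ℝ) / 2) by push_cast; ring]
        exact gHat_neg_half_self hn
      have hsym : ((bin (-(n : ℤ)) T M δ).card : ℝ) = (bin n T M δ).card := by
        exact_mod_cast card_bin_neg hδ2 hρδ hloc (n : ℤ)
      rw [e0, en, en', hsym]
      ring
    · intro k _ hk
      simp only [Finset.mem_insert, Finset.mem_singleton, not_or] at hk
      rw [gHat_half_int_eq_zero hk.1 hk.2.1 hk.2.2, zero_mul]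
  -- the error: `|F p − ĝ_n(k/2)| ≤ 4π ρ + 2 π² M²/L²` on `B_k`
  have herr : ∀ k ∈ K, ∀ p ∈ bin k T M δ,
      |F p - gHat n ((k : ℝ) / 2)| ≤ 4 * π * ρ + 2 * (π ^ 2 * M ^ 2 / L ^ 2) := by
    intro k _ p hp
    have hpP : p ∈ pairs T M := bin_subset_pairs k T M δ hp
    have hy : |pairSpacing T p| ≤ M := (mem_pairs.mp hpP).2.2.2
    have hk := (mem_bin_iff_of_localised hδ2 hρδ hloc hpP k).mp hp
    set wv := montgomeryWeight (zetaOrdinate p.1 - zetaOrdinate p.2) with hwv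
    have hw := one_sub_weight_le hL p
    rw [← hwv, ← hLdef] at hw
    have hw2 : 1 - wv ≤ π ^ 2 * M ^ 2 / L ^ 2 := by
      refine hw.2.trans ?_
      apply div_le_div_of_nonneg_right _ (by positivity)
      apply mul_le_mul_of_nonneg_left _ (by positivity)
      have := abs_le.mp hy
      nlinarith [abs_nonneg (pairSpacing T p), sq_abs (pairSpacing T p)]
    have e : F p - gHat n ((k : ℝ) / 2) =
        (gHat n (pairSpacing T p) - gHat n ((k : ℝ) / 2)) * wv - gHat n ((k : ℝ) / 2) * (1 - wv) := by
      rw [hF]; ring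
    rw [e]
    calc |(gHat n (pairSpacing T p) - gHat n ((k : ℝ) / 2)) * wv - gHat n ((k : ℝ) / 2) * (1 - wv)|
        ≤ |(gHat n (pairSpacing T p) - gHat n ((k : ℝ) / 2)) * wv| + |gHat n ((k : ℝ) / 2) * (1 - wv)| :=
          abs_sub _ _
      _ = |gHat n (pairSpacing T p) - gHat n ((k : ℝ) / 2)| * wv + |gHat n ((k : ℝ) / 2)| * (1 - wv) := by
          rw [abs_mul, abs_mul, abs_of_pos (montgomeryWeight_pos _), abs_of_nonneg hw.1]
      _ ≤ (4 * π * |pairSpacing T p - (k : ℝ) / 2|) * 1 + 2 * (π ^ 2 * M ^ 2 / L ^ 2) :=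
          add_le_add (mul_le_mul (abs_gHat_sub_le n _ _) (montgomeryWeight_le_one _)
              (montgomeryWeight_pos _).le (by positivity))
            (mul_le_mul (abs_gHat_le_two n _) hw2 hw.1 (by norm_num))
      _ ≤ 4 * π * ρ + 2 * (π ^ 2 * M ^ 2 / L ^ 2) := by nlinarith [Real.pi_pos]
  -- `|𝒫(T, M)| ≤ 2 Cw T L (M/y₀ + 1)`
  have hPcard : ((pairs T M).card : ℝ) ≤ 2 * (Cw * (T * L)) * (M / y₀ + 1) := by
    set yM : ℕ × ℕ → ℝ := fun p ↦ L / (2 * π) * (zetaOrdinate p.1 - zetaOrdinate p.2) with hyM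
    have hwin' : ∀ s : ℝ, |s| + y₀ ≤ L / π →
        (((zeroIndexSet T ×ˢ zeroIndexSet T).filter fun p ↦ |yM p - s| ≤ y₀).card : ℝ) ≤ Cw * (T * L) := by
      intro s hs
      exact (hwin s hs).trans (mul_le_mul_of_nonneg_right (le_max_left _ _) (by positivity))
    have hR' : (M / y₀ + 5 / 2) * y₀ ≤ L / π := by
      rw [show (M / y₀ + 5 / 2) * y₀ = M + 5 / 2 * y₀ by field_simp, le_div_iff₀ Real.pi_pos]
      linarith
    have h1 := RudnickSarnak.card_filter_abs_le_le (zeroIndexSet T ×ˢ zeroIndexSet T) yM hy₀ hM0.le hwin' hR'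
    have hsub : pairs T M ⊆ (zeroIndexSet T ×ˢ zeroIndexSet T).filter fun p ↦ |yM p| ≤ M := by
      intro p hp
      rw [mem_pairs] at hp
      rw [Finset.mem_filter]
      refine ⟨hp.1, ?_⟩
      have : yM p = pairSpacing T p := by rw [pairSpacing_eq]
      rw [this]; exact hp.2.2.2
    have hfl : (⌊M / y₀⌋₊ : ℝ) ≤ M / y₀ := Nat.floor_le (by positivity)
    calc ((pairs T M).card : ℝ)
        ≤ (((zeroIndexSet T ×ˢ zeroIndexSet T).filter fun p ↦ |yM p| ≤ M).card : ℝ) := by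
          exact_mod_cast Finset.card_le_card hsub
      _ ≤ 2 * (Cw * (T * L)) * (⌊M / y₀⌋₊ + 1) := h1
      _ ≤ 2 * (Cw * (T * L)) * (M / y₀ + 1) := by gcongr
  -- assemble
  rw [hsumK, ← hvals, ← Finset.sum_sub_distrib]
  have hstep : ∀ k ∈ K, |∑ p ∈ bin k T M δ, F p - gHat n ((k : ℝ) / 2) * ((bin k T M δ).card : ℝ)| ≤
      (4 * π * ρ + 2 * (π ^ 2 * M ^ 2 / L ^ 2)) * (bin k T M δ).card := by
    intro k hk
    have e : gHat n ((k : ℝ) / 2) * ((bin k T M δ).card : ℝ) = ∑ p ∈ bin k T M δ, gHat n ((k : ℝ) / 2) := by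
      rw [Finset.sum_const, nsmul_eq_mul, mul_comm]
    rw [e, ← Finset.sum_sub_distrib]
    calc |∑ p ∈ bin k T M δ, (F p - gHat n ((k : ℝ) / 2))|
        ≤ ∑ p ∈ bin k T M δ, |F p - gHat n ((k : ℝ) / 2)| := Finset.abs_sum_le_sum_abs _ _
      _ ≤ ∑ p ∈ bin k T M δ, (4 * π * ρ + 2 * (π ^ 2 * M ^ 2 / L ^ 2)) :=
          Finset.sum_le_sum fun p hp ↦ herr k hk p hp
      _ = (4 * π * ρ + 2 * (π ^ 2 * M ^ 2 / L ^ 2)) * (bin k T M δ).card := by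
          rw [Finset.sum_const, nsmul_eq_mul, mul_comm]
  calc |∑ k ∈ K, (∑ p ∈ bin k T M δ, F p - gHat n ((k : ℝ) / 2) * ((bin k T M δ).card : ℝ))|
      ≤ ∑ k ∈ K, |∑ p ∈ bin k T M δ, F p - gHat n ((k : ℝ) / 2) * ((bin k T M δ).card : ℝ)| :=
        Finset.abs_sum_le_sum_abs _ _
    _ ≤ ∑ k ∈ K, (4 * π * ρ + 2 * (π ^ 2 * M ^ 2 / L ^ 2)) * (bin k T M δ).card :=
        Finset.sum_le_sum hstep
    _ = (4 * π * ρ + 2 * (π ^ 2 * M ^ 2 / L ^ 2)) * (pairs T M).card := by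
        rw [← Finset.mul_sum, hcardK]
    _ ≤ (4 * π * ρ + 2 * (π ^ 2 * M ^ 2 / L ^ 2)) * (2 * (Cw * (T * L)) * (M / y₀ + 1)) := by
        gcongr
    _ = (4 * π * ρ + 2 * (π ^ 2 * M ^ 2 / L ^ 2)) * Q * (T / (2 * π) * L) := by
        rw [hQ]; field_simp; norm_num
    _ ≤ ε * (T / (2 * π) * L) := by
        apply mul_le_mul_of_nonneg_right _ hN0.le
        -- `4π ρ Q ≤ ε/4` and `2 π² M² Q / L² ≤ ε/2`
        have h1 : 4 * π * ρ * Q ≤ ε / 4 := by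
          have := (le_div_iff₀ (by positivity : (0 : ℝ) < 16 * π * Q)).mp hρε
          nlinarith [Real.pi_pos]
        have h2 : 2 * (π ^ 2 * M ^ 2 / L ^ 2) * Q ≤ ε / 2 := by
          rw [show 2 * (π ^ 2 * M ^ 2 / L ^ 2) * Q = 2 * π ^ 2 * M ^ 2 * Q / L ^ 2 by ring]
          rw [div_le_iff₀ (by positivity)]
          have hL2 : L ≤ L ^ 2 := by nlinarith
          have h3 : 2 * (2 * π ^ 2 * M ^ 2 * Q) / ε ≤ L := by linarith
          rw [div_le_iff₀ hε] at h3
          nlinarith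
        nlinarith

/-! ## G. Proof of Theorem 1 -/

/-- **The core limit** (BGSTB 2025, §3, proof of Theorem 1: "We now take `T` and then `M` large in
the last two equations and conclude `P_0 + (−1)^{n+1} P_{n/2} ∼ ½` (`n` even), `3/2 − 2/(π²n²)`
(`n` odd)"): assuming RH and AH-Pairs, for `0 < δ ≤ 1/2`, `n ≥ 1` and any `M ≥ n`,
`P_0(T) + (−1)^{n+1} P_{n/2}(T) → g_n(0) + 2∫₀¹ α g_n(α) dα`. The iterated limit is a plain
`T`-limit because the bins do not depend on `M ≥ (n + δ)/2` (`AH.bin_eq_bin_of_le`).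
[cite: BaluyotGoldstonSuriajayaTurnageButterbaugh2025, §3 (proof of Theorem 1)] -/
theorem tendsto_binDensity_add (hRH : RiemannHypothesis) (hAH : AHPairs) {δ : ℝ} (hδ : 0 < δ)
    (hδ2 : δ ≤ 1 / 2) {n : ℕ} (hn : 1 ≤ n) {M : ℝ} (hM : (n : ℝ) ≤ M) :
    Tendsto (fun T : ℝ ↦ binDensity 0 T M δ + sgn n * binDensity n T M δ) atTop
      (𝓝 (gProfile n 0 + ∫ a in (-1 : ℝ)..1, |a| * gProfile n a)) := by
  set ℓ : ℝ := gProfile n 0 + ∫ a in (-1 : ℝ)..1, |a| * gProfile n a with hℓ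
  have hn1 : (1 : ℝ) ≤ n := by exact_mod_cast hn
  have hM1 : 1 ≤ M := hn1.trans hM
  rw [Metric.tendsto_nhds]
  intro ε hε
  have hε4 : 0 < ε / 4 := by positivity
  obtain ⟨M₀, hM₀, htail⟩ := eventually_abs_sum_sub_sum_pairs_le hRH hn hε4
  set M' : ℝ := max M M₀ with hM'
  have hM'0 : 0 < M' := lt_of_lt_of_le hM₀ (le_max_right _ _)
  have hnM' : (n : ℝ) ≤ M' := hM.trans (le_max_left _ _)
  have hAHM' : AHPairsAt M' := hAH M' hM'0
  have h1 := (Metric.tendsto_nhds.mp (tendsto_sum_gHat_div hRH n)) (ε / 4) hε4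
  have h2 := htail M' (le_max_right _ _)
  have h3 := eventually_abs_sum_pairs_sub_bins_le hRH hM'0 hAHM' hδ hδ2 hn hnM' hε4
  filter_upwards [h1, h2, h3, eventually_normaliser_pos] with T hT1 hT2 hT3 hN0
  -- the bins at levels `M` and `M'` agree
  have hb0 : bin 0 T M δ = bin 0 T M' δ :=
    bin_eq_bin_of_le (by push_cast; rw [abs_zero]; linarith) (by push_cast; rw [abs_zero]; linarith)
  have hbn : bin (n : ℤ) T M δ = bin (n : ℤ) T M' δ :=
    bin_eq_bin_of_le (by push_cast; rw [Nat.abs_cast]; linarith) (by push_cast; rw [Nat.abs_cast]; linarith)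
  set S : ℝ := ∑ p ∈ zeroIndexSet T ×ˢ zeroIndexSet T,
    gHat n (pairSpacing T p) * montgomeryWeight (zetaOrdinate p.1 - zetaOrdinate p.2) with hS
  set S' : ℝ := ∑ p ∈ pairs T M',
    gHat n (pairSpacing T p) * montgomeryWeight (zetaOrdinate p.1 - zetaOrdinate p.2) with hS'
  set X : ℝ := ((bin 0 T M' δ).card : ℝ) + sgn n * (bin n T M' δ).card with hX
  have e : binDensity 0 T M δ + sgn n * binDensity n T M δ = X / (T / (2 * π) * Real.log T) := by
    rw [hX, add_div, mul_div_assoc, binDensity, binDensity, hb0, hbn]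
  rw [e, Real.dist_eq]
  rw [Real.dist_eq] at hT1
  have h4 : |X / (T / (2 * π) * Real.log T) - S / (T / (2 * π) * Real.log T)| ≤ ε / 2 := by
    rw [← sub_div, abs_div, abs_of_pos hN0, div_le_iff₀ hN0]
    calc |X - S| ≤ |X - S'| + |S' - S| := abs_sub_le _ _ _
      _ ≤ ε / 4 * (T / (2 * π) * Real.log T) + ε / 4 * (T / (2 * π) * Real.log T) := by
          rw [abs_sub_comm X S', abs_sub_comm S' S]; exact add_le_add hT3 hT2
      _ = ε / 2 * (T / (2 * π) * Real.log T) := by ring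
  calc |X / (T / (2 * π) * Real.log T) - ℓ|
      ≤ |X / (T / (2 * π) * Real.log T) - S / (T / (2 * π) * Real.log T)| +
        |S / (T / (2 * π) * Real.log T) - ℓ| := abs_sub_le _ _ _
    _ < ε / 2 + ε / 4 := add_lt_add_of_le_of_lt h4 hT1
    _ ≤ ε := by linarith

end AH

/-- **DISCHARGE of `Literature.NumberTheory.LFunctions.bgstb2025_theorem1`** — Baluyot–Goldston–
Suriajaya–Turnage-Butterbaugh 2025, Theorem 1, PROVED (as a conditional: RH and AH-Pairs are its
hypotheses): following the printed proof (§3: (MT-Pairs) from Montgomery's theorem — the tree's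
`montgomery_pair_correlation_restricted_holds` on `|α| ≤ 1 − δ`, completed near `|α| = 1` by the
`O(1)` bound `AH.exists_abs_formFactor_le_near_one` from the tree's (P1)–(P3) — Lemma 2 (pairs
outside `𝒫(T, M)`, via the tree's Fejér-kernel pair count and unit windows), Lemma 3 (AH-Pairs), and
the Fourier pair `g_n`, `ĝ_n` of Lemma 4). LABEL: NOT RH-BEARING — a theorem ABOUT the conjunction
`RH ∧ AH-Pairs`; nothing here bears on the truth of RH or of AH.
[cite: BaluyotGoldstonSuriajayaTurnageButterbaugh2025, Theorem 1] -/
theorem bgstb2025_theorem1_holds : bgstb2025_theorem1 := by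
  intro hRH hAH δ hδ hδ2
  refine ⟨fun ε hε ↦ ?_, fun k hk0 hke ↦ ?_, fun k hko ↦ ?_⟩
  · -- (thm1a): `1 + o(1) ≤ P_0 ≤ 3/2 − 2/π² + o(1)`
    filter_upwards [eventually_ge_atTop (1 : ℝ)] with M hM
    have hcore := AH.tendsto_binDensity_add hRH hAH hδ hδ2 le_rfl (by exact_mod_cast hM : ((1 : ℕ) : ℝ) ≤ M)
    rw [AH.gProfile_zero_add_integral_of_odd odd_one, AH.sgn_of_odd odd_one] at hcore
    have hup := (Metric.tendsto_nhds.mp hcore) ε hε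
    filter_upwards [AH.eventually_le_binDensity_zero (by linarith : (0 : ℝ) ≤ M) hδ hε, hup,
      AH.eventually_normaliser_pos] with T hlow hT hN0
    refine ⟨hlow, ?_⟩
    rw [Real.dist_eq] at hT
    have hP1 : 0 ≤ AH.binDensity ((1 : ℕ) : ℤ) T M δ := by
      unfold AH.binDensity; positivity
    have := (abs_sub_lt_iff.mp hT).1
    push_cast at this hP1
    norm_num at this
    linarith
  · -- (thm1b), `k ≠ 0` even: `P_0 − P_{k/2} → ½`
    set n : ℕ := k.natAbs with hn
    have hn1 : 1 ≤ n := Int.natAbs_pos.mpr hk0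
    have hne : Even n := Int.natAbs_even.mpr hke
    filter_upwards [eventually_ge_atTop (n : ℝ)] with M hM
    have hM0 : 0 < M := lt_of_lt_of_le (by exact_mod_cast hn1) hM
    have hcore := AH.tendsto_binDensity_add hRH hAH hδ hδ2 hn1 hM
    rw [AH.gProfile_zero_add_integral_of_even hn1 hne, AH.sgn_of_even hne] at hcore
    rcases le_or_gt 0 k with hk | hk
    · have hkn : (n : ℤ) = k := by omega
      rw [hkn] at hcore
      exact hcore.congr fun T ↦ by ring
    · have hkn : (n : ℤ) = -k := by omega
      have hsym := AH.eventually_card_bin_neg (hAH M hM0) hδ hδ2 k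
      refine hcore.congr' ?_
      filter_upwards [hsym] with T hT
      rw [AH.binDensity, AH.binDensity, AH.binDensity, hkn, hT]
      ring
  · -- (thm1b), `k` odd: `P_0 + P_{k/2} → 3/2 − 2/(π²k²)`
    set n : ℕ := k.natAbs with hn
    have hno : Odd n := Int.natAbs_odd.mpr hko
    have hn1 : 1 ≤ n := by obtain ⟨j, hj⟩ := hno; omega
    filter_upwards [eventually_ge_atTop (n : ℝ)] with M hM
    have hM0 : 0 < M := lt_of_lt_of_le (by exact_mod_cast hn1) hM
    have hcore := AH.tendsto_binDensity_add hRH hAH hδ hδ2 hn1 hM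
    rw [AH.gProfile_zero_add_integral_of_odd hno, AH.sgn_of_odd hno] at hcore
    have hk2 : (k : ℝ) ^ 2 = (n : ℝ) ^ 2 := by
      have : (n : ℤ) ^ 2 = k ^ 2 := by rw [hn, Int.natAbs_sq]
      exact_mod_cast this.symm
    rw [hk2]
    rcases le_or_gt 0 k with hk | hk
    · have hkn : (n : ℤ) = k := by omega
      rw [hkn] at hcore
      exact hcore.congr fun T ↦ by ring
    · have hkn : (n : ℤ) = -k := by omega
      have hsym := AH.eventually_card_bin_neg (hAH M hM0) hδ hδ2 k
      refine hcore.congr' ?_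
      filter_upwards [hsym] with T hT
      rw [AH.binDensity, AH.binDensity, AH.binDensity, hkn, hT]
      ring

/-- **Corollary 1 — PROVED** (via the landed glue `bgstb2025_corollary1_of_theorem1`). [cite: BaluyotGoldstonSuriajayaTurnageButterbaugh2025, Corollary 1] -/
theorem bgstb2025_corollary1_holds : bgstb2025_corollary1 :=
  bgstb2025_corollary1_of_theorem1 bgstb2025_theorem1_holds

/-- **Corollary 1, last sentence — PROVED.** [cite: BaluyotGoldstonSuriajayaTurnageButterbaugh2025, Corollary 1] -/
theorem bgstb2025_corollary1_of_one_holds : bgstb2025_corollary1_of_one :=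
  bgstb2025_corollary1_of_one_of_theorem1 bgstb2025_theorem1_holds

/-- **Corollary 2 — PROVED.** [cite: BaluyotGoldstonSuriajayaTurnageButterbaugh2025, Corollary 2] -/
theorem bgstb2025_corollary2_holds : bgstb2025_corollary2 :=
  bgstb2025_corollary2_of_theorem1 bgstb2025_theorem1_holds

/-- **Corollary 3 — PROVED.** [cite: BaluyotGoldstonSuriajayaTurnageButterbaugh2025, Corollary 3] -/
theorem bgstb2025_corollary3_holds : bgstb2025_corollary3 :=
  bgstb2025_corollary3_of_theorem1 bgstb2025_theorem1_holds

namespace AH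

/-! ## H. BGSTB 2025, Theorem 2: `p_0 = 1` under RH and Strong AH-Pairs -/

/-- `|sinc x| ≤ 1/|x|`. [folklore] -/
private theorem abs_sinc_le_inv_abs {x : ℝ} (hx : x ≠ 0) : |Real.sinc x| ≤ |x|⁻¹ := by
  rw [Real.sinc_of_ne_zero hx, abs_div]
  rw [div_le_iff₀ (abs_pos.mpr hx), inv_mul_cancel₀ (abs_ne_zero.mpr hx)]
  exact Real.abs_sin_le_one x

/-- Montgomery's kernel for `β = 1`: `k(α) = ½ 1_{[-1,1]}(α)`, `k̂(t) = sin(2πt)/(2πt)` (BGSTB 2025,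
(k-kernel); "Montgomery's first example of a kernel"). [cite: BaluyotGoldstonSuriajayaTurnageButterbaugh2025, §2 (k-kernel)] -/
theorem fourier_half_indicator (t : ℝ) :
    𝓕 (fun a : ℝ ↦ (((Icc (-1 : ℝ) 1).indicator (fun _ ↦ (1 / 2 : ℝ)) a : ℝ) : ℂ)) t =
      (Real.sinc (2 * π * t) : ℂ) := by
  rw [Real.fourier_real_eq_integral_exp_smul]
  simp only [smul_eq_mul]
  have e1 : (fun v : ℝ ↦ Complex.exp (↑(-2 * π * v * t) * Complex.I) *
      (((Icc (-1 : ℝ) 1).indicator (fun _ ↦ (1 / 2 : ℝ)) v : ℝ) : ℂ)) =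
      fun v ↦ (Icc (-1 : ℝ) 1).indicator
        (fun v ↦ Complex.exp (↑(-2 * π * v * t) * Complex.I) * (1 / 2 : ℂ)) v := by
    funext v
    by_cases hv : v ∈ Icc (-1 : ℝ) 1
    · rw [indicator_of_mem hv, indicator_of_mem hv]; push_cast; ring
    · rw [indicator_of_notMem hv, indicator_of_notMem hv, Complex.ofReal_zero, mul_zero]
  rw [e1, integral_indicator measurableSet_Icc, integral_Icc_eq_integral_Ioc,
    ← intervalIntegral.integral_of_le (by norm_num : (-1 : ℝ) ≤ 1), intervalIntegral.integral_mul_const]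
  have e2 : (fun v : ℝ ↦ Complex.exp (↑(-2 * π * v * t) * Complex.I)) =
      fun v ↦ Complex.exp (↑((-2 * π * t) * v) * Complex.I) := by
    funext v; congr 2; push_cast; ring
  rw [e2, integral_cexp_mul_I, show -2 * π * t = -(2 * π * t) by ring, Real.sinc_neg]
  push_cast; ring

/-- **(Msum1) with `β = 1`, in `o(1)` form — PROVED under RH:**
`(1/((T/2π) log T)) ∑_{0<γ,γ'≤T} (sin((γ−γ') log T)/((γ−γ') log T)) w(γ−γ') → 1`
(printed: "`= (T/2π) log T + O(T√log T)`"; Montgomery 1973 via (MT-Pairs) with `k = ½ 1_{[-1,1]}`).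
[cite: BaluyotGoldstonSuriajayaTurnageButterbaugh2025, §2 (Msum1)] -/
theorem tendsto_sum_sinc_div (hRH : RiemannHypothesis) :
    Tendsto (fun T : ℝ ↦ (∑ p ∈ zeroIndexSet T ×ˢ zeroIndexSet T,
        Real.sinc (2 * π * pairSpacing T p) * montgomeryWeight (zetaOrdinate p.1 - zetaOrdinate p.2)) /
          (T / (2 * π) * Real.log T)) atTop (𝓝 1) := by
  have hB := tendsto_integral_formFactor_indicator_mul hRH (continuous_const (y := (1 / 2 : ℝ)))
  have hval : (1 / 2 : ℝ) + ∫ a in (-1 : ℝ)..1, |a| * (1 / 2 : ℝ) = 1 := by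
    have hcont : Continuous fun a : ℝ ↦ |a| * (1 / 2 : ℝ) := by fun_prop
    rw [← intervalIntegral.integral_add_adjacent_intervals (b := 0) (hcont.intervalIntegrable _ _)
      (hcont.intervalIntegrable _ _)]
    have hneg : ∫ a in (-1 : ℝ)..0, |a| * (1 / 2 : ℝ) = ∫ a in (0 : ℝ)..1, |a| * (1 / 2 : ℝ) := by
      have := intervalIntegral.integral_comp_neg (a := (0 : ℝ)) (b := 1) (fun a ↦ |a| * (1 / 2 : ℝ))
      simp only [neg_zero] at this
      rw [← this]
      exact intervalIntegral.integral_congr fun a _ ↦ by rw [abs_neg]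
    have hpos : ∫ a in (0 : ℝ)..1, |a| * (1 / 2 : ℝ) = ∫ a in (0 : ℝ)..1, (1 / 2 : ℝ) * a := by
      refine intervalIntegral.integral_congr fun a ha ↦ ?_
      rw [Set.uIcc_of_le zero_le_one] at ha
      rw [abs_of_nonneg ha.1]; ring
    rw [hneg, hpos, intervalIntegral.integral_const_mul, integral_id]
    norm_num
  rw [hval] at hB
  refine hB.congr' ?_
  filter_upwards [eventually_gt_atTop (1 : ℝ)] with T hT
  have hN : 0 < T / (2 * π) * Real.log T := mul_pos (by positivity) (Real.log_pos hT)
  set g : ℝ → ℝ := fun a ↦ (Icc (-1 : ℝ) 1).indicator (fun _ ↦ (1 / 2 : ℝ)) a with hg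
  have hgi : Integrable g := integrable_indicator_Icc_const _ _ _
  have h := sum_fourier_pairSpacing_eq_integral g hgi hT
  simp only [hg] at h
  simp_rw [fourier_half_indicator] at h
  have h' : ((∑ p ∈ zeroIndexSet T ×ˢ zeroIndexSet T,
      Real.sinc (2 * π * pairSpacing T p) * montgomeryWeight (zetaOrdinate p.1 - zetaOrdinate p.2) : ℝ) : ℂ) =
      ((T / (2 * π) * Real.log T * ∫ a : ℝ, montgomeryFormFactor a T *
        (Icc (-1 : ℝ) 1).indicator (fun _ ↦ (1 / 2 : ℝ)) a : ℝ) : ℂ) := by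
    rw [← h]; push_cast; rfl
  have h'' := Complex.ofReal_injective h'
  rw [eq_div_iff hN.ne', h'', mul_comm]

/-- Zeros within distance `X` of a given point: `#{j : |γ_j − a| ≤ X} ≤ 2 C₁ log T (⌊2X⌋ + 1)`
(unit windows). [cite: Titchmarsh1986, Thm. 9.2] -/
theorem card_filter_abs_zetaOrdinate_sub_le {T C₁ : ℝ}
    (hwin : ∀ a : ℝ, (((Finset.range (zetaZeroCount T)).filter fun c ↦
      a ≤ zetaOrdinate c ∧ zetaOrdinate c ≤ a + 1).card : ℝ) ≤ C₁ * Real.log T)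
    {X : ℝ} (hX : 0 ≤ X) (a : ℝ) :
    (((zeroIndexSet T).filter fun j ↦ |zetaOrdinate j - a| ≤ X).card : ℝ) ≤
      2 * (C₁ * Real.log T) * (⌊X / (1 / 2)⌋₊ + 1) := by
  have hwin' : ∀ s : ℝ, |s| + 1 / 2 ≤ X + 3 →
      (((zeroIndexSet T).filter fun j ↦ |zetaOrdinate j - a - s| ≤ 1 / 2).card : ℝ) ≤ C₁ * Real.log T := by
    intro s _
    refine le_trans ?_ (hwin (a + s - 1 / 2))
    have hsub : ((zeroIndexSet T).filter fun j ↦ |zetaOrdinate j - a - s| ≤ 1 / 2) ⊆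
        ((Finset.range (zetaZeroCount T)).filter fun c ↦
          a + s - 1 / 2 ≤ zetaOrdinate c ∧ zetaOrdinate c ≤ a + s - 1 / 2 + 1) := by
      intro j hj
      rw [Finset.mem_filter] at hj ⊢
      have := abs_le.mp hj.2
      exact ⟨hj.1, by linarith, by linarith⟩
    exact_mod_cast Finset.card_le_card hsub
  exact RudnickSarnak.card_filter_abs_le_le (zeroIndexSet T) (fun j ↦ zetaOrdinate j - a) (by norm_num)
    hX hwin' (by linarith)

set_option maxHeartbeats 1600000 in
/-- **BGSTB 2025, Theorem 2: the pairs outside `𝒬(T, 𝓜)` are negligible** (§4: removing the pairs with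
a member `≤ T/log²T` costs `O(T√log T)` [here `O_𝓜(T)`], and "we now discard the terms with
`|γ − γ'| > 𝓜` which … contributes an error `≪ T log T/𝓜²`", by `|k̂(y)| ≤ 1/(L|γ−γ'|)`,
`w ≤ 4/(γ−γ')²` and unit windows): for `𝓜 ≥ 3` and all large `T`,
`|∑_{0<γ,γ'≤T} k̂ w − ∑_{𝒬(T,𝓜)} k̂ w| ≤ (K/(𝓜(𝓜−2)) + ε)(T/2π) log T`.
[cite: BaluyotGoldstonSuriajayaTurnageButterbaugh2025, §4 (proof of Theorem 2)] -/
theorem eventually_abs_sum_sub_sum_nearPairs_le :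
    ∃ K : ℝ, 0 < K ∧ ∀ 𝓜 : ℝ, 3 ≤ 𝓜 → ∀ ε : ℝ, 0 < ε → ∀ᶠ T : ℝ in atTop,
      |∑ p ∈ zeroIndexSet T ×ˢ zeroIndexSet T,
          Real.sinc (2 * π * pairSpacing T p) * montgomeryWeight (zetaOrdinate p.1 - zetaOrdinate p.2) -
        ∑ p ∈ nearPairs T 𝓜,
          Real.sinc (2 * π * pairSpacing T p) * montgomeryWeight (zetaOrdinate p.1 - zetaOrdinate p.2)| ≤
        (K / (𝓜 * (𝓜 - 2)) + ε) * (T / (2 * π) * Real.log T) := by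
  obtain ⟨C₁, hC₁, hunitE⟩ := RudnickSarnak.eventually_card_filter_zetaOrdinate_window_le
  obtain ⟨CN, hCN, hN⟩ := exists_zetaZeroCount_le_mul_log
  refine ⟨2 * π * (64 * C₁ * CN), by positivity, fun 𝓜 h𝓜 ε hε ↦ ?_⟩
  have h𝓜0 : 0 < 𝓜 := by linarith
  filter_upwards [hunitE, eventually_ge_atTop (4 : ℝ),
    (RudnickSarnak.tendsto_div_log_sq_atTop).eventually_ge_atTop (max 2 𝓜),
    Real.tendsto_log_atTop.eventually_ge_atTop (2 * π * (4 * CN * C₁ * (2 * 𝓜 + 1)) / ε + 1)]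
    with T hunit hT4 hu hLε
  have hT0 : 0 < T := by linarith
  have hT1 : 1 < T := by linarith
  set L : ℝ := Real.log T with hLdef
  have hL : 0 < L := Real.log_pos hT1
  have hL1 : 1 ≤ L := by
    have : 0 ≤ 2 * π * (4 * CN * C₁ * (2 * 𝓜 + 1)) / ε := by positivity
    linarith
  set Z := zeroIndexSet T with hZ
  set Ω := zeroIndexSet T ×ˢ zeroIndexSet T with hΩ
  set u : ℝ := T / L ^ 2 with hudef
  have hu2 : 2 ≤ u := (le_max_left _ _).trans hu
  have hu𝓜 : 𝓜 ≤ u := (le_max_right _ _).trans hu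
  set f : ℕ × ℕ → ℝ := fun p ↦
    Real.sinc (2 * π * pairSpacing T p) * montgomeryWeight (zetaOrdinate p.1 - zetaOrdinate p.2) with hf
  have hfabs : ∀ p, |f p| ≤ 1 := by
    intro p
    rw [hf]; dsimp only
    rw [abs_mul, abs_of_pos (montgomeryWeight_pos _)]
    exact mul_le_one₀ (Real.abs_sinc_le_one _) (montgomeryWeight_pos _).le (montgomeryWeight_le_one _)
  -- decomposition `Ω \ 𝒬 ⊆ Far ∪ A`
  have hQΩ : nearPairs T 𝓜 ⊆ Ω := fun p hp ↦ (mem_nearPairs.mp hp).1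
  set Far := Ω.filter fun p ↦ 𝓜 < |zetaOrdinate p.1 - zetaOrdinate p.2| with hFar
  set A := Ω.filter fun p ↦ |zetaOrdinate p.1 - zetaOrdinate p.2| ≤ 𝓜 ∧
    (zetaOrdinate p.1 ≤ u ∨ zetaOrdinate p.2 ≤ u) with hA
  have hcover : Ω \ nearPairs T 𝓜 ⊆ Far ∪ A := by
    intro p hp
    rw [Finset.mem_sdiff] at hp
    obtain ⟨hpΩ, hpQ⟩ := hp
    rw [mem_nearPairs, not_and] at hpQ
    have hnot := hpQ hpΩ
    rw [Finset.mem_union, hFar, hA, Finset.mem_filter, Finset.mem_filter]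
    by_cases hfar : 𝓜 < |zetaOrdinate p.1 - zetaOrdinate p.2|
    · exact Or.inl ⟨hpΩ, hfar⟩
    · right
      push Not at hfar
      refine ⟨hpΩ, hfar, ?_⟩
      by_contra hcon
      push Not at hcon
      exact hnot ⟨by rw [← hudef]; exact hcon.1, by rw [← hudef]; exact hcon.2, hfar⟩
  have hnn : ∀ p, 0 ≤ |f p| := fun p ↦ abs_nonneg _
  have hmain : |∑ p ∈ Ω, f p - ∑ p ∈ nearPairs T 𝓜, f p| ≤ ∑ p ∈ Far, |f p| + ∑ p ∈ A, |f p| := by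
    rw [← Finset.sum_sdiff_eq_sub hQΩ]
    calc |∑ p ∈ Ω \ nearPairs T 𝓜, f p| ≤ ∑ p ∈ Ω \ nearPairs T 𝓜, |f p| := Finset.abs_sum_le_sum_abs _ _
      _ ≤ ∑ p ∈ Far ∪ A, |f p| := Finset.sum_le_sum_of_subset_of_nonneg hcover fun p _ _ ↦ hnn p
      _ ≤ ∑ p ∈ Far, |f p| + ∑ p ∈ A, |f p| := RudnickSarnak.sum_union_le_add _ _ hnn
  -- the far pairs: `|f| ≤ 4/(L |γ−γ'|³) ≤ (16/(L 𝓜)) (1+|γ−γ'|)^{-2}`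
  have hfar_pt : ∀ p ∈ Far, |f p| ≤ 16 / (L * 𝓜) * ((1 + |zetaOrdinate p.1 - zetaOrdinate p.2|) ^ 2)⁻¹ := by
    intro p hp
    rw [hFar, Finset.mem_filter] at hp
    set v : ℝ := zetaOrdinate p.1 - zetaOrdinate p.2 with hv
    have hv𝓜 : 𝓜 < |v| := hp.2
    have hv1 : 1 ≤ |v| := by linarith
    have hv0 : v ≠ 0 := by intro h; rw [h, abs_zero] at hv1; linarith
    have hy : 2 * π * pairSpacing T p = L * v := by rw [hLdef, hv]; unfold pairSpacing; field_simp
    rw [hf]; dsimp only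
    rw [abs_mul, abs_of_pos (montgomeryWeight_pos _), hy, ← hv]
    have h1 : |Real.sinc (L * v)| ≤ (L * |v|)⁻¹ := by
      have := abs_sinc_le_inv_abs (mul_ne_zero hL.ne' hv0)
      rwa [abs_mul, abs_of_pos hL] at this
    have h2 : montgomeryWeight v ≤ 4 / v ^ 2 := by
      rw [montgomeryWeight]
      apply div_le_div_of_nonneg_left (by norm_num) (by positivity) (by linarith)
    have h3 : (1 + |v|) ^ 2 ≤ 4 * v ^ 2 := by nlinarith [sq_abs v]
    calc |Real.sinc (L * v)| * montgomeryWeight v ≤ (L * |v|)⁻¹ * (4 / v ^ 2) :=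
          mul_le_mul h1 h2 (montgomeryWeight_pos _).le (by positivity)
      _ = 4 / (L * (|v| * v ^ 2)) := by field_simp
      _ ≤ 4 / (L * (𝓜 * ((1 + |v|) ^ 2 / 4))) := by
          apply div_le_div_of_nonneg_left (by norm_num) (by positivity)
          apply mul_le_mul_of_nonneg_left _ hL.le
          exact mul_le_mul hv𝓜.le (by linarith) (by positivity) (by positivity)
      _ = 16 / (L * 𝓜) * ((1 + |v|) ^ 2)⁻¹ := by field_simp; norm_num
  have hrow : ∀ i ∈ Z, ∑ j ∈ Z with 𝓜 < |zetaOrdinate i - zetaOrdinate j| ∧ |zetaOrdinate i - zetaOrdinate j| ≤ T,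
      ((1 + |zetaOrdinate i - zetaOrdinate j|) ^ 2)⁻¹ ≤ 2 * (2 * (C₁ * L)) / (1 * (𝓜 - 2 * 1)) := by
    intro i _
    have hwin_i : ∀ s : ℝ, |s| + 1 ≤ T + 5 / 2 →
        ((Z.filter fun j ↦ |zetaOrdinate i - zetaOrdinate j - s| ≤ 1).card : ℝ) ≤ 2 * (C₁ * L) := by
      intro s _
      have hsub : (Z.filter fun j ↦ |zetaOrdinate i - zetaOrdinate j - s| ≤ 1) ⊆
          ((Finset.range (zetaZeroCount T)).filter fun c ↦
              zetaOrdinate i - s - 1 ≤ zetaOrdinate c ∧ zetaOrdinate c ≤ zetaOrdinate i - s - 1 + 1) ∪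
          ((Finset.range (zetaZeroCount T)).filter fun c ↦
              zetaOrdinate i - s - 1 + 1 ≤ zetaOrdinate c ∧ zetaOrdinate c ≤ zetaOrdinate i - s - 1 + 1 + 1) := by
        intro j hj
        rw [Finset.mem_filter] at hj
        have hjr : j ∈ Finset.range (zetaZeroCount T) := hj.1
        obtain ⟨h1, h2⟩ := abs_le.mp hj.2
        rw [Finset.mem_union, Finset.mem_filter, Finset.mem_filter]
        by_cases h : zetaOrdinate j ≤ zetaOrdinate i - s - 1 + 1
        · exact Or.inl ⟨hjr, by linarith, h⟩
        · push Not at h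
          exact Or.inr ⟨hjr, h.le, by linarith⟩
      calc ((Z.filter fun j ↦ |zetaOrdinate i - zetaOrdinate j - s| ≤ 1).card : ℝ)
          ≤ ((((Finset.range (zetaZeroCount T)).filter fun c ↦
                zetaOrdinate i - s - 1 ≤ zetaOrdinate c ∧ zetaOrdinate c ≤ zetaOrdinate i - s - 1 + 1) ∪
              ((Finset.range (zetaZeroCount T)).filter fun c ↦
                zetaOrdinate i - s - 1 + 1 ≤ zetaOrdinate c ∧
                  zetaOrdinate c ≤ zetaOrdinate i - s - 1 + 1 + 1)).card : ℝ) := by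
            exact_mod_cast Finset.card_le_card hsub
        _ ≤ C₁ * L + C₁ * L := by
            refine le_trans (by exact_mod_cast Finset.card_union_le _ _) (add_le_add (hunit _) (hunit _))
        _ = 2 * (C₁ * L) := by ring
    exact RudnickSarnak.sum_filter_mid_le Z (fun j ↦ zetaOrdinate i - zetaOrdinate j) one_pos
      (by linarith : 3 * (1 : ℝ) ≤ 𝓜) (by positivity : (0 : ℝ) ≤ 2 * (C₁ * L)) hwin_i
      (by linarith : (T / 1 + 5 / 2) * 1 ≤ T + 5 / 2)
  have hNT : (zetaZeroCount T : ℝ) ≤ CN * (T * L) := hN T (by linarith)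
  have hFarsum : ∑ p ∈ Far, |f p| ≤ 64 * C₁ * CN * (T * L) / (𝓜 * (𝓜 - 2)) := by
    have hFar' : Far = Ω.filter fun p ↦ 𝓜 < |zetaOrdinate p.1 - zetaOrdinate p.2| ∧
        |zetaOrdinate p.1 - zetaOrdinate p.2| ≤ T := by
      rw [hFar]
      ext p
      simp only [Finset.mem_filter]
      constructor
      · rintro ⟨h1, h2⟩; exact ⟨h1, h2, abs_sub_zetaOrdinate_le h1⟩
      · rintro ⟨h1, h2, -⟩; exact ⟨h1, h2⟩
    have e : ∑ p ∈ Far, ((1 + |zetaOrdinate p.1 - zetaOrdinate p.2|) ^ 2)⁻¹ =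
        ∑ i ∈ Z, ∑ j ∈ Z with 𝓜 < |zetaOrdinate i - zetaOrdinate j| ∧ |zetaOrdinate i - zetaOrdinate j| ≤ T,
          ((1 + |zetaOrdinate i - zetaOrdinate j|) ^ 2)⁻¹ := by
      rw [hFar', Finset.sum_filter, hΩ, Finset.sum_product]
      refine Finset.sum_congr rfl fun i _ ↦ ?_
      rw [Finset.sum_filter]
    calc ∑ p ∈ Far, |f p| ≤ ∑ p ∈ Far, 16 / (L * 𝓜) * ((1 + |zetaOrdinate p.1 - zetaOrdinate p.2|) ^ 2)⁻¹ :=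
          Finset.sum_le_sum hfar_pt
      _ = 16 / (L * 𝓜) * ∑ p ∈ Far, ((1 + |zetaOrdinate p.1 - zetaOrdinate p.2|) ^ 2)⁻¹ := by
          rw [Finset.mul_sum]
      _ ≤ 16 / (L * 𝓜) * (zetaZeroCount T * (2 * (2 * (C₁ * L)) / (1 * (𝓜 - 2 * 1)))) := by
          apply mul_le_mul_of_nonneg_left _ (by positivity)
          rw [e]
          calc _ ≤ ∑ i ∈ Z, 2 * (2 * (C₁ * L)) / (1 * (𝓜 - 2 * 1)) := Finset.sum_le_sum hrow
            _ = _ := by rw [Finset.sum_const, nsmul_eq_mul, hZ, card_zeroIndexSet]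
      _ ≤ 16 / (L * 𝓜) * (CN * (T * L) * (2 * (2 * (C₁ * L)) / (1 * (𝓜 - 2 * 1)))) := by
          apply mul_le_mul_of_nonneg_left _ (by positivity)
          exact mul_le_mul_of_nonneg_right hNT (div_nonneg (by positivity) (by linarith))
      _ = 64 * C₁ * CN * (T * L) / (𝓜 * (𝓜 - 2)) := by
          have : 𝓜 - 2 ≠ 0 := by linarith
          field_simp
          ring
  -- the low close pairs: `O_𝓜(T)`
  have hAcard : (A.card : ℝ) ≤ 4 * CN * C₁ * (2 * 𝓜 + 1) * T := by
    set Zlow := Z.filter fun i ↦ zetaOrdinate i ≤ u with hZlow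
    have hsub : A ⊆ ((Zlow ×ˢ Z).filter fun p ↦ |zetaOrdinate p.1 - zetaOrdinate p.2| ≤ 𝓜) ∪
        ((Z ×ˢ Zlow).filter fun p ↦ |zetaOrdinate p.1 - zetaOrdinate p.2| ≤ 𝓜) := by
      intro p hp
      rw [hA, Finset.mem_filter, hΩ, Finset.mem_product] at hp
      rw [Finset.mem_union, Finset.mem_filter, Finset.mem_filter, Finset.mem_product, Finset.mem_product,
        hZlow, Finset.mem_filter, Finset.mem_filter]
      rcases hp.2.2 with h | h
      · exact Or.inl ⟨⟨⟨hp.1.1, h⟩, hp.1.2⟩, hp.2.1⟩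
      · exact Or.inr ⟨⟨hp.1.1, hp.1.2, h⟩, hp.2.1⟩
    have hrowc : ∀ i : ℕ, (((Z.filter fun j ↦ |zetaOrdinate i - zetaOrdinate j| ≤ 𝓜)).card : ℝ) ≤
        2 * (C₁ * L) * (⌊𝓜 / (1 / 2)⌋₊ + 1) := by
      intro i
      have h := card_filter_abs_zetaOrdinate_sub_le hunit h𝓜0.le (zetaOrdinate i)
      refine le_trans (le_of_eq ?_) h
      rw [hZ]
      congr 2
      ext j; simp only [Finset.mem_filter, abs_sub_comm]
    have hfl : (⌊𝓜 / (1 / 2)⌋₊ : ℝ) ≤ 2 * 𝓜 := by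
      have := Nat.floor_le (show 0 ≤ 𝓜 / (1 / 2) by positivity); linarith
    have hZlowc : (Zlow.card : ℝ) ≤ CN * T / L := by
      have h1 : Zlow.card ≤ zetaZeroCount u := card_filter_zetaOrdinate_le_le T u
      have h2 := hN u hu2
      have hlu : Real.log u ≤ L := by
        apply Real.log_le_log (by linarith)
        rw [hudef, div_le_iff₀ (by positivity)]
        have : (1 : ℝ) ≤ L ^ 2 := one_le_pow₀ hL1
        nlinarith
      have hlu0 : 0 ≤ Real.log u := Real.log_nonneg (by linarith)
      calc (Zlow.card : ℝ) ≤ zetaZeroCount u := by exact_mod_cast h1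
        _ ≤ CN * (u * Real.log u) := h2
        _ ≤ CN * (u * L) := by gcongr
        _ = CN * T / L := by rw [hudef]; field_simp
    have hpart1 : ((((Zlow ×ˢ Z).filter fun p ↦ |zetaOrdinate p.1 - zetaOrdinate p.2| ≤ 𝓜)).card : ℝ) ≤
        (CN * T / L) * (2 * (C₁ * L) * (2 * 𝓜 + 1)) := by
      have e : (((Zlow ×ˢ Z).filter fun p ↦ |zetaOrdinate p.1 - zetaOrdinate p.2| ≤ 𝓜)).card =
          ∑ i ∈ Zlow, ((Z.filter fun j ↦ |zetaOrdinate i - zetaOrdinate j| ≤ 𝓜)).card := by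
        rw [Finset.card_filter, Finset.sum_product]
        refine Finset.sum_congr rfl fun i _ ↦ ?_
        rw [Finset.card_filter]
      rw [e]; push_cast
      calc ∑ i ∈ Zlow, (((Z.filter fun j ↦ |zetaOrdinate i - zetaOrdinate j| ≤ 𝓜)).card : ℝ)
          ≤ ∑ i ∈ Zlow, 2 * (C₁ * L) * (2 * 𝓜 + 1) := by
            refine Finset.sum_le_sum fun i _ ↦ (hrowc i).trans ?_
            gcongr
        _ = Zlow.card * (2 * (C₁ * L) * (2 * 𝓜 + 1)) := by rw [Finset.sum_const, nsmul_eq_mul]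
        _ ≤ (CN * T / L) * (2 * (C₁ * L) * (2 * 𝓜 + 1)) := by gcongr
    have hpart2 : ((((Z ×ˢ Zlow).filter fun p ↦ |zetaOrdinate p.1 - zetaOrdinate p.2| ≤ 𝓜)).card : ℝ) ≤
        (CN * T / L) * (2 * (C₁ * L) * (2 * 𝓜 + 1)) := by
      have e : (((Z ×ˢ Zlow).filter fun p ↦ |zetaOrdinate p.1 - zetaOrdinate p.2| ≤ 𝓜)).card =
          ∑ j ∈ Zlow, ((Z.filter fun i ↦ |zetaOrdinate i - zetaOrdinate j| ≤ 𝓜)).card := by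
        rw [Finset.card_filter, Finset.sum_product_right]
        refine Finset.sum_congr rfl fun j _ ↦ ?_
        rw [Finset.card_filter]
      rw [e]; push_cast
      calc ∑ j ∈ Zlow, (((Z.filter fun i ↦ |zetaOrdinate i - zetaOrdinate j| ≤ 𝓜)).card : ℝ)
          ≤ ∑ j ∈ Zlow, 2 * (C₁ * L) * (2 * 𝓜 + 1) := by
            refine Finset.sum_le_sum fun j _ ↦ ?_
            have h := (hrowc j)
            have e2 : (Z.filter fun i ↦ |zetaOrdinate i - zetaOrdinate j| ≤ 𝓜) =
                (Z.filter fun i ↦ |zetaOrdinate j - zetaOrdinate i| ≤ 𝓜) := by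
              ext i; simp only [Finset.mem_filter, abs_sub_comm]
            rw [e2]
            refine h.trans ?_
            gcongr
        _ = Zlow.card * (2 * (C₁ * L) * (2 * 𝓜 + 1)) := by rw [Finset.sum_const, nsmul_eq_mul]
        _ ≤ (CN * T / L) * (2 * (C₁ * L) * (2 * 𝓜 + 1)) := by gcongr
    calc (A.card : ℝ) ≤ ((((Zlow ×ˢ Z).filter fun p ↦ |zetaOrdinate p.1 - zetaOrdinate p.2| ≤ 𝓜) ∪
          ((Z ×ˢ Zlow).filter fun p ↦ |zetaOrdinate p.1 - zetaOrdinate p.2| ≤ 𝓜)).card : ℝ) := by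
          exact_mod_cast Finset.card_le_card hsub
      _ ≤ (CN * T / L) * (2 * (C₁ * L) * (2 * 𝓜 + 1)) + (CN * T / L) * (2 * (C₁ * L) * (2 * 𝓜 + 1)) := by
          refine le_trans (by exact_mod_cast Finset.card_union_le _ _) (add_le_add hpart1 hpart2)
      _ = 4 * CN * C₁ * (2 * 𝓜 + 1) * T := by field_simp; ring
  have hAsum : ∑ p ∈ A, |f p| ≤ 4 * CN * C₁ * (2 * 𝓜 + 1) * T :=
    calc ∑ p ∈ A, |f p| ≤ ∑ p ∈ A, (1 : ℝ) := Finset.sum_le_sum fun p _ ↦ hfabs p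
      _ = A.card := by rw [Finset.sum_const, nsmul_eq_mul, mul_one]
      _ ≤ _ := hAcard
  -- assemble
  have hN0 : 0 < T / (2 * π) * L := by positivity
  have hfar' : 64 * C₁ * CN * (T * L) / (𝓜 * (𝓜 - 2)) =
      2 * π * (64 * C₁ * CN) / (𝓜 * (𝓜 - 2)) * (T / (2 * π) * L) := by
    have : 𝓜 - 2 ≠ 0 := by linarith
    field_simp
  have hA' : 4 * CN * C₁ * (2 * 𝓜 + 1) * T ≤ ε * (T / (2 * π) * L) := by
    rw [show ε * (T / (2 * π) * L) = (ε * L / (2 * π)) * T by ring]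
    apply mul_le_mul_of_nonneg_right _ hT0.le
    rw [le_div_iff₀ (by positivity)]
    have h1 : 2 * π * (4 * CN * C₁ * (2 * 𝓜 + 1)) / ε ≤ L := by linarith
    rw [div_le_iff₀ hε] at h1
    linarith
  calc |∑ p ∈ Ω, f p - ∑ p ∈ nearPairs T 𝓜, f p| ≤ ∑ p ∈ Far, |f p| + ∑ p ∈ A, |f p| := hmain
    _ ≤ 64 * C₁ * CN * (T * L) / (𝓜 * (𝓜 - 2)) + 4 * CN * C₁ * (2 * 𝓜 + 1) * T := add_le_add hFarsum hAsum
    _ ≤ 2 * π * (64 * C₁ * CN) / (𝓜 * (𝓜 - 2)) * (T / (2 * π) * L) + ε * (T / (2 * π) * L) := by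
        rw [hfar']; linarith
    _ = (2 * π * (64 * C₁ * CN) / (𝓜 * (𝓜 - 2)) + ε) * (T / (2 * π) * L) := by ring

end AH

namespace AH

/-- Pairs with `|γ − γ'| ≤ 𝓜`: `#{(γ,γ') : |γ − γ'| ≤ 𝓜} ≤ N(T) · 2C₁ log T (⌊2𝓜⌋ + 1)` (unit windows;
BGSTB's (zeropairbound) for bounded `h`). [cite: BaluyotGoldstonSuriajayaTurnageButterbaugh2025, §3 (zeropairbound)] -/
theorem card_filter_abs_sub_le_unit {T C₁ : ℝ}
    (hwin : ∀ a : ℝ, (((Finset.range (zetaZeroCount T)).filter fun c ↦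
      a ≤ zetaOrdinate c ∧ zetaOrdinate c ≤ a + 1).card : ℝ) ≤ C₁ * Real.log T)
    {𝓜 : ℝ} (h𝓜 : 0 ≤ 𝓜) :
    ((((zeroIndexSet T ×ˢ zeroIndexSet T).filter fun p ↦
        |zetaOrdinate p.1 - zetaOrdinate p.2| ≤ 𝓜)).card : ℝ) ≤
      zetaZeroCount T * (2 * (C₁ * Real.log T) * (⌊𝓜 / (1 / 2)⌋₊ + 1)) := by
  have e : (((zeroIndexSet T ×ˢ zeroIndexSet T).filter fun p ↦
      |zetaOrdinate p.1 - zetaOrdinate p.2| ≤ 𝓜)).card =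
      ∑ i ∈ zeroIndexSet T, ((zeroIndexSet T).filter fun j ↦ |zetaOrdinate i - zetaOrdinate j| ≤ 𝓜).card := by
    rw [Finset.card_filter, Finset.sum_product]
    refine Finset.sum_congr rfl fun i _ ↦ ?_
    rw [Finset.card_filter]
  rw [e]; push_cast
  calc ∑ i ∈ zeroIndexSet T, ((((zeroIndexSet T).filter fun j ↦ |zetaOrdinate i - zetaOrdinate j| ≤ 𝓜)).card : ℝ)
      ≤ ∑ i ∈ zeroIndexSet T, 2 * (C₁ * Real.log T) * (⌊𝓜 / (1 / 2)⌋₊ + 1) := by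
        refine Finset.sum_le_sum fun i _ ↦ ?_
        have h := card_filter_abs_zetaOrdinate_sub_le hwin h𝓜 (zetaOrdinate i)
        refine le_trans (le_of_eq ?_) h
        congr 2
        ext j; simp only [Finset.mem_filter, abs_sub_comm]
    _ = zetaZeroCount T * (2 * (C₁ * Real.log T) * (⌊𝓜 / (1 / 2)⌋₊ + 1)) := by
        rw [Finset.sum_const, nsmul_eq_mul, card_zeroIndexSet]

set_option maxHeartbeats 1600000 in
/-- **BGSTB 2025, Theorem 2: the sum over `𝒬(T, 𝓜)` under Strong AH-Pairs** (§4): for all large `T`,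
`|∑_{(γ,γ')∈𝒬(T,𝓜)} k̂(y) w(γ−γ') − |B_0|| ≤ ε (T/2π) log T`. Printed: the terms with `k ≠ 0` contribute
"`≪ R(T)|𝒬(T,𝓜)| ≪ 𝓜 R(T) T log²T`" (by `|sin(πk + x)| = |sin x| ≤ |x|`), and the terms with `k = 0` are
"`(1 + O(R(T)²))(1 + O(R(T)²/log²T))|B_0|`" (`(sin x)/x = 1 + O(x²)`, `w(u) = 1 + O(u²)`); with
`R(T) log T → 0`. [cite: BaluyotGoldstonSuriajayaTurnageButterbaugh2025, §4 (proof of Theorem 2)] -/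
theorem eventually_abs_sum_nearPairs_sub_card_bin_le (hRH : RiemannHypothesis) {𝓜 : ℝ} (h𝓜 : 0 < 𝓜)
    (hSAH : StrongAHPairsAt 𝓜) {δ : ℝ} (hδ : 0 < δ) (hδ2 : δ ≤ 1 / 2) {M : ℝ} (hM : 1 ≤ M)
    {ε : ℝ} (hε : 0 < ε) :
    ∀ᶠ T : ℝ in atTop,
      |∑ p ∈ nearPairs T 𝓜,
          Real.sinc (2 * π * pairSpacing T p) * montgomeryWeight (zetaOrdinate p.1 - zetaOrdinate p.2) -
        ((bin 0 T M δ).card : ℝ)| ≤ ε * (T / (2 * π) * Real.log T) := by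
  obtain ⟨R, hR0, -, hRL, C, hC⟩ := hSAH
  obtain ⟨C₁, hC₁, hunitE⟩ := RudnickSarnak.eventually_card_filter_zetaOrdinate_window_le
  obtain ⟨CN, hCN, hN⟩ := exists_zetaZeroCount_le_mul_log
  obtain ⟨y₀, hy₀, C_w, hwinE⟩ := RudnickSarnak.exists_pairCount_window_le hRH
  set Cw : ℝ := max C_w 1 with hCw
  have hCw0 : 0 < Cw := lt_of_lt_of_le one_pos (le_max_right _ _)
  set C' : ℝ := max C 1 with hC'
  have hC'0 : 0 < C' := lt_of_lt_of_le one_pos (le_max_right _ _)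
  have hC'C : C ≤ C' := le_max_left _ _
  -- `R → 0` (from `R log T → 0`)
  have hRlim : Tendsto R atTop (𝓝 0) := by
    have h1 : ∀ᶠ T : ℝ in atTop, 1 ≤ Real.log T := Real.tendsto_log_atTop.eventually_ge_atTop 1
    refine squeeze_zero' (Eventually.of_forall fun T ↦ (hR0 T).le) ?_ hRL
    filter_upwards [h1] with T hT
    calc R T = R T * 1 := (mul_one _).symm
      _ ≤ R T * Real.log T := mul_le_mul_of_nonneg_left hT (hR0 T).le
  have hC'R : Tendsto (fun T ↦ C' * R T) atTop (𝓝 0) := by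
    have := hRlim.const_mul C'; rwa [mul_zero] at this
  have hC'RL : Tendsto (fun T ↦ C' * (R T * Real.log T)) atTop (𝓝 0) := by
    have := hRL.const_mul C'; rwa [mul_zero] at this
  -- continuity of `sinc` at `0`
  set ε₁ : ℝ := ε / (12 * π * Cw) with hε₁
  have hε₁0 : 0 < ε₁ := by positivity
  obtain ⟨η, hη, hsinc⟩ : ∃ η > 0, ∀ x : ℝ, |x| < η → |Real.sinc x - 1| < ε₁ := by
    have h := Metric.continuousAt_iff.mp (Real.continuous_sinc.continuousAt (x := (0 : ℝ))) ε₁ hε₁0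
    obtain ⟨η, hη, h⟩ := h
    refine ⟨η, hη, fun x hx ↦ ?_⟩
    have := @h x (by rw [dist_eq_norm, Real.norm_eq_abs, sub_zero]; exact hx)
    rwa [Real.sinc_zero, dist_eq_norm, Real.norm_eq_abs] at this
  -- the constant of the `k ≠ 0` terms
  set KQ : ℝ := 2 * π * (16 * CN * C₁ * (2 * 𝓜 + 1)) with hKQ
  have hKQ0 : 0 < KQ := by positivity
  filter_upwards [hC, hunitE, hwinE, eventually_ge_atTop (4 : ℝ),
    hC'R.eventually (gt_mem_nhds (show (0 : ℝ) < min (min (1 / 8) (δ / 2)) (min y₀ (min (η / (2 * π)) (ε₁ / π ^ 2)))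
      by positivity)),
    hC'RL.eventually (gt_mem_nhds (show (0 : ℝ) < ε / (3 * KQ) by positivity)),
    Real.tendsto_log_atTop.eventually_ge_atTop (π * δ / 𝓜 + 1),
    Real.tendsto_log_atTop.eventually_ge_atTop (π * y₀)]
    with T hCT hunit hwin hT4 hsmall hRLT hLδ hLy₀
  have hT0 : 0 < T := by linarith
  have hT1 : 1 < T := by linarith
  set L : ℝ := Real.log T with hLdef
  have hL : 0 < L := Real.log_pos hT1
  have hL1 : 1 ≤ L := by
    have : 0 ≤ π * δ / 𝓜 := by positivity
    linarith
  have hN0 : 0 < T / (2 * π) * L := by positivity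
  set e₀ : ℝ := C' * R T with he₀
  have he₀pos : 0 < e₀ := mul_pos hC'0 (hR0 T)
  have he₀8 : e₀ < 1 / 8 := lt_of_lt_of_le hsmall ((min_le_left _ _).trans (min_le_left _ _))
  have he₀δ : e₀ < δ / 2 := lt_of_lt_of_le hsmall ((min_le_left _ _).trans (min_le_right _ _))
  have he₀y : e₀ < y₀ := lt_of_lt_of_le hsmall ((min_le_right _ _).trans (min_le_left _ _))
  have he₀η : e₀ < η / (2 * π) :=
    lt_of_lt_of_le hsmall ((min_le_right _ _).trans ((min_le_right _ _).trans (min_le_left _ _)))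
  have he₀ε : e₀ < ε₁ / π ^ 2 :=
    lt_of_lt_of_le hsmall ((min_le_right _ _).trans ((min_le_right _ _).trans (min_le_right _ _)))
  have hRLT' : C' * (R T * L) < ε / (3 * KQ) := hRLT
  set Ω := zeroIndexSet T ×ˢ zeroIndexSet T with hΩ
  set Q := nearPairs T 𝓜 with hQ
  set f : ℕ × ℕ → ℝ := fun p ↦
    Real.sinc (2 * π * pairSpacing T p) * montgomeryWeight (zetaOrdinate p.1 - zetaOrdinate p.2) with hf
  -- the dichotomy on `𝒬(T, 𝓜)`
  have hdich : ∀ p ∈ Q, |pairSpacing T p| ≤ e₀ ∨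
      (1 / 4 < |pairSpacing T p| ∧ |Real.sinc (2 * π * pairSpacing T p)| ≤ 8 * e₀) := by
    intro p hp
    obtain ⟨k, hk⟩ := hCT p hp
    set y := pairSpacing T p with hy
    have hk' : |y - (k : ℝ) / 2| ≤ C' * (|(k : ℝ)| + 1) * R T := by
      refine hk.trans ?_
      gcongr
      · exact (hR0 T).le
    rcases eq_or_ne k 0 with rfl | hk0
    · left
      simp only [Int.cast_zero, zero_div, sub_zero, abs_zero, zero_add, mul_one] at hk'
      exact hk'
    · right
      have hk1 : (1 : ℝ) ≤ |(k : ℝ)| := by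
        rw [← Int.cast_abs]; exact_mod_cast Int.one_le_abs hk0
      set e : ℝ := C' * (|(k : ℝ)| + 1) * R T with he
      have he1 : e = (|(k : ℝ)| + 1) * e₀ := by rw [he, he₀]; ring
      have he' : e < |(k : ℝ)| / 4 := by
        rw [he1]
        calc (|(k : ℝ)| + 1) * e₀ < (|(k : ℝ)| + 1) * (1 / 8) :=
              mul_lt_mul_of_pos_left he₀8 (by positivity)
          _ ≤ |(k : ℝ)| / 4 := by linarith
      have he2 : e ≤ 2 * |(k : ℝ)| * e₀ := by rw [he1]; nlinarith
      have hyk : |(k : ℝ)| / 4 < |y| := by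
        have := abs_sub_abs_le_abs_sub ((k : ℝ) / 2) y
        rw [abs_sub_comm, abs_div, abs_two] at this
        linarith
      refine ⟨by linarith, ?_⟩
      have hy0 : y ≠ 0 := by
        intro h; rw [h, abs_zero] at hyk; linarith
      have hsin : |Real.sin (2 * π * y)| ≤ 2 * π * e := by
        have e1 : 2 * π * y = 2 * π * (y - (k : ℝ) / 2) + k * π := by ring
        rw [e1, Real.sin_add_int_mul_pi, abs_mul, abs_neg_one_zpow, one_mul]
        refine (Real.abs_sin_le_abs).trans ?_
        rw [abs_mul, abs_of_pos (by positivity : (0 : ℝ) < 2 * π)]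
        exact mul_le_mul_of_nonneg_left hk' (by positivity)
      rw [Real.sinc_of_ne_zero (by positivity), abs_div, abs_mul, abs_of_pos (by positivity : (0 : ℝ) < 2 * π)]
      rw [div_le_iff₀ (by positivity)]
      calc |Real.sin (2 * π * y)| ≤ 2 * π * e := hsin
        _ ≤ 2 * π * (2 * |(k : ℝ)| * e₀) := by gcongr
        _ = 8 * e₀ * (2 * π * (|(k : ℝ)| / 4)) := by ring
        _ ≤ 8 * e₀ * (2 * π * |y|) := by gcongr
  -- split `𝒬 = Q₀ ⊔ Q₁`
  set Q₀ := Q.filter fun p ↦ |pairSpacing T p| ≤ e₀ with hQ₀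
  set Q₁ := Q.filter fun p ↦ ¬ |pairSpacing T p| ≤ e₀ with hQ₁
  have hsplit : ∑ p ∈ Q, f p = ∑ p ∈ Q₀, f p + ∑ p ∈ Q₁, f p :=
    (Finset.sum_filter_add_sum_filter_not Q (fun p ↦ |pairSpacing T p| ≤ e₀) f).symm
  -- `Q₀ = B_0(T, M, δ)`
  have hπδ : π * δ ≤ 𝓜 * L := by
    have h1 : π * δ / 𝓜 ≤ L := by linarith
    rw [div_le_iff₀ h𝓜] at h1; linarith
  have hQ0bin : Q₀ = bin 0 T M δ := by
    ext p
    rw [hQ₀, Finset.mem_filter, hQ, mem_nearPairs, mem_bin, mem_pairs]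
    push_cast
    constructor
    · rintro ⟨⟨hpΩ, h1, h2, -⟩, hy⟩
      have := abs_le.mp hy
      exact ⟨⟨hpΩ, h1, h2, by linarith⟩, by linarith, by linarith⟩
    · rintro ⟨⟨hpΩ, h1, h2, -⟩, h3, h4⟩
      have hyδ : |pairSpacing T p| ≤ δ / 2 := abs_le.mpr ⟨by linarith, by linarith⟩
      have hγ : |zetaOrdinate p.1 - zetaOrdinate p.2| ≤ 𝓜 := by
        have e : zetaOrdinate p.1 - zetaOrdinate p.2 = 2 * π * pairSpacing T p / L := by
          have hL' : Real.log T ≠ 0 := by rw [← hLdef]; exact hL.ne'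
          rw [hLdef]; unfold pairSpacing; field_simp
        rw [e, abs_div, abs_mul, abs_of_pos (by positivity : (0 : ℝ) < 2 * π), abs_of_pos hL,
          div_le_iff₀ hL]
        nlinarith [Real.pi_pos]
      have hpQ : p ∈ Q := by rw [hQ, mem_nearPairs]; exact ⟨hpΩ, h1, h2, hγ⟩
      refine ⟨⟨hpΩ, h1, h2, hγ⟩, ?_⟩
      rcases hdich p hpQ with h | h
      · exact h
      · exfalso; linarith [h.1]
  -- (1) the `k ≠ 0` terms
  have hcardQ : (Q.card : ℝ) ≤ CN * (T * L) * (2 * (C₁ * L) * (2 * 𝓜 + 1)) := by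
    have hsub : Q ⊆ (Ω.filter fun p ↦ |zetaOrdinate p.1 - zetaOrdinate p.2| ≤ 𝓜) := by
      intro p hp
      rw [hQ, mem_nearPairs] at hp
      rw [Finset.mem_filter]
      exact ⟨hp.1, hp.2.2.2⟩
    have h1 := card_filter_abs_sub_le_unit hunit h𝓜.le (T := T)
    have hfl : (⌊𝓜 / (1 / 2)⌋₊ : ℝ) ≤ 2 * 𝓜 := by
      have := Nat.floor_le (show 0 ≤ 𝓜 / (1 / 2) by positivity); linarith
    have hNT : (zetaZeroCount T : ℝ) ≤ CN * (T * L) := hN T (by linarith)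
    calc (Q.card : ℝ) ≤ ((Ω.filter fun p ↦ |zetaOrdinate p.1 - zetaOrdinate p.2| ≤ 𝓜).card : ℝ) := by
          exact_mod_cast Finset.card_le_card hsub
      _ ≤ zetaZeroCount T * (2 * (C₁ * L) * (⌊𝓜 / (1 / 2)⌋₊ + 1)) := h1
      _ ≤ CN * (T * L) * (2 * (C₁ * L) * (2 * 𝓜 + 1)) := by gcongr
  have hQ1sum : |∑ p ∈ Q₁, f p| ≤ ε / 3 * (T / (2 * π) * L) := by
    calc |∑ p ∈ Q₁, f p| ≤ ∑ p ∈ Q₁, |f p| := Finset.abs_sum_le_sum_abs _ _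
      _ ≤ ∑ p ∈ Q₁, 8 * e₀ := by
          refine Finset.sum_le_sum fun p hp ↦ ?_
          rw [hQ₁, Finset.mem_filter] at hp
          rcases hdich p hp.1 with h | h
          · exact absurd h hp.2
          · rw [hf]; dsimp only
            rw [abs_mul, abs_of_pos (montgomeryWeight_pos _)]
            calc |Real.sinc (2 * π * pairSpacing T p)| * montgomeryWeight (zetaOrdinate p.1 - zetaOrdinate p.2)
                ≤ 8 * e₀ * 1 := mul_le_mul h.2 (montgomeryWeight_le_one _) (montgomeryWeight_pos _).le (by positivity)
              _ = 8 * e₀ := mul_one _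
      _ = 8 * e₀ * Q₁.card := by rw [Finset.sum_const, nsmul_eq_mul, mul_comm]
      _ ≤ 8 * e₀ * Q.card := by
          gcongr
          rw [hQ₁]; exact Finset.filter_subset _ _
      _ ≤ 8 * e₀ * (CN * (T * L) * (2 * (C₁ * L) * (2 * 𝓜 + 1))) := by gcongr
      _ = KQ * (C' * (R T * L)) * (T / (2 * π) * L) := by rw [hKQ, he₀]; field_simp; ring
      _ ≤ KQ * (ε / (3 * KQ)) * (T / (2 * π) * L) := by gcongr
      _ = ε / 3 * (T / (2 * π) * L) := by field_simp
  -- (2) the `k = 0` terms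
  have hQ0card : (Q₀.card : ℝ) ≤ Cw * (T * L) := by
    have hsub : Q₀ ⊆ (Ω.filter fun p ↦
        |Real.log T / (2 * π) * (zetaOrdinate p.1 - zetaOrdinate p.2) - 0| ≤ y₀) := by
      intro p hp
      rw [hQ₀, Finset.mem_filter, hQ, mem_nearPairs] at hp
      rw [Finset.mem_filter, sub_zero, ← pairSpacing_eq]
      exact ⟨hp.1.1, hp.2.trans he₀y.le⟩
    have hs : |(0 : ℝ)| + y₀ ≤ Real.log T / π := by
      rw [abs_zero, zero_add, le_div_iff₀ Real.pi_pos, ← hLdef]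
      linarith
    calc (Q₀.card : ℝ) ≤ ((Ω.filter fun p ↦
          |Real.log T / (2 * π) * (zetaOrdinate p.1 - zetaOrdinate p.2) - 0| ≤ y₀).card : ℝ) := by
          exact_mod_cast Finset.card_le_card hsub
      _ ≤ C_w * (T * L) := hwin 0 hs
      _ ≤ Cw * (T * L) := mul_le_mul_of_nonneg_right (le_max_left _ _) (by positivity)
  have hQ0sum : |∑ p ∈ Q₀, f p - (Q₀.card : ℝ)| ≤ ε / 3 * (T / (2 * π) * L) := by
    have e : (Q₀.card : ℝ) = ∑ p ∈ Q₀, (1 : ℝ) := by rw [Finset.sum_const, nsmul_eq_mul, mul_one]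
    rw [e, ← Finset.sum_sub_distrib]
    have hpt : ∀ p ∈ Q₀, |f p - 1| ≤ 2 * ε₁ := by
      intro p hp
      rw [hQ₀, Finset.mem_filter] at hp
      have hy : |pairSpacing T p| ≤ e₀ := hp.2
      set wv := montgomeryWeight (zetaOrdinate p.1 - zetaOrdinate p.2) with hwv
      have hw := one_sub_weight_le hL p
      rw [← hwv, ← hLdef] at hw
      have hw2 : 1 - wv ≤ ε₁ := by
        refine hw.2.trans ?_
        have h1 : π ^ 2 * pairSpacing T p ^ 2 / L ^ 2 ≤ π ^ 2 * pairSpacing T p ^ 2 := by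
          apply div_le_self (by positivity)
          exact one_le_pow₀ hL1
        have h2 : pairSpacing T p ^ 2 ≤ e₀ := by
          have := abs_le.mp hy
          have h3 : pairSpacing T p ^ 2 ≤ e₀ ^ 2 := by nlinarith [sq_abs (pairSpacing T p), abs_nonneg (pairSpacing T p)]
          nlinarith
        have h4 : π ^ 2 * e₀ ≤ ε₁ := by
          have := (lt_div_iff₀ (by positivity : (0 : ℝ) < π ^ 2)).mp he₀ε
          linarith
        nlinarith [Real.pi_pos]
      have hs1 : |Real.sinc (2 * π * pairSpacing T p) - 1| < ε₁ := by
        apply hsinc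
        rw [abs_mul, abs_of_pos (by positivity : (0 : ℝ) < 2 * π)]
        have := (lt_div_iff₀ (by positivity : (0 : ℝ) < 2 * π)).mp he₀η
        nlinarith [Real.pi_pos]
      have e2 : f p - 1 = (Real.sinc (2 * π * pairSpacing T p) - 1) * wv - (1 - wv) := by
        rw [hf]; ring
      rw [e2]
      calc |(Real.sinc (2 * π * pairSpacing T p) - 1) * wv - (1 - wv)|
          ≤ |(Real.sinc (2 * π * pairSpacing T p) - 1) * wv| + |1 - wv| := abs_sub _ _
        _ = |Real.sinc (2 * π * pairSpacing T p) - 1| * wv + (1 - wv) := by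
            rw [abs_mul, abs_of_pos (montgomeryWeight_pos _), abs_of_nonneg hw.1]
        _ ≤ ε₁ * 1 + ε₁ := add_le_add (mul_le_mul hs1.le (montgomeryWeight_le_one _)
            (montgomeryWeight_pos _).le hε₁0.le) hw2
        _ = 2 * ε₁ := by ring
    calc |∑ p ∈ Q₀, (f p - 1)| ≤ ∑ p ∈ Q₀, |f p - 1| := Finset.abs_sum_le_sum_abs _ _
      _ ≤ ∑ p ∈ Q₀, 2 * ε₁ := Finset.sum_le_sum hpt
      _ = 2 * ε₁ * Q₀.card := by rw [Finset.sum_const, nsmul_eq_mul, mul_comm]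
      _ ≤ 2 * ε₁ * (Cw * (T * L)) := by gcongr
      _ = ε / 3 * (T / (2 * π) * L) := by rw [hε₁]; field_simp; ring
  -- total
  rw [hsplit, ← hQ0bin]
  calc |∑ p ∈ Q₀, f p + ∑ p ∈ Q₁, f p - (Q₀.card : ℝ)|
      = |(∑ p ∈ Q₀, f p - (Q₀.card : ℝ)) + ∑ p ∈ Q₁, f p| := by ring_nf
    _ ≤ |∑ p ∈ Q₀, f p - (Q₀.card : ℝ)| + |∑ p ∈ Q₁, f p| := abs_add_le _ _
    _ ≤ ε / 3 * (T / (2 * π) * L) + ε / 3 * (T / (2 * π) * L) := add_le_add hQ0sum hQ1sum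
    _ ≤ ε * (T / (2 * π) * L) := by nlinarith

end AH

namespace AH

/-- **BGSTB 2025, Theorem 2 (core limit).** Assuming RH and Strong AH-Pairs, for every `0 < δ ≤ 1/2`
and `M ≥ 1`, `P_0(T) = |B_0|/((T/2π) log T) → 1` as `T → ∞` (i.e. `p_0 = 1`). Assembly of §4:
(Msum1) in `o(1)` form, the far/low pairs, and the `𝒬(T, 𝓜)` analysis, with `𝓜 → ∞` last (the bin
`B_0` does not depend on `𝓜`). [cite: BaluyotGoldstonSuriajayaTurnageButterbaugh2025, Theorem 2] -/
theorem tendsto_binDensity_zero_of_strong (hRH : RiemannHypothesis) (hSAH : StrongAHPairs) {δ : ℝ}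
    (hδ : 0 < δ) (hδ2 : δ ≤ 1 / 2) {M : ℝ} (hM : 1 ≤ M) :
    Tendsto (fun T : ℝ ↦ binDensity 0 T M δ) atTop (𝓝 1) := by
  rw [Metric.tendsto_nhds]
  intro ε hε
  obtain ⟨K, hK, hfar⟩ := eventually_abs_sum_sub_sum_nearPairs_le
  set 𝓜 : ℝ := 3 + 8 * K / ε with h𝓜def
  have h𝓜3 : 3 ≤ 𝓜 := by
    have : 0 ≤ 8 * K / ε := by positivity
    linarith
  have h𝓜0 : 0 < 𝓜 := by linarith
  have hK𝓜 : K / (𝓜 * (𝓜 - 2)) ≤ ε / 8 := by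
    have h1 : 𝓜 - 2 ≤ 𝓜 * (𝓜 - 2) := by nlinarith
    have h2 : 0 < 𝓜 - 2 := by linarith
    calc K / (𝓜 * (𝓜 - 2)) ≤ K / (𝓜 - 2) := div_le_div_of_nonneg_left hK.le h2 h1
      _ ≤ ε / 8 := by
          rw [div_le_iff₀ h2]
          have : ε / 8 * (𝓜 - 2) = ε / 8 + K := by rw [h𝓜def]; field_simp; ring
          have hε8 : 0 ≤ ε / 8 := by positivity
          linarith
  have h1 := (Metric.tendsto_nhds.mp (tendsto_sum_sinc_div hRH)) (ε / 8) (by positivity)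
  have h2 := hfar 𝓜 h𝓜3 (ε / 8) (by positivity)
  have h3 := eventually_abs_sum_nearPairs_sub_card_bin_le hRH h𝓜0 (hSAH 𝓜 h𝓜0) hδ hδ2 hM
    (ε := ε / 4) (by positivity)
  filter_upwards [h1, h2, h3, eventually_gt_atTop (1 : ℝ)] with T hS hFar hQ hT
  have hN : 0 < T / (2 * π) * Real.log T := mul_pos (by positivity) (Real.log_pos hT)
  set N := T / (2 * π) * Real.log T with hNdef
  set S := ∑ p ∈ zeroIndexSet T ×ˢ zeroIndexSet T,
    Real.sinc (2 * π * pairSpacing T p) * montgomeryWeight (zetaOrdinate p.1 - zetaOrdinate p.2) with hSdef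
  set SQ := ∑ p ∈ nearPairs T 𝓜,
    Real.sinc (2 * π * pairSpacing T p) * montgomeryWeight (zetaOrdinate p.1 - zetaOrdinate p.2) with hSQdef
  rw [Real.dist_eq] at hS ⊢
  unfold binDensity
  rw [← hNdef]
  have hS' : |S - N| < ε / 8 * N := by
    have e : S - N = (S / N - 1) * N := by field_simp
    rw [e, abs_mul, abs_of_pos hN]
    exact mul_lt_mul_of_pos_right hS hN
  have hFar' : |S - SQ| ≤ ε / 4 * N := by
    refine hFar.trans ?_
    apply mul_le_mul_of_nonneg_right _ hN.le
    linarith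
  have e : ((bin 0 T M δ).card : ℝ) / N - 1 = (((bin 0 T M δ).card : ℝ) - N) / N := by field_simp
  rw [e, abs_div, abs_of_pos hN, div_lt_iff₀ hN]
  calc |((bin 0 T M δ).card : ℝ) - N| = |(S - N) - (S - SQ) - (SQ - ((bin 0 T M δ).card : ℝ))| := by ring_nf
    _ ≤ |S - N| + |S - SQ| + |SQ - ((bin 0 T M δ).card : ℝ)| := by
        exact (abs_sub _ _).trans (add_le_add (abs_sub _ _) le_rfl)
    _ < ε / 8 * N + ε / 4 * N + ε / 4 * N := by linarith
    _ ≤ ε * N := by nlinarith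

end AH

/-- **BGSTB 2025, Theorem 2 — DISCHARGED.** Assuming RH and Strong AH-Pairs, `P_0(T) ∼ 1`, so that
`p_0 = 1` exists (for every bin half-width `0 < δ ≤ 1/2`; the typed `∀ᶠ M` form holds for all
`M ≥ 1`). [cite: BaluyotGoldstonSuriajayaTurnageButterbaugh2025, Theorem 2] -/
theorem bgstb2025_theorem2_holds : bgstb2025_theorem2 := by
  intro hRH hSAH δ hδ hδ2
  show ∀ᶠ M : ℝ in atTop, Tendsto (fun T : ℝ ↦ AH.binDensity 0 T M δ) atTop (𝓝 1)
  filter_upwards [eventually_ge_atTop (1 : ℝ)] with M hM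
  exact AH.tendsto_binDensity_zero_of_strong hRH hSAH hδ hδ2 hM

end Literature.NumberTheory.LFunctions

end
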